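/-
Copyright: cell `langlands-arthur-audit` (papers/Langlands/langlands-arthur-audit), unit `pub-arthur-down-g30`
(downstream tracer, gen 30).  Eighth file of the exact-support certificates of the downstream register (module M179 of the
cell's MODULE-MAP; v1 / v2 said M170 — renumbered by CLAIM order, `lean/MODULE-MAP2.md` ruling of 2026-08-21T15:02Z): `DownstreamSupport.lean` … `DownstreamSupport6.lean` and `DownstreamSupport7.lean` (sections 59–68; v8 ≈
153,000 bytes = 77 % of the gate's 200 000-byte file cap) are full or nearly so, so the certificates continue here,
APPEND-ONLY in the same conventions and the same namespace `…Arthur2013.Downstream.Support`; v1 = section 69, the supports of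
the sixty-sixth tranche (`Downstream17.lean` v3: THE UNITARY LINE — five consumers of Mok's memoir — C58 `GrbacShahidiAsai`, C52
`JZUnitaryNonvanishing`, C54 `IchinoThetaReal`, C53 `FinisLapidTWN`, E7 `ATLevelRaising`; `canon₆₆`, `canon_implications₆₆`,
`sixtysixth_holds_top`, `mokLine_book_cm`, `mokLine_mok_cm`, `mokLine_kmsw_cm`, `mokLine_regraded`); and section 70, the supports of the
sixty-seventh tranche (`Downstream18.lean` v1 — hence `import …Downstream18` —: SHIMURA VARIETIES AND PERIODS UNDER STATED HYPOTHESES — C69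
`MorelSuhSign` / `MorelSuhSiegel` with node `MorelSuhCondC`, C66 `IchinoPrasannaHodge` with node `IPGaloisHyp`, C41 `FMBessel` / `FMBesselGeneral`, C42
`BhagwatRaghuramO2n`; `canon₆₇`, `canon₆₇no`, `canon_implications₆₇/₆₇no`, `sixtyseventh_holds_top`, `periods_need_nodes_top`, `periods_book_cm`,
`periods_mok_cm`, `periods_kmsw_cm`, `periods_regraded`); and section 74, the supports of the
seventy-first tranche (`Downstream19.lean` v1 — hence `import …Downstream19` —: LEVEL ONE, CONDUCTOR p, AND A p-ADIC L-FUNCTION — C59 `DummiganLifts`, C47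
`LachausseeConducteur`, C80 `EHLSpadicL` with node `EHLSMultOne`; `canon₇₁`, `canon₇₁no`, `canon_implications₇₁/₇₁no`, `seventyfirst_holds_top`, `levelOne_needs_node_top`,
`levelOne_book_cm`, `levelOne_mok_cm`, `levelOne_kmsw_cm`, `levelOne_regraded`; sections 71–73 — the supports of tranches 68–70, `Downstream18.lean` v2, at the gate —
follow in later versions); v2 (unit `pub-arthur-down-g30`, APPEND-ONLY) = section 71, the supports of the sixty-eighth tranche (`Downstream18.lean` v2: ARITHMETIC GEOMETRY AND L-VALUES, UNITARY AND SYMPLECTIC — C65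
`NguyenKottwitzPEL`, C68 `HarronJorzaLinvariant`, C98 `ClozelKretRankin`, C70 `HMYBallQuotients`, C79 `GHLDelignePeriods`; `canon₆₈`, `canon_implications₆₈`,
`sixtyeighth_holds_top`, `arithmeticII_book_cm`, `arithmeticII_mok_cm`, `arithmeticII_kmsw_cm`, `arithmeticII_regraded`) and section 72, the supports of the sixty-ninth tranche (`Downstream18.lean` v2, second half: MULTIPLICITY ONE AND THE STABLE TRACE FORMULA AS SIDE
INPUTS — C72 `BRCuspidalCohomology`, C75 `AtanasovHarrisTW`, C81 `GuerberoffCriticalValues` with node `GuerberoffHypMult`, C36 `ZhuOrthogonalIH` with node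
`ZhuHyp202`; `canon₆₉`, `canon₆₉no`, `canon_implications₆₉/₆₉no`, `sixtyninth_holds_top`, `sideInputs_need_nodes_top`, `sideInputs_book_cm`, `sideInputs_mok_cm`,
`sideInputs_kmsw_cm`, `sideInputs_regraded`) and section 73, the supports of the seventieth tranche (`Downstream18.lean` v2, third part: RECENT CONSUMERS OF THE MULTIPLICITY FORMULA — C122
`WanSelmerUrs`, C40 `PengWhitmoreRT`, C128 / C157 `KimYamauchiSp6`, C92 `MullerTheta`; `canon₇₀`, `canon_implications₇₀`, `seventieth_holds_top`,
`recentAMF_book_cm`, `recentAMF_mok_cm`, `recentAMF_kmsw_cm`, `recentAMF_regraded`) and section 75, the supports of the seventy-second tranche (`Downstream19.lean` v2: THE ANTICYCLOTOMIC LINE AND TWO CONSTRUCTIONS — C123 `LaiWallCrossing`,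
C22 `LaiSkinnerEuler`, C133 `KimYamauchiGSpin210` with node `KYTransferHyp`, C129 `ItoDoubleDescent`; `canon₇₂`, `canon₇₂no`, `canon_implications₇₂/₇₂no`,
`seventysecond_holds_top`, `anticyclotomic_needs_node_top`, `anticyclotomic_book_cm`, `anticyclotomic_mok_cm`, `anticyclotomic_kmsw_cm`, `anticyclotomic_regraded`); v3 (unit `pub-arthur-down-g31`, gen 31, APPEND-ONLY) = section 76, the supports of the seventy-third tranche (`Downstream19.lean` v3: PERIODS, POLES AND DISTINCTION THROUGH THE PARAMETER — C132
`JiangWuChiB`, C138 `JZBesselDescents`, C137 `MitraOffenSpDist`, C134 `BRWRPoincare`; `canon₇₃`, `canon₇₃no9`, `canon_implications₇₃/₇₃no9`, `e43_canon_top`,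
`seventythird_holds_top`, `periodsPoles_need_ch9_top`, `periodsPoles_book_cm`, `periodsPoles_mok_cm`, `periodsPoles_kmsw_cm`, `periodsPoles_regraded`); v4 (unit `pub-arthur-down-g31`, gen 31, APPEND-ONLY) = section 77, the supports of the seventy-fourth tranche (`Downstream20.lean` v1, a NEW register file — hence the new `import …Downstream20` —: THE UNITARY
SHIMURA – GALOIS LINE — C33 `RSZHeckeKunneth`, C141 `FPWeaklyRegular`, C140 `BergerWeissSigns`, C136 `JNSRigidFamilies`; `canon₇₄`, `canon_implications₇₄`,
`seventyfourth_holds_top`, `unitaryGalois_book_cm`, `unitaryGalois_mok_cm`, `unitaryGalois_kmsw_cm`, `unitaryGalois_regraded`); v5 (unit `pub-arthur-down-g31`, gen 31 — sections prepared and validated there, filed unchanged by unit `pub-arthur-down-g32` —, APPEND-ONLY) = sections 78 and 79, the supports of the seventy-fifth tranche (`Downstream20.lean` v2: UNITARY DESCENT AND MULTIPLICITY ONE — C125 `JLinPeriods`, C106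
`ChaudouardZydorGGP`, C150 `HarrisMultOne` / `HarrisSquareRoot`, C151 `SorensenIhara` / `SorensenMultOne` / `SorensenLLCFamilies`; `canon₇₅`, `canon_implications₇₅`,
`canon₃₄_bpPlancherel_of`, `seventyfifth_holds_top`, `multOne_book_cm`, `multOne_mok_cm`, `multOne_kmsw_cm`, `multOne75_regraded`) and of the seventy-sixth tranche (THE BOOK AS
ANNOUNCED AND TWO MODEL CITATIONS — C169 `MoeglinPairesL`, C179 `JLZResidualPoles`, C145 `TakanashiParity`, C30 `DSHermitianParameters`; `canon₇₆`, `canon₇₆no9`,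
`canon_implications₇₆`, `canon_implications₇₆no9`, `seventysixth_holds_top`, `announced76_need_ch9_top`, `announced76_book_cm`, `announced76_mok_cm`, `announced76_kmsw_cm`,
`announced76_regraded`); with v5 this file is CLOSED (78 % of the cap) — the supports of tranche 77 open `DownstreamSupport9.lean`.  Nothing of the first seven
files is redeclared or changed.
-/
import HarnessLib
import Literature.NumberTheory.Automorphic.Arthur2013.DownstreamSupport7
import Literature.NumberTheory.Automorphic.Arthur2013.Downstream17
import Literature.NumberTheory.Automorphic.Arthur2013.Downstream18
import Literature.NumberTheory.Automorphic.Arthur2013.Downstream19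
import Literature.NumberTheory.Automorphic.Arthur2013.Downstream20

/-!
# Downstream of Arthur (2013): exact leaf support of the downstream register, eighth file (sections ≥ 69)

**Source reproduced.**  Nothing beyond what `Downstream.lean` … `Downstream19.lean` transcribe (the downstream
authors' own sentences, cited there chunk by chunk) and what the three leaf-support modules certify
(`Arthur2013/LeafSupport.lean`, `Mok2015/LeafSupport.lean`, `KMSW2014/LeafSupport.lean`: for every leaf a
kernel-checked countermodel of the DAG as typed).  As in the first seven files: a CANONICAL READING assigns to each
typed downstream statement the conjunction of DAG outputs its edge receives, the tranche's edges are shown to hold in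
that reading for arbitrary node assignments, and the countermodels then give the « only if » half of each support —
which leaves are load-bearing for which downstream theorem, in the register AS TYPED (a statement about the cell's
transcription, not about the mathematics).  [cite: Arthur2013, §1.5 with AGIKMS2024 l.380-382 (the conditional
reading whose supports are certified)]

**v1 (section 69; unit `pub-arthur-down-g30`).**  The sixty-sixth tranche (`Downstream17.lean` v3) types THE UNITARY LINE — five consumers of Mok's
memoir: C58 `GrbacShahidiAsai` (Grbac – Shahidi, PJM 2015 ⇐ Mok), C52 `JZUnitaryNonvanishing` (Jiang – Zhang, JEMS 2020 ⇐ Mok ∧ KMSW's scope), C54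
`IchinoThetaReal` (Ichino 2020/2022 ⇐ Mok ∧ KMSW in full), C53 `FinisLapidTWN` (Finis – Lapid 2017 ⇐ book ∧ Mok), E7 `ATLevelRaising` (Anastassiades –
Thorne, JIMJ 2022 ⇐ Mok ∧ KMSW's node `StabOrdI`).  Certified here (canonical reading `canon₆₆`: each statement := the conjunction of the DAG outputs
its edge receives): every sixty-sixth edge holds for arbitrary ν, μ, κ (`canon_implications₆₆`); all five hold at the top, KMSW's two sequels granted
(`sixtysixth_holds_top`, through `mokLine_of_rows`); EXACT SUPPORTS AS TYPED: in the book countermodel of ANY leaf C53 FAILS and the four unitary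
rows HOLD (`mokLine_book_cm`); in Mok's countermodel of ANY of its 29 leaves ALL FIVE FAIL (`mokLine_mok_cm`); in KMSW's countermodel of a leaf l ≠
MokMain (`mokLine_kmsw_cm`): C58 and C53 HOLD, C54 FAILS for EVERY such leaf (sequels included — the K1 flag certified), C52 holds IFF `l.onlyFull`
(KMSW's proved scope), E7 holds IFF `l.stabOrdI = false` (StabOrdI's five suppliers, none of them a sequel — the authors' avoidance certified).  In one
statement (`mokLine_regraded`): support(C58) = Mok 29; support(C52) = Mok 29 ∪ KMSW's scope leaves; support(C54) = Mok 29 ∪ every KMSW leaf;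
support(C53) = book 24 ∪ Mok 29; support(E7) = Mok 29 ∪ {FL, WFL_split, WFL_general, STF, Transfer of KMSW's DAG}.

**v1 (section 70; unit `pub-arthur-down-g30`).**  The sixty-seventh tranche (`Downstream18.lean` v1, a NEW register file) types SHIMURA VARIETIES AND
PERIODS UNDER STATED HYPOTHESES: C69 Morel – Suh 2019 (node `MorelSuhCondC`; `MorelSuhSign` ⇐ node; `MorelSuhSiegel` ⇐ book ∧ A7), C66 Ichino –
Prasanna 2023 (node `IPGaloisHyp`; `IchinoPrasannaHodge` ⇐ Mok ∧ KMSW in full ∧ node), C41 Furusawa – Morimoto 2021 (`FMBessel` ⇐ book;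
`FMBesselGeneral` ⇐ book ∧ Chapter-9 node ∧ `FMBessel`), C42 Bhagwat – Raghuram 2025 (`BhagwatRaghuramO2n` ⇐ book ∧ B3).  Certified here (canonical
reading `canon₆₇` with the three nodes GRANTED, over `canon`, `canon₆`, `canon₈`; and `canon₆₇no` with condition (C), the Galois input and Chapter 9
DENIED, over `canon₈no`): every edge holds for arbitrary ν, μ, κ in both readings (`canon_implications₆₇`, `canon_implications₆₇no`); all six
statements hold at the top with the nodes granted (`sixtyseventh_holds_top`); with every DAG input granted but the nodes denied, `MorelSuhSign`,
`IchinoPrasannaHodge`, `FMBesselGeneral` FAIL and `MorelSuhSiegel`, `FMBessel`, `BhagwatRaghuramO2n` HOLD (`periods_need_nodes_top`) — the three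
hypothesis-carrying statements are exactly the three their authors flag; EXACT SUPPORTS AS TYPED: in the book countermodel of ANY leaf the four
book rows FAIL while `MorelSuhSign` (node only) and `IchinoPrasannaHodge` (unitary) HOLD (`periods_book_cm`); in Mok's countermodel of ANY leaf only
`IchinoPrasannaHodge` FAILS (`periods_mok_cm`); in KMSW's countermodel of ANY leaf l ≠ MokMain only `IchinoPrasannaHodge` FAILS — for every leaf, both
sequels included: the authors' « tentative » status certified (`periods_kmsw_cm`).  In one statement (`periods_regraded`): support(MorelSuhSiegel) =
support(FMBessel) = support(C42) = book 24; support(FMBesselGeneral) = book 24 ∪ {Chapter 9}; support(C66) = Mok 29 ∪ every KMSW leaf ∪ {its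
node}; support(MorelSuhSign) = {its node}.

**v1 (section 74; unit `pub-arthur-down-g30`).**  The seventy-first tranche (`Downstream19.lean` v1, a NEW register file — hence `import …Downstream19`)
types LEVEL ONE, CONDUCTOR p, AND A p-ADIC L-FUNCTION: C59 Dummigan 2017 (`DummiganLifts` ⇐ book ∧ C3 ∧ `AMR`), C47 Lachaussée 2020 (`LachausseeConducteur` ⇐
book ∧ A3 ∧ `AMR`), C80 Eischen – Harris – Li – Skinner 2020 (node `EHLSMultOne`; `EHLSpadicL` ⇐ node).  Certified here (`canon₇₁` with the node GRANTED,
over `canon`; `canon₇₁no` with it DENIED): every edge holds for arbitrary ν, μ, κ in both readings (`canon_implications₇₁/₇₁no`); all three hold at the top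
(`seventyfirst_holds_top`); with every DAG input granted but the node denied C80 FAILS and C59, C47 HOLD (`levelOne_needs_node_top`); EXACT SUPPORTS AS TYPED:
in the book countermodel of ANY leaf C59 and C47 FAIL and C80 HOLDS (`levelOne_book_cm`); in Mok's countermodel of ANY leaf and in KMSW's countermodel of ANY
leaf l ≠ MokMain all three HOLD (`levelOne_mok_cm`, `levelOne_kmsw_cm`).  In one statement (`levelOne_regraded`): support(C59) = support(C47) = book 24;
support(C80) = {its node}.

**v2 (section 71; unit `pub-arthur-down-g30`).**  The sixty-eighth tranche (`Downstream18.lean` v2) types ARITHMETIC GEOMETRY AND L-VALUES, UNITARY AND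
SYMPLECTIC: C65 Nguyen 2023 (`NguyenKottwitzPEL` ⇐ Mok ∧ KMSW's scope), C68 Harron – Jorza 2017 (`HarronJorzaLinvariant` ⇐ book ∧ Mok ∧ C191), C98 Clozel –
Kret 2025 (`ClozelKretRankin` ⇐ book), C70 Horinaga – Maeda – Yamauchi 2025 (`HMYBallQuotients` ⇐ Mok ∧ KMSW in full), C79 Grobner – Harris – Lin 2025
(`GHLDelignePeriods` ⇐ Mok ∧ KMSW's scope).  Certified here (canonical reading `canon₆₈` over `canon₂₈`): every edge holds for arbitrary ν, μ, κ
(`canon_implications₆₈`); all five hold at the top (`sixtyeighth_holds_top`); EXACT SUPPORTS AS TYPED: in the book countermodel of ANY leaf C68 and C98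
FAIL, the three unitary rows HOLD (`arithmeticII_book_cm`); in Mok's countermodel of ANY leaf the four Mok-premised rows FAIL and C98 HOLDS
(`arithmeticII_mok_cm`); in KMSW's countermodel of ANY leaf l ≠ MokMain C70 FAILS while C68, C98 hold, and C65 / C79 HOLD iff `l.onlyFull` — in the
countermodels of the two sequels and of the non-generic chapters — and FAIL for KMSW's proved-scope leaves (`arithmeticII_kmsw_cm`).  In one statement
(`arithmeticII_regraded`): support(C65) = support(C79) = Mok 29 ∪ KMSW's scope leaves; support(C68) = book 24 ∪ Mok 29; support(C98) = book 24;
support(C70) = Mok 29 ∪ every KMSW leaf, both sequels included.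

**v2 (section 72; unit `pub-arthur-down-g30`).**  The sixty-ninth tranche (`Downstream18.lean` v2, second half) types MULTIPLICITY ONE AND THE STABLE
TRACE FORMULA AS SIDE INPUTS: C72 Bhagwat – Raghuram 2015 (`BRCuspidalCohomology` ⇐ book ∧ Mok ∧ C51), C75 Atanasov – Harris 2025 (`AtanasovHarrisTW` ⇐
KMSW's scope), C81 Guerberoff 2018 (node `GuerberoffHypMult`; `GuerberoffCriticalValues` ⇐ node), C36 Y. Zhu 2018 (node `ZhuHyp202`; `ZhuOrthogonalIH` ⇐ book
∧ A3 ∧ node).  Certified here (`canon₆₉` with the two nodes GRANTED, over `canon`, `canon₆₅`; `canon₆₉no` with them DENIED): every edge holds for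
arbitrary ν, μ, κ in both readings (`canon_implications₆₉`, `canon_implications₆₉no`); all four hold at the top (`sixtyninth_holds_top`); with every DAG
input granted but the nodes denied C81 and C36 FAIL, C72 and C75 HOLD (`sideInputs_need_nodes_top`); EXACT SUPPORTS AS TYPED: in the book countermodel of
ANY leaf C72 and C36 FAIL, C75 and C81 HOLD (`sideInputs_book_cm`); in Mok's countermodel of ANY leaf C72 FAILS and so does C75 — KMSW's scope imports Mok —
while C81, C36 HOLD (`sideInputs_mok_cm`); in KMSW's countermodel of ANY leaf l ≠ MokMain C72, C81, C36 HOLD and C75 HOLDS iff `l.onlyFull` (it fails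
exactly for the proved-scope leaves; both sequels irrelevant) (`sideInputs_kmsw_cm`).  In one statement (`sideInputs_regraded`): support(C72) = book 24 ∪
Mok 29; support(C75) = KMSW's scope leaves ∪ Mok 29; support(C81) = {its node}; support(C36) = book 24 ∪ {its node}.

**v2 (section 73; unit `pub-arthur-down-g30`).**  The seventieth tranche (`Downstream18.lean` v2, third part) types RECENT CONSUMERS OF THE MULTIPLICITY
FORMULA: C122 X. Wan 2019 (`WanSelmerUrs` ⇐ Mok ∧ KMSW's scope), C40 Peng – Whitmore 2026 (`PengWhitmoreRT` ⇐ book), C128 / C157 Kim – Yamauchi 2025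
(`KimYamauchiSp6` ⇐ book ∧ C55), C92 Müller 2026 (`MullerTheta` ⇐ book ∧ C5 ∧ A3).  Certified here (`canon₇₀` over `canon`, `canon₃₃`): every edge holds for
arbitrary ν, μ, κ (`canon_implications₇₀`); all four hold at the top (`seventieth_holds_top`); EXACT SUPPORTS AS TYPED: in the book countermodel of ANY leaf
the three book rows FAIL and C122 HOLDS (`recentAMF_book_cm`); in Mok's countermodel of ANY leaf only C122 FAILS (`recentAMF_mok_cm`); in KMSW's countermodel
of ANY leaf l ≠ MokMain the book rows HOLD and C122 HOLDS iff `l.onlyFull` — it fails exactly for the proved-scope leaves (`recentAMF_kmsw_cm`).  In one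
statement (`recentAMF_regraded`): support(C122) = Mok 29 ∪ KMSW's scope leaves; support(C40) = support(C128) = support(C92) = book 24.

**v2 (section 75; unit `pub-arthur-down-g30`).**  The seventy-second tranche (`Downstream19.lean` v2) types THE ANTICYCLOTOMIC LINE AND TWO CONSTRUCTIONS: C123
S. Lai 2024 (`LaiWallCrossing` ⇐ KMSW's scope), C22 Lai – Skinner 2024 (`LaiSkinnerEuler` ⇐ KMSW's scope), C133 Kim – Yamauchi 2018 (node `KYTransferHyp`;
`KimYamauchiGSpin210` ⇐ book ∧ node), C129 Ito 2025 (`ItoDoubleDescent` ⇐ book ∧ A5 in full).  Certified here (`canon₇₂` with the node GRANTED, over `canon`;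
`canon₇₂no` with it DENIED): every edge holds for arbitrary ν, μ, κ in both readings (`canon_implications₇₂/₇₂no`); all four hold at the top
(`seventysecond_holds_top`); with every DAG input granted but the node denied C133 FAILS and the other three HOLD (`anticyclotomic_needs_node_top`); EXACT
SUPPORTS AS TYPED: in the book countermodel of ANY leaf C133 and C129 FAIL, C123 and C22 HOLD (`anticyclotomic_book_cm`); in Mok's countermodel of ANY leaf C123
and C22 FAIL — KMSW's scope imports Mok — and C133, C129 HOLD (`anticyclotomic_mok_cm`); in KMSW's countermodel of ANY leaf l ≠ MokMain C133, C129 HOLD and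
C123, C22 HOLD iff `l.onlyFull` — they fail exactly for the proved-scope leaves, both sequels irrelevant (`anticyclotomic_kmsw_cm`).  In one statement
(`anticyclotomic_regraded`): support(C123) = support(C22) = KMSW's scope leaves ∪ Mok 29; support(C133) = book 24 ∪ {its node}; support(C129) = book 24 (∪
Ishimoto's sequel node, True in `canon`).

**v3 (section 76; unit `pub-arthur-down-g31`).**  The seventy-third tranche (`Downstream19.lean` v3) types PERIODS, POLES AND DISTINCTION THROUGH THE
PARAMETER: C132 Jiang – Wu 2016 (`JiangWuChiB` ⇐ Mok ∧ KMSW in full), C138 Jiang – Zhang 2021 (`JZBesselDescents` ⇐ book ∧ Chapter-9 node ∧ row C16),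
C137 Mitra – Offen 2021 (`MitraOffenSpDist` ⇐ Mok ∧ `Consumers51.MoeglinTadicDS` ∧ `Consumers45.MoeglinUnitaryDS`), C134 Bringmann – Richter –
Westerholt-Raum 2016 (`BRWRPoincare` ⇐ book).  Certified here (canonical reading `canon₇₃` over `canon₈`, `canon₄₅`, `canon₅₁`, Chapter 9 GRANTED; `canon₇₃no9`
over `canon₈no`, Chapter 9 DENIED): every edge holds for arbitrary ν, μ, κ in both readings (`canon_implications₇₃`, `canon_implications₇₃no9`); all four
hold at the top, KMSW's two sequels granted (`seventythird_holds_top`); with every DAG input granted but the Chapter-9 node denied C138 FAILS and the other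
three HOLD (`periodsPoles_need_ch9_top`); EXACT SUPPORTS AS TYPED: in the book countermodel of ANY leaf C138, C137, C134 FAIL and C132 HOLDS
(`periodsPoles_book_cm` — C137 through tranche 51's (BA) edge, which reads the Mœglin – Tadić classification as « the book »: declared); in Mok's countermodel
of ANY leaf C132, C138, C137 FAIL and C134 HOLDS (`periodsPoles_mok_cm` — C138 through row C16's unitary half: declared); in KMSW's countermodel of ANY leaf
l ≠ MokMain C132 FAILS FOR EVERY SUCH LEAF, the two SEQUELS included (the unflagged K1 dependence, certified), C137 and C134 HOLD, and C138 HOLDS iff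
`l.onlyFull` (again through C16's typed scope premise) (`periodsPoles_kmsw_cm`).  In one statement (`periodsPoles_regraded`): support(C132) = Mok 29 ∪ every
KMSW leaf; support(C138) = book 24 ∪ {Chapter 9} ∪ Mok 29 ∪ KMSW's scope leaves (the last two via C16 as typed); support(C137) = Mok 29 ∪ book 24 (via
tranche 51); support(C134) = book 24.

**v4 (section 77; unit `pub-arthur-down-g31`).**  The seventy-fourth tranche (`Downstream20.lean` v1, a NEW register file — hence `import …Downstream20`)
types THE UNITARY SHIMURA – GALOIS LINE: C33 Rapoport – Smithling – Zhang 2020 (`RSZHeckeKunneth` ⇐ Mok ∧ KMSW in full ∧ `AMR`; the census's EXCEEDS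
row), C141 Fakhruddin – Pilloni 2023 (`FPWeaklyRegular` ⇐ Mok), C140 Berger – Weiss 2022 (`BergerWeissSigns` ⇐ Mok ∧ C141), C136 Johansson – Newton –
Sorensen 2020 (`JNSRigidFamilies` ⇐ KMSW's scope).  Certified here (canonical reading `canon₇₄` over `canon`): every edge holds for arbitrary ν, μ, κ
(`canon_implications₇₄`); all four hold at the top, KMSW's two sequels granted (`seventyfourth_holds_top`); EXACT SUPPORTS AS TYPED: in the book
countermodel of ANY leaf C33 FAILS — through `AMR` (tranche 1: ⇐ book), the only book premise of the tranche — and C141, C140, C136 HOLD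
(`unitaryGalois_book_cm`); in Mok's countermodel of ANY leaf ALL FOUR FAIL — C136 because KMSW read without its import of Mok has no scope
(`unitaryGalois_mok_cm`); in KMSW's countermodel of ANY leaf l ≠ MokMain C33 FAILS FOR EVERY SUCH LEAF, the two SEQUELS included — « (and its sequels) …
known » certified load-bearing as typed —, C141 and C140 HOLD (no KMSW premise), C136 HOLDS iff `l.onlyFull` (KMSW's proved scope, the authors'
Remark 2.1) (`unitaryGalois_kmsw_cm`).  In one statement (`unitaryGalois_regraded`): support(C33) = Mok 29 ∪ every KMSW leaf ∪ book 24 (via `AMR`);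
support(C141) = support(C140) = Mok 29; support(C136) = KMSW's scope leaves ∪ Mok 29.

**v5 (section 78; unit `pub-arthur-down-g31`).**  The seventy-fifth tranche (`Downstream20.lean` v2) types UNITARY DESCENT AND MULTIPLICITY ONE — TWO USES,
TWO HYPOTHESES: C125 J. Lin 2015 (`JLinPeriods` ⇐ KMSW's scope ∧ Mok), C106 Chaudouard – Zydor 2021 (`ChaudouardZydorGGP` ⇐ Mok ∧ KMSW's scope), C150
M. Harris 2021 (node `HarrisMultOne` with supplier edge ⇐ KMSW in full; `HarrisSquareRoot` ⇐ node ∧ C25), C151 Sorensen 2016 (node `SorensenIhara`, no supplier;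
node `SorensenMultOne` with supplier edge ⇐ KMSW in full; `SorensenLLCFamilies` ⇐ the two nodes).  Certified here (canonical reading `canon₇₅` over `canon₃₄`;
the Ihara node := `True`, i.e. granted): every edge holds for arbitrary μ, κ (`canon_implications₇₅`); all six non-trivial fields hold at the top, KMSW's two
sequels granted (`seventyfifth_holds_top`); NO BOOK PREMISE anywhere — the reading does not mention the book's nodes, so every book countermodel leaves the
tranche intact (`multOne_book_cm`); in Mok's countermodel of ANY leaf ALL SIX FAIL (`multOne_mok_cm`); in KMSW's countermodel of ANY leaf l ≠ MokMain the two
USES (C125, C106) HOLD iff `l.onlyFull` — KMSW's proved scope — while the two HYPOTHESES and the two theorems read through them FAIL FOR EVERY SUCH LEAF, the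
two SEQUELS included: Harris's « will be proved in the sequel to [KMSW] » and Sorensen's « work in progress of Kaletha, Shin, and White » (his G attached to
a division algebra: [KMS_B]) certified load-bearing as typed (`multOne_kmsw_cm`).  In one statement (`multOne75_regraded`): support(C125) = support(C106) =
KMSW's scope leaves ∪ Mok 29; support(`HarrisMultOne`) = support(`SorensenMultOne`) = support(C150 Thm 9) = support(C151 Thm 1) ⊇ every KMSW leaf ∪ Mok 29
(C150 adds C25's support, C151 the Ihara node); book 24 ∩ support = ∅ for all seven fields.

**v5 (section 79; unit `pub-arthur-down-g31`).**  The seventy-sixth tranche (`Downstream20.lean` v2, second part) types THE BOOK AS ANNOUNCED (2011–2013) AND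
TWO MODEL CITATIONS OF THE UNITARY CLASSIFICATION: C169 Mœglin 2012 (`MoeglinPairesL` ⇐ book ∧ Chapter-9 node), C179 Jiang – Liu – Zhang 2013
(`JLZResidualPoles` ⇐ book), C145 Takanashi 2025 (`TakanashiParity` ⇐ Mok), C30 Dummigan – Schönnenbeck 2021 (`DSHermitianParameters` ⇐ KMSW in full,
flagged by the authors).  Certified here (canonical reading `canon₇₆` over `canon₈`, Chapter 9 GRANTED; `canon₇₆no9` over `canon₈no`, Chapter 9 DENIED): every
edge holds for arbitrary ν, μ, κ in both readings (`canon_implications₇₆`, `canon_implications₇₆no9`); all four hold at the top, KMSW's two sequels granted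
(`seventysixth_holds_top`); with every DAG input granted but the Chapter-9 node denied C169 FAILS and the other three HOLD (`announced76_need_ch9_top` —
Mœglin's « groupe classique auquel s'applique les travaux d'Arthur », quasi-split only at the real places, as typed); EXACT SUPPORTS AS TYPED: in the book
countermodel of ANY leaf C169 and C179 FAIL, C145 and C30 HOLD (`announced76_book_cm`); in Mok's countermodel of ANY leaf C145 and C30 FAIL (C30: KMSW read
without its import of Mok has no full statements), C169 and C179 HOLD (`announced76_mok_cm`); in KMSW's countermodel of ANY leaf l ≠ MokMain C30 FAILS FOR
EVERY SUCH LEAF, the two SEQUELS included — exactly the authors' « conditional on what will be written up in later papers » —, the other three HOLD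
(`announced76_kmsw_cm`).  In one statement (`announced76_regraded`): support(C169) = book 24 ∪ {Chapter 9}; support(C179) = book 24; support(C145) = Mok 29;
support(C30) = every KMSW leaf ∪ Mok 29.

**Deliberately not here.**  Any claim about the content or truth of a downstream statement; no new named fact (every
canonical value is written out); no Mathlib, no `axiom`, no `sorry`, no `opaque`.
-/

set_option autoImplicit false

namespace Literature.NumberTheory.Automorphic.Arthur2013

namespace Downstream

namespace Support

/-! ## 69. Sixty-sixth tranche (v1 of this file, after `Downstream17.lean` v3; unit `pub-arthur-down-g30`): supports of THE UNITARY LINE —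
C58 `GrbacShahidiAsai`, C52 `JZUnitaryNonvanishing`, C54 `IchinoThetaReal`, C53 `FinisLapidTWN`, E7 `ATLevelRaising`; see the module docstring for
the summary of what is certified. -/

section Canon66

variable (ν : Nodes) (μ : Mok2015.Nodes) (κ : KMSW2014.Nodes)

/-- The canonical reading of the sixty-sixth tranche: C58 := Mok; C52 := Mok ∧ KMSW's scope; C54 := Mok ∧ KMSW in full; C53 := book ∧ Mok; E7 := Mok ∧ `StabOrdI`. [cite: GrbacShahidi2015, Thm 4.3; JiangZhang2020Nonvanishing, Thm 1.3; Ichino2022ThetaReal, Thm 1.1; FinisLapid2017Normalizing, Thm 3.11; AnastassiadesThorne2022, Thm 1 (canonical model; bookkeeping)] -/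
abbrev canon₆₆ : Consumers66 where
  GrbacShahidiAsai := (∀ N, μ.Everything N)
  JZUnitaryNonvanishing := (∀ N, μ.Everything N) ∧ (∀ N, κ.Scope N)
  IchinoThetaReal := (∀ N, μ.Everything N) ∧ (∀ N, κ.Full N)
  FinisLapidTWN := (∀ N, ν.Everything N) ∧ (∀ N, μ.Everything N)
  ATLevelRaising := (∀ N, μ.Everything N) ∧ κ.StabOrdI

/-- Every sixty-sixth-tranche edge holds in the canonical reading, for arbitrary ν, μ, κ. [cite: GrbacShahidi2015, §1; AnastassiadesThorne2022, §3 (bookkeeping proved here)] -/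
theorem canon_implications₆₆ : Implications66 ν μ κ (canon₆₆ ν μ κ) where
  grbacShahidi := fun m => m
  jiangZhang := fun m s => ⟨m, s⟩
  ichino := fun m f => ⟨m, f⟩
  finisLapid := fun b m => ⟨b, m⟩
  anastassiadesThorne := fun m o => ⟨m, o⟩

end Canon66

/-- At the top (every input of the three DAGs, KMSW's two sequels granted) all five statements hold — through the tranche's own `mokLine_of_rows`. [cite: GrbacShahidi2015, Thm 4.3; Ichino2022ThetaReal, Thm 1.1 (bookkeeping proved here)] -/
theorem sixtysixth_holds_top : ((canon₆₆ νtop μtop κtop).GrbacShahidiAsai ∧ (canon₆₆ νtop μtop κtop).JZUnitaryNonvanishing ∧ (canon₆₆ νtop μtop κtop).IchinoThetaReal ∧ (canon₆₆ νtop μtop κtop).FinisLapidTWN ∧ (canon₆₆ νtop μtop κtop).ATLevelRaising) :=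
  have b : ∀ N, νtop.Everything N := bookInputs_top.everything
  have m : ∀ N, μtop.Everything N := mokInputs_top.everything
  have KQ := kmswInputs_top μtop
  have s : ∀ N, κtop.Scope N := KQ.1.scope mokInputs_top
  have f : ∀ N, κtop.Full N := KQ.1.full mokInputs_top KQ.2
  have o : κtop.StabOrdI := KQ.1.stabOrdI
  mokLine_of_rows (canon_implications₆₆ νtop μtop κtop) b m s f o

/-- BOOK SIDE, EXACT SUPPORT AS TYPED: in the book countermodel of ANY leaf `l` (Mok and KMSW at the top; every sixty-sixth edge valid) C53 FAILS (the
book's transfer for symplectic / orthogonal G′ is its first premise) and the four unitary rows HOLD — no book premise although [Arthur 2013] / [A13] /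
[arthur] / [Art13] stand in all four citation lists. [cite: FinisLapid2017Normalizing, p0003:L60; GrbacShahidi2015, p0003:L40 (bookkeeping proved here)] -/
theorem mokLine_book_cm (l : LeafSupport.Leaf) :
    Implications66 (LeafSupport.mkN (LeafSupport.cm l)) μtop κtop (canon₆₆ (LeafSupport.mkN (LeafSupport.cm l)) μtop κtop) ∧
      ((canon₆₆ (LeafSupport.mkN (LeafSupport.cm l)) μtop κtop).GrbacShahidiAsai ∧ (canon₆₆ (LeafSupport.mkN (LeafSupport.cm l)) μtop κtop).JZUnitaryNonvanishing ∧ (canon₆₆ (LeafSupport.mkN (LeafSupport.cm l)) μtop κtop).IchinoThetaReal ∧ ¬ (canon₆₆ (LeafSupport.mkN (LeafSupport.cm l)) μtop κtop).FinisLapidTWN ∧ (canon₆₆ (LeafSupport.mkN (LeafSupport.cm l)) μtop κtop).ATLevelRaising) ∧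
      (∀ l', l' ≠ l → (LeafSupport.mkN (LeafSupport.cm l)).leaf l') ∧ ¬ (LeafSupport.mkN (LeafSupport.cm l)).leaf l :=
  have cmod := LeafSupport.countermodel l
  have n := not_B_cm l
  have m : ∀ N, μtop.Everything N := mokInputs_top.everything
  have KQ := kmswInputs_top μtop
  have s : ∀ N, κtop.Scope N := KQ.1.scope mokInputs_top
  have f : ∀ N, κtop.Full N := KQ.1.full mokInputs_top KQ.2
  have o : κtop.StabOrdI := KQ.1.stabOrdI
  ⟨canon_implications₆₆ _ _ _, ⟨m, ⟨m, s⟩, ⟨m, f⟩, fun h => n h.1, ⟨m, o⟩⟩, cmod.2.1, cmod.2.2.1⟩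

/-- MOK SIDE, EXACT SUPPORT AS TYPED: in Mok's countermodel of ANY of its leaves (book at the top; KMSW read without its import of Mok; every
sixty-sixth edge valid) ALL FIVE statements FAIL — Mok at all ranks is a premise of each. [cite: GrbacShahidi2015, p0003:L43-45; JiangZhang2020Nonvanishing, p0005:L12; Ichino2022ThetaReal, p0016:L96; FinisLapid2017Normalizing, p0003:L61; AnastassiadesThorne2022, p0012:L13 (bookkeeping proved here)] -/
theorem mokLine_mok_cm (l : Mok2015.LeafSupport.Leaf) :
    Mok2015.LeafSupport.Systems (Mok2015.LeafSupport.mkN (Mok2015.LeafSupport.cm l)) ∧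
      (∀ l', l' ≠ l → (Mok2015.LeafSupport.mkN (Mok2015.LeafSupport.cm l)).leaf l') ∧ ¬ (Mok2015.LeafSupport.mkN (Mok2015.LeafSupport.cm l)).leaf l ∧
      Implications66 νtop (Mok2015.LeafSupport.mkN (Mok2015.LeafSupport.cm l)) κnoMok (canon₆₆ νtop (Mok2015.LeafSupport.mkN (Mok2015.LeafSupport.cm l)) κnoMok) ∧
      (¬ (canon₆₆ νtop (Mok2015.LeafSupport.mkN (Mok2015.LeafSupport.cm l)) κnoMok).GrbacShahidiAsai ∧ ¬ (canon₆₆ νtop (Mok2015.LeafSupport.mkN (Mok2015.LeafSupport.cm l)) κnoMok).JZUnitaryNonvanishing ∧ ¬ (canon₆₆ νtop (Mok2015.LeafSupport.mkN (Mok2015.LeafSupport.cm l)) κnoMok).IchinoThetaReal ∧ ¬ (canon₆₆ νtop (Mok2015.LeafSupport.mkN (Mok2015.LeafSupport.cm l)) κnoMok).FinisLapidTWN ∧ ¬ (canon₆₆ νtop (Mok2015.LeafSupport.mkN (Mok2015.LeafSupport.cm l)) κnoMok).ATLevelRaising) :=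
  have cmod := Mok2015.LeafSupport.countermodel l
  have nm := not_M_cm l
  ⟨cmod.1, cmod.2.1, cmod.2.2.1, canon_implications₆₆ _ _ _,
    ⟨nm, fun h => nm h.1, fun h => nm h.1, fun h => nm h.2, fun h => nm h.1⟩⟩

/-- KMSW SIDE, EXACT SUPPORT AS TYPED: book and Mok at the top, KMSW's countermodel of a leaf `l ≠ MokMain` (every KMSW edge valid, the other KMSW
leaves true; every sixty-sixth edge valid): C58 and C53 HOLD (no KMSW premise); C54 FAILS for every such leaf — the starred theorems in full rest on
every KMSW leaf, the two SEQUELS included (Ichino's K1 caveat, certified); C52 holds IF AND ONLY IF `l.onlyFull` (KMSW's PROVED scope: the generic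
packets of U_{n+2,n}); E7 holds IF AND ONLY IF `l.stabOrdI = false` — the definite U_2n's stabilisation rests on FL, WFL_split, WFL_general, STF,
Transfer of KMSW's DAG and on NEITHER sequel: Anastassiades – Thorne's avoidance of [Kal14]'s completion, certified as typed. [claim: KalethaMinguezShinWhite2014, under-review] [cite: Ichino2022ThetaReal, arXiv:2002.09148 p0003:L46; AnastassiadesThorne2022, p0009:L3; JiangZhang2020Nonvanishing, p0005:L1-2 (bookkeeping proved here)] -/
theorem mokLine_kmsw_cm (l : KMSW2014.LeafSupport.Leaf) (hl : l ≠ .MokMain) :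
    (∃ ωκ, KMSW2014.LeafSupport.Systems (KMSW2014.LeafSupport.mkN (KMSW2014.LeafSupport.cm l)) ωκ) ∧
      (∀ l', l' ≠ l → (KMSW2014.LeafSupport.mkN (KMSW2014.LeafSupport.cm l)).leaf l') ∧ ¬ (KMSW2014.LeafSupport.mkN (KMSW2014.LeafSupport.cm l)).leaf l ∧
      KMSW2014.E_ImportMok μtop (KMSW2014.LeafSupport.mkN (KMSW2014.LeafSupport.cm l)) ∧
      Implications66 νtop μtop (KMSW2014.LeafSupport.mkN (KMSW2014.LeafSupport.cm l)) (canon₆₆ νtop μtop (KMSW2014.LeafSupport.mkN (KMSW2014.LeafSupport.cm l))) ∧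
      ((canon₆₆ νtop μtop (KMSW2014.LeafSupport.mkN (KMSW2014.LeafSupport.cm l))).GrbacShahidiAsai ∧ (canon₆₆ νtop μtop (KMSW2014.LeafSupport.mkN (KMSW2014.LeafSupport.cm l))).FinisLapidTWN ∧ ¬ (canon₆₆ νtop μtop (KMSW2014.LeafSupport.mkN (KMSW2014.LeafSupport.cm l))).IchinoThetaReal ∧ ((canon₆₆ νtop μtop (KMSW2014.LeafSupport.mkN (KMSW2014.LeafSupport.cm l))).JZUnitaryNonvanishing ↔ l.onlyFull = true) ∧ ((canon₆₆ νtop μtop (KMSW2014.LeafSupport.mkN (KMSW2014.LeafSupport.cm l))).ATLevelRaising ↔ l.stabOrdI = false)) := by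
  have cmod := KMSW2014.LeafSupport.countermodel l
  have b : ∀ N, νtop.Everything N := bookInputs_top.everything
  have m : ∀ N, μtop.Everything N := mokInputs_top.everything
  have nf : ¬ ∀ N, (KMSW2014.LeafSupport.mkN (KMSW2014.LeafSupport.cm l)).Full N :=
    fun h => KMSW2014.LeafSupport.not_full_of_noFull (cmod.2.2.2 0) (h 0)
  have hsc : (∀ N, (KMSW2014.LeafSupport.mkN (KMSW2014.LeafSupport.cm l)).Scope N) ↔ l.onlyFull = true := by
    constructor
    · intro hk
      cases hb : l.onlyFull
      · exact absurd (hk 0) (KMSW2014.LeafSupport.not_scope_of (KMSW2014.LeafSupport.scope_fails l hb 0))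
      · rfl
    · intro h
      exact scope_of_onlyFull l h
  exact ⟨⟨_, cmod.1⟩, cmod.2.1, cmod.2.2.1, fun _ => cmod.2.1 .MokMain (Ne.symm hl), canon_implications₆₆ _ _ _,
    ⟨m, ⟨b, m⟩, fun h => nf h.2,
      ⟨fun h => hsc.1 h.2, fun h => ⟨m, hsc.2 h⟩⟩,
      ⟨fun h => (stabOrdI_cm_iff l).1 h.2, fun h => ⟨m, (stabOrdI_cm_iff l).2 h⟩⟩⟩⟩

/-- THE SIXTY-SIXTH TRANCHE REGRADED, in one statement: (i) at the top all five hold; (ii) in the book countermodel of any leaf C53 fails, the four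
unitary rows hold; (iii) in every Mok countermodel all five fail; (iv) in every KMSW countermodel (l ≠ MokMain) C58, C53 hold, C54 fails, C52 ↔
`l.onlyFull`, E7 ↔ `l.stabOrdI = false`. [cite: GrbacShahidi2015, Thm 4.3; JiangZhang2020Nonvanishing, Thm 1.3; Ichino2022ThetaReal, Thm 1.1; FinisLapid2017Normalizing, Thm 3.11; AnastassiadesThorne2022, Thm 1 (bookkeeping proved here)] -/
theorem mokLine_regraded :
    ((canon₆₆ νtop μtop κtop).GrbacShahidiAsai ∧ (canon₆₆ νtop μtop κtop).JZUnitaryNonvanishing ∧ (canon₆₆ νtop μtop κtop).IchinoThetaReal ∧ (canon₆₆ νtop μtop κtop).FinisLapidTWN ∧ (canon₆₆ νtop μtop κtop).ATLevelRaising) ∧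
      (∀ l : LeafSupport.Leaf, ((canon₆₆ (LeafSupport.mkN (LeafSupport.cm l)) μtop κtop).GrbacShahidiAsai ∧ (canon₆₆ (LeafSupport.mkN (LeafSupport.cm l)) μtop κtop).JZUnitaryNonvanishing ∧ (canon₆₆ (LeafSupport.mkN (LeafSupport.cm l)) μtop κtop).IchinoThetaReal ∧ ¬ (canon₆₆ (LeafSupport.mkN (LeafSupport.cm l)) μtop κtop).FinisLapidTWN ∧ (canon₆₆ (LeafSupport.mkN (LeafSupport.cm l)) μtop κtop).ATLevelRaising)) ∧
      (∀ l : Mok2015.LeafSupport.Leaf, (¬ (canon₆₆ νtop (Mok2015.LeafSupport.mkN (Mok2015.LeafSupport.cm l)) κnoMok).GrbacShahidiAsai ∧ ¬ (canon₆₆ νtop (Mok2015.LeafSupport.mkN (Mok2015.LeafSupport.cm l)) κnoMok).JZUnitaryNonvanishing ∧ ¬ (canon₆₆ νtop (Mok2015.LeafSupport.mkN (Mok2015.LeafSupport.cm l)) κnoMok).IchinoThetaReal ∧ ¬ (canon₆₆ νtop (Mok2015.LeafSupport.mkN (Mok2015.LeafSupport.cm l)) κnoMok).FinisLapidTWN ∧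 ¬ (canon₆₆ νtop (Mok2015.LeafSupport.mkN (Mok2015.LeafSupport.cm l)) κnoMok).ATLevelRaising)) ∧
      (∀ l : KMSW2014.LeafSupport.Leaf, l ≠ .MokMain → ((canon₆₆ νtop μtop (KMSW2014.LeafSupport.mkN (KMSW2014.LeafSupport.cm l))).GrbacShahidiAsai ∧ (canon₆₆ νtop μtop (KMSW2014.LeafSupport.mkN (KMSW2014.LeafSupport.cm l))).FinisLapidTWN ∧ ¬ (canon₆₆ νtop μtop (KMSW2014.LeafSupport.mkN (KMSW2014.LeafSupport.cm l))).IchinoThetaReal ∧ ((canon₆₆ νtop μtop (KMSW2014.LeafSupport.mkN (KMSW2014.LeafSupport.cm l))).JZUnitaryNonvanishing ↔ l.onlyFull = true) ∧ ((canon₆₆ νtop μtop (KMSW2014.LeafSupport.mkN (KMSW2014.LeafSupport.cm l))).ATLevelRaising ↔ l.stabOrdI = false))) :=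
  ⟨sixtysixth_holds_top, fun l => (mokLine_book_cm l).2.1, fun l => (mokLine_mok_cm l).2.2.2.2,
    fun l hl => (mokLine_kmsw_cm l hl).2.2.2.2.2⟩

/-! ## 70. Sixty-seventh tranche (v1 of this file, after `Downstream18.lean` v1; unit `pub-arthur-down-g30`): supports of SHIMURA VARIETIES
AND PERIODS UNDER STATED HYPOTHESES — C69 `MorelSuhSign` / `MorelSuhSiegel` (node `MorelSuhCondC`), C66 `IchinoPrasannaHodge` (node `IPGaloisHyp`),
C41 `FMBessel` / `FMBesselGeneral`, C42 `BhagwatRaghuramO2n`; see the module docstring for the summary of what is certified. -/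

section Canon67

variable (ν : Nodes) (μ : Mok2015.Nodes) (κ : KMSW2014.Nodes)

/-- The canonical reading of the sixty-seventh tranche with the three hypothesis nodes GRANTED: the nodes := True; `MorelSuhSign` := True (its only premise); `MorelSuhSiegel` := book ∧ A7's `canon` value; `IchinoPrasannaHodge` := Mok ∧ KMSW in full ∧ True; `FMBessel` := book; `FMBesselGeneral` := book ∧ `InnerTwists` (True in `canon₈`) ∧ book; `BhagwatRaghuramO2n` := book ∧ B3's `canon₆` value. [cite: MorelSuh2019Sign, Thm 4; IchinoPrasanna2023Hodge, Thm 1; FurusawaMorimoto2021Bessel, Thm 1; BhagwatRaghuram2025Eisenstein, Thm 1 (canonical model; bookkeeping)] -/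
abbrev canon₆₇ : Consumers67 where
  MorelSuhCondC := True
  MorelSuhSign := True
  MorelSuhSiegel := (∀ N, ν.Everything N) ∧ (∀ N, ν.Everything N)
  IPGaloisHyp := True
  IchinoPrasannaHodge := (∀ N, μ.Everything N) ∧ (∀ N, κ.Full N) ∧ True
  FMBessel := (∀ N, ν.Everything N)
  FMBesselGeneral := (∀ N, ν.Everything N) ∧ True ∧ (∀ N, ν.Everything N)
  BhagwatRaghuramO2n := (∀ N, ν.Everything N) ∧ (∀ N, ν.Everything N)

/-- The reading with the three nodes DENIED (condition (C), the Galois input, and — over `canon₈no` — Chapter 9): the node fields := False; `MorelSuhSign` := False; `IchinoPrasannaHodge` := Mok ∧ KMSW in full ∧ False; `FMBesselGeneral` := book ∧ False ∧ book; the three book rows as in `canon₆₇`. [cite: MorelSuh2019Sign, §1 condition (C); IchinoPrasanna2023Hodge, Remark 1 (ii); FurusawaMorimoto2021Bessel, Cor. 1 (canonical model; bookkeeping)] -/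
abbrev canon₆₇no : Consumers67 where
  MorelSuhCondC := False
  MorelSuhSign := False
  MorelSuhSiegel := (∀ N, ν.Everything N) ∧ (∀ N, ν.Everything N)
  IPGaloisHyp := False
  IchinoPrasannaHodge := (∀ N, μ.Everything N) ∧ (∀ N, κ.Full N) ∧ False
  FMBessel := (∀ N, ν.Everything N)
  FMBesselGeneral := (∀ N, ν.Everything N) ∧ False ∧ (∀ N, ν.Everything N)
  BhagwatRaghuramO2n := (∀ N, ν.Everything N) ∧ (∀ N, ν.Everything N)

/-- Every sixty-seventh-tranche edge holds in the nodes-granted reading, for arbitrary ν, μ, κ. [cite: MorelSuh2019Sign, footnote p0003:L92-94; FurusawaMorimoto2021Bessel, §6 (bookkeeping proved here)] -/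
theorem canon_implications₆₇ : Implications67 ν μ κ (canon ν μ κ) (canon₆ ν μ) (canon₈ ν μ κ) (canon₆₇ ν μ κ) where
  morelSuh := fun h => h
  morelSuhSiegel := fun b x => ⟨b, x⟩
  ichinoPrasanna := fun m f g => ⟨m, f, g⟩
  fmBessel := fun b => b
  fmGeneral := fun b h9 t => ⟨b, h9, t⟩
  bhagwatRaghuram := fun b a => ⟨b, a⟩

/-- The edges also hold in the nodes-denied reading. [cite: MorelSuh2019Sign, §1; IchinoPrasanna2023Hodge, Remark 1 (ii) (bookkeeping proved here)] -/
theorem canon_implications₆₇no : Implications67 ν μ κ (canon ν μ κ) (canon₆ ν μ) (canon₈no ν μ) (canon₆₇no ν μ κ) where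
  morelSuh := fun h => h
  morelSuhSiegel := fun b x => ⟨b, x⟩
  ichinoPrasanna := fun m f g => ⟨m, f, g⟩
  fmBessel := fun b => b
  fmGeneral := fun b h9 t => ⟨b, h9, t⟩
  bhagwatRaghuram := fun b a => ⟨b, a⟩

end Canon67

/-- At the top (every input of the three DAGs, KMSW's sequels and the three nodes granted) all six statements hold — through `periods_of_rows`. [cite: MorelSuh2019Sign, Thm 4; IchinoPrasanna2023Hodge, Thm 1; FurusawaMorimoto2021Bessel, Thm 1 (bookkeeping proved here)] -/
theorem sixtyseventh_holds_top : ((canon₆₇ νtop μtop κtop).MorelSuhSign ∧ (canon₆₇ νtop μtop κtop).MorelSuhSiegel ∧ (canon₆₇ νtop μtop κtop).IchinoPrasannaHodge ∧ (canon₆₇ νtop μtop κtop).FMBessel ∧ (canon₆₇ νtop μtop κtop).FMBesselGeneral ∧ (canon₆₇ νtop μtop κtop).BhagwatRaghuramO2n) :=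
  have b : ∀ N, νtop.Everything N := bookInputs_top.everything
  have m : ∀ N, μtop.Everything N := mokInputs_top.everything
  have KQ := kmswInputs_top μtop
  have f : ∀ N, κtop.Full N := KQ.1.full mokInputs_top KQ.2
  periods_of_rows (canon_implications₆₇ νtop μtop κtop) b m f trivial trivial trivial b b

/-- THE NODES ARE GENUINE PREMISES AS TYPED: every input of the three DAGs granted (sequels included) but condition (C), the Galois input and Chapter 9
DENIED, every edge valid: `MorelSuhSign`, `IchinoPrasannaHodge`, `FMBesselGeneral` FAIL while `MorelSuhSiegel`, `FMBessel`, `BhagwatRaghuramO2n` HOLD. [cite: MorelSuh2019Sign, Thm 3 hypothesis; IchinoPrasanna2023Hodge, p0004:L47; FurusawaMorimoto2021Bessel, p0007:L10-12 (bookkeeping proved here)] -/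
theorem periods_need_nodes_top :
    Implications67 νtop μtop κtop (canon νtop μtop κtop) (canon₆ νtop μtop) (canon₈no νtop μtop) (canon₆₇no νtop μtop κtop) ∧ (¬ (canon₆₇no νtop μtop κtop).MorelSuhSign ∧ ¬ (canon₆₇no νtop μtop κtop).IchinoPrasannaHodge ∧ ¬ (canon₆₇no νtop μtop κtop).FMBesselGeneral ∧ (canon₆₇no νtop μtop κtop).MorelSuhSiegel ∧ (canon₆₇no νtop μtop κtop).FMBessel ∧ (canon₆₇no νtop μtop κtop).BhagwatRaghuramO2n) :=
  have b : ∀ N, νtop.Everything N := bookInputs_top.everything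
  ⟨canon_implications₆₇no _ _ _, ⟨fun h => h, fun h => h.2.2, fun h => h.2.1, ⟨b, b⟩, b, ⟨b, b⟩⟩⟩

/-- BOOK SIDE, EXACT SUPPORT AS TYPED: in the book countermodel of ANY leaf `l` (Mok and KMSW at the top, nodes granted; every edge valid) the four book
rows `MorelSuhSiegel`, `FMBessel`, `FMBesselGeneral`, `BhagwatRaghuramO2n` FAIL; `MorelSuhSign` (node only) and `IchinoPrasannaHodge` (unitary) HOLD. [cite: MorelSuh2019Sign, p0003:L82-83; FurusawaMorimoto2021Bessel, p0006:L117; BhagwatRaghuram2025Eisenstein, p0002:L32 (bookkeeping proved here)] -/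
theorem periods_book_cm (l : LeafSupport.Leaf) :
    Implications67 (LeafSupport.mkN (LeafSupport.cm l)) μtop κtop (canon (LeafSupport.mkN (LeafSupport.cm l)) μtop κtop) (canon₆ (LeafSupport.mkN (LeafSupport.cm l)) μtop) (canon₈ (LeafSupport.mkN (LeafSupport.cm l)) μtop κtop) (canon₆₇ (LeafSupport.mkN (LeafSupport.cm l)) μtop κtop) ∧
      (¬ (canon₆₇ (LeafSupport.mkN (LeafSupport.cm l)) μtop κtop).MorelSuhSiegel ∧ ¬ (canon₆₇ (LeafSupport.mkN (LeafSupport.cm l)) μtop κtop).FMBessel ∧ ¬ (canon₆₇ (LeafSupport.mkN (LeafSupport.cm l)) μtop κtop).FMBesselGeneral ∧ ¬ (canon₆₇ (LeafSupport.mkN (LeafSupport.cm l)) μtop κtop).BhagwatRaghuramO2n ∧ (canon₆₇ (LeafSupport.mkN (LeafSupport.cm l)) μtop κtop).MorelSuhSign ∧ (canon₆₇ (LeafSupport.mkN (LeafSupport.cm l)) μtop κtop).IchinoPrasannaHodge) ∧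
      (∀ l', l' ≠ l → (LeafSupport.mkN (LeafSupport.cm l)).leaf l') ∧ ¬ (LeafSupport.mkN (LeafSupport.cm l)).leaf l :=
  have cmod := LeafSupport.countermodel l
  have n := not_B_cm l
  have m : ∀ N, μtop.Everything N := mokInputs_top.everything
  have KQ := kmswInputs_top μtop
  have f : ∀ N, κtop.Full N := KQ.1.full mokInputs_top KQ.2
  ⟨canon_implications₆₇ _ _ _, ⟨fun h => n h.1, n, fun h => n h.1, fun h => n h.1, trivial, ⟨m, f, trivial⟩⟩, cmod.2.1, cmod.2.2.1⟩

/-- MOK SIDE, EXACT SUPPORT AS TYPED: in Mok's countermodel of ANY of its leaves (book at the top; KMSW read without its import of Mok; nodes granted;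
every edge valid) only `IchinoPrasannaHodge` FAILS. [cite: IchinoPrasanna2023Hodge, p0067:L91-94 ([mok]) (bookkeeping proved here)] -/
theorem periods_mok_cm (l : Mok2015.LeafSupport.Leaf) :
    Mok2015.LeafSupport.Systems (Mok2015.LeafSupport.mkN (Mok2015.LeafSupport.cm l)) ∧
      (∀ l', l' ≠ l → (Mok2015.LeafSupport.mkN (Mok2015.LeafSupport.cm l)).leaf l') ∧ ¬ (Mok2015.LeafSupport.mkN (Mok2015.LeafSupport.cm l)).leaf l ∧
      Implications67 νtop (Mok2015.LeafSupport.mkN (Mok2015.LeafSupport.cm l)) κnoMok (canon νtop (Mok2015.LeafSupport.mkN (Mok2015.LeafSupport.cm l)) κnoMok) (canon₆ νtop (Mok2015.LeafSupport.mkN (Mok2015.LeafSupport.cm l))) (canon₈ νtop (Mok2015.LeafSupport.mkN (Mok2015.LeafSupport.cm l)) κnoMok) (canon₆₇ νtop (Mok2015.LeafSupport.mkN (Mok2015.LeafSupport.cm l)) κnoMok) ∧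
      (¬ (canon₆₇ νtop (Mok2015.LeafSupport.mkN (Mok2015.LeafSupport.cm l)) κnoMok).IchinoPrasannaHodge ∧ (canon₆₇ νtop (Mok2015.LeafSupport.mkN (Mok2015.LeafSupport.cm l)) κnoMok).MorelSuhSign ∧ (canon₆₇ νtop (Mok2015.LeafSupport.mkN (Mok2015.LeafSupport.cm l)) κnoMok).MorelSuhSiegel ∧ (canon₆₇ νtop (Mok2015.LeafSupport.mkN (Mok2015.LeafSupport.cm l)) κnoMok).FMBessel ∧ (canon₆₇ νtop (Mok2015.LeafSupport.mkN (Mok2015.LeafSupport.cm l)) κnoMok).FMBesselGeneral ∧ (canon₆₇ νtop (Mok2015.LeafSupport.mkN (Mok2015.LeafSupport.cm l)) κnoMok).BhagwatRaghuramO2n) :=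
  have cmod := Mok2015.LeafSupport.countermodel l
  have nm := not_M_cm l
  have b : ∀ N, νtop.Everything N := bookInputs_top.everything
  ⟨cmod.1, cmod.2.1, cmod.2.2.1, canon_implications₆₇ _ _ _,
    ⟨fun h => nm h.1, trivial, ⟨b, b⟩, b, ⟨b, trivial, b⟩, ⟨b, b⟩⟩⟩

/-- KMSW SIDE, EXACT SUPPORT AS TYPED: book and Mok at the top, KMSW's countermodel of a leaf `l ≠ MokMain` (every KMSW edge valid, the other KMSW
leaves true; nodes granted; every edge valid): only `IchinoPrasannaHodge` FAILS — for EVERY such leaf, the two SEQUELS included (KMSW in full is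
its premise): Ichino – Prasanna's « tentative » status, certified as typed. [claim: KalethaMinguezShinWhite2014, under-review] [cite: IchinoPrasanna2023Hodge, p0004:L37-38, p0044:L21 (bookkeeping proved here)] -/
theorem periods_kmsw_cm (l : KMSW2014.LeafSupport.Leaf) (hl : l ≠ .MokMain) :
    (∃ ωκ, KMSW2014.LeafSupport.Systems (KMSW2014.LeafSupport.mkN (KMSW2014.LeafSupport.cm l)) ωκ) ∧
      (∀ l', l' ≠ l → (KMSW2014.LeafSupport.mkN (KMSW2014.LeafSupport.cm l)).leaf l') ∧ ¬ (KMSW2014.LeafSupport.mkN (KMSW2014.LeafSupport.cm l)).leaf l ∧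
      KMSW2014.E_ImportMok μtop (KMSW2014.LeafSupport.mkN (KMSW2014.LeafSupport.cm l)) ∧
      Implications67 νtop μtop (KMSW2014.LeafSupport.mkN (KMSW2014.LeafSupport.cm l)) (canon νtop μtop (KMSW2014.LeafSupport.mkN (KMSW2014.LeafSupport.cm l))) (canon₆ νtop μtop) (canon₈ νtop μtop (KMSW2014.LeafSupport.mkN (KMSW2014.LeafSupport.cm l))) (canon₆₇ νtop μtop (KMSW2014.LeafSupport.mkN (KMSW2014.LeafSupport.cm l))) ∧
      (¬ (canon₆₇ νtop μtop (KMSW2014.LeafSupport.mkN (KMSW2014.LeafSupport.cm l))).IchinoPrasannaHodge ∧ (canon₆₇ νtop μtop (KMSW2014.LeafSupport.mkN (KMSW2014.LeafSupport.cm l))).MorelSuhSign ∧ (canon₆₇ νtop μtop (KMSW2014.LeafSupport.mkN (KMSW2014.LeafSupport.cm l))).MorelSuhSiegel ∧ (canon₆₇ νtop μtop (KMSW2014.LeafSupport.mkN (KMSW2014.LeafSupport.cm l))).FMBessel ∧ (canon₆₇ νtop μtop (KMSW2014.LeafSupport.mkN (KMSW2014.LeafSupport.cm l))).FMBesselGeneral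 ∧ (canon₆₇ νtop μtop (KMSW2014.LeafSupport.mkN (KMSW2014.LeafSupport.cm l))).BhagwatRaghuramO2n) :=
  have cmod := KMSW2014.LeafSupport.countermodel l
  have b : ∀ N, νtop.Everything N := bookInputs_top.everything
  have nf : ¬ ∀ N, (KMSW2014.LeafSupport.mkN (KMSW2014.LeafSupport.cm l)).Full N :=
    fun h => KMSW2014.LeafSupport.not_full_of_noFull (cmod.2.2.2 0) (h 0)
  ⟨⟨_, cmod.1⟩, cmod.2.1, cmod.2.2.1, fun _ => cmod.2.1 .MokMain (Ne.symm hl), canon_implications₆₇ _ _ _,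
    ⟨fun h => nf h.2.1, trivial, ⟨b, b⟩, b, ⟨b, trivial, b⟩, ⟨b, b⟩⟩⟩

/-- THE SIXTY-SEVENTH TRANCHE REGRADED, in one statement: (i) at the top, nodes granted, all six hold; (ii) nodes denied, the three hypothesis-carrying
statements fail and the three book rows hold; (iii) in the book countermodel of any leaf the four book rows fail, `MorelSuhSign` and `IchinoPrasannaHodge`
hold; (iv) in every Mok countermodel only `IchinoPrasannaHodge` fails; (v) in every KMSW countermodel (l ≠ MokMain) only `IchinoPrasannaHodge` fails. [cite: MorelSuh2019Sign, Thms 3–5; IchinoPrasanna2023Hodge, Thm 1; FurusawaMorimoto2021Bessel, Thm 1, Cor. 1; BhagwatRaghuram2025Eisenstein, Thm 1 (bookkeeping proved here)] -/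
theorem periods_regraded :
    ((canon₆₇ νtop μtop κtop).MorelSuhSign ∧ (canon₆₇ νtop μtop κtop).MorelSuhSiegel ∧ (canon₆₇ νtop μtop κtop).IchinoPrasannaHodge ∧ (canon₆₇ νtop μtop κtop).FMBessel ∧ (canon₆₇ νtop μtop κtop).FMBesselGeneral ∧ (canon₆₇ νtop μtop κtop).BhagwatRaghuramO2n) ∧
      (¬ (canon₆₇no νtop μtop κtop).MorelSuhSign ∧ ¬ (canon₆₇no νtop μtop κtop).IchinoPrasannaHodge ∧ ¬ (canon₆₇no νtop μtop κtop).FMBesselGeneral ∧ (canon₆₇no νtop μtop κtop).MorelSuhSiegel ∧ (canon₆₇no νtop μtop κtop).FMBessel ∧ (canon₆₇no νtop μtop κtop).BhagwatRaghuramO2n) ∧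
      (∀ l : LeafSupport.Leaf, (¬ (canon₆₇ (LeafSupport.mkN (LeafSupport.cm l)) μtop κtop).MorelSuhSiegel ∧ ¬ (canon₆₇ (LeafSupport.mkN (LeafSupport.cm l)) μtop κtop).FMBessel ∧ ¬ (canon₆₇ (LeafSupport.mkN (LeafSupport.cm l)) μtop κtop).FMBesselGeneral ∧ ¬ (canon₆₇ (LeafSupport.mkN (LeafSupport.cm l)) μtop κtop).BhagwatRaghuramO2n ∧ (canon₆₇ (LeafSupport.mkN (LeafSupport.cm l)) μtop κtop).MorelSuhSign ∧ (canon₆₇ (LeafSupport.mkN (LeafSupport.cm l)) μtop κtop).IchinoPrasannaHodge)) ∧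
      (∀ l : Mok2015.LeafSupport.Leaf, (¬ (canon₆₇ νtop (Mok2015.LeafSupport.mkN (Mok2015.LeafSupport.cm l)) κnoMok).IchinoPrasannaHodge ∧ (canon₆₇ νtop (Mok2015.LeafSupport.mkN (Mok2015.LeafSupport.cm l)) κnoMok).MorelSuhSign ∧ (canon₆₇ νtop (Mok2015.LeafSupport.mkN (Mok2015.LeafSupport.cm l)) κnoMok).MorelSuhSiegel ∧ (canon₆₇ νtop (Mok2015.LeafSupport.mkN (Mok2015.LeafSupport.cm l)) κnoMok).FMBessel ∧ (canon₆₇ νtop (Mok2015.LeafSupport.mkN (Mok2015.LeafSupport.cm l)) κnoMok).FMBesselGeneral ∧ (canon₆₇ νtop (Mok2015.LeafSupport.mkN (Mok2015.LeafSupport.cm l)) κnoMok).BhagwatRaghuramO2n)) ∧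
      (∀ l : KMSW2014.LeafSupport.Leaf, l ≠ .MokMain → (¬ (canon₆₇ νtop μtop (KMSW2014.LeafSupport.mkN (KMSW2014.LeafSupport.cm l))).IchinoPrasannaHodge ∧ (canon₆₇ νtop μtop (KMSW2014.LeafSupport.mkN (KMSW2014.LeafSupport.cm l))).MorelSuhSign ∧ (canon₆₇ νtop μtop (KMSW2014.LeafSupport.mkN (KMSW2014.LeafSupport.cm l))).MorelSuhSiegel ∧ (canon₆₇ νtop μtop (KMSW2014.LeafSupport.mkN (KMSW2014.LeafSupport.cm l))).FMBessel ∧ (canon₆₇ νtop μtop (KMSW2014.LeafSupport.mkN (KMSW2014.LeafSupport.cm l))).FMBesselGeneral ∧ (canon₆₇ νtop μtop (KMSW2014.LeafSupport.mkN (KMSW2014.LeafSupport.cm l))).BhagwatRaghuramO2n)) :=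
  ⟨sixtyseventh_holds_top, periods_need_nodes_top.2, fun l => (periods_book_cm l).2.1, fun l => (periods_mok_cm l).2.2.2.2,
    fun l hl => (periods_kmsw_cm l hl).2.2.2.2.2⟩

/-! ## 74. Seventy-first tranche (v1 of this file, after `Downstream19.lean` v1; unit `pub-arthur-down-g30`): supports of LEVEL ONE, CONDUCTOR p, AND
A p-ADIC L-FUNCTION — C59 `DummiganLifts`, C47 `LachausseeConducteur`, C80 `EHLSpadicL` (node `EHLSMultOne`); see the module docstring for the summary of what
is certified. -/

section Canon71

variable (ν : Nodes) (μ : Mok2015.Nodes) (κ : KMSW2014.Nodes)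

/-- The canonical reading of the seventy-first tranche with the node GRANTED: C59 := book ∧ C3's and `AMR`'s `canon` values; C47 := book ∧ A3's and `AMR`'s `canon` values; the node and C80 := True. [cite: Dummigan2017LiftingPuzzles, Props 5.1–5.6; Lachaussee2020Conducteur, Thms 2, 3, 5; EischenHarrisLiSkinner2020, Main Thm 108 (canonical model; bookkeeping)] -/
abbrev canon₇₁ : Consumers71 where
  DummiganLifts := (∀ N, ν.Everything N) ∧ (canon ν μ κ).ChenevierRenardStar ∧ (canon ν μ κ).AMR
  LachausseeConducteur := (∀ N, ν.Everything N) ∧ (canon ν μ κ).TaibiInner ∧ (canon ν μ κ).AMR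
  EHLSMultOne := True
  EHLSpadicL := True

/-- The reading with the node DENIED: the node and C80 := False; C59, C47 as in `canon₇₁`. [cite: EischenHarrisLiSkinner2020, Hypothesis 44 (canonical model; bookkeeping)] -/
abbrev canon₇₁no : Consumers71 where
  DummiganLifts := (∀ N, ν.Everything N) ∧ (canon ν μ κ).ChenevierRenardStar ∧ (canon ν μ κ).AMR
  LachausseeConducteur := (∀ N, ν.Everything N) ∧ (canon ν μ κ).TaibiInner ∧ (canon ν μ κ).AMR
  EHLSMultOne := False
  EHLSpadicL := False

/-- Every seventy-first-tranche edge holds in the node-granted reading, for arbitrary ν, μ, κ. [cite: Dummigan2017LiftingPuzzles, Thm 3.1; Lachaussee2020Conducteur, Thm 5.1 (bookkeeping proved here)] -/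
theorem canon_implications₇₁ : Implications71 ν (canon ν μ κ) (canon₇₁ ν μ κ) where
  dummigan := fun b h3 a => ⟨b, h3, a⟩
  lachaussee := fun b t a => ⟨b, t, a⟩
  ehls := fun h => h

/-- The edges also hold in the node-denied reading. [cite: EischenHarrisLiSkinner2020, Hypothesis 44 (bookkeeping proved here)] -/
theorem canon_implications₇₁no : Implications71 ν (canon ν μ κ) (canon₇₁no ν μ κ) where
  dummigan := fun b h3 a => ⟨b, h3, a⟩
  lachaussee := fun b t a => ⟨b, t, a⟩
  ehls := fun h => h

end Canon71

/-- At the top (every input of the book granted, node granted) all three statements hold — through `levelOne_of_rows`. [cite: Dummigan2017LiftingPuzzles, Props 5.1–5.6; Lachaussee2020Conducteur, Thm 5 (bookkeeping proved here)] -/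
theorem seventyfirst_holds_top : ((canon₇₁ νtop μtop κtop).DummiganLifts ∧ (canon₇₁ νtop μtop κtop).LachausseeConducteur ∧ (canon₇₁ νtop μtop κtop).EHLSpadicL) :=
  have b : ∀ N, νtop.Everything N := bookInputs_top.everything
  levelOne_of_rows (canon_implications₇₁ νtop μtop κtop) b b b b trivial

/-- THE NODE IS A GENUINE PREMISE AS TYPED: every input granted, the node DENIED, every edge valid: C80 FAILS; C59 and C47 HOLD. [cite: EischenHarrisLiSkinner2020, Main Thm 108 hypotheses (bookkeeping proved here)] -/
theorem levelOne_needs_node_top :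
    Implications71 νtop (canon νtop μtop κtop) (canon₇₁no νtop μtop κtop) ∧ (¬ (canon₇₁no νtop μtop κtop).EHLSpadicL ∧ (canon₇₁no νtop μtop κtop).DummiganLifts ∧ (canon₇₁no νtop μtop κtop).LachausseeConducteur) :=
  have b : ∀ N, νtop.Everything N := bookInputs_top.everything
  ⟨canon_implications₇₁no _ _ _, ⟨fun h => h, ⟨b, b, b⟩, ⟨b, b, b⟩⟩⟩

/-- BOOK SIDE, EXACT SUPPORT AS TYPED: in the book countermodel of ANY leaf `l` (node granted; every edge valid) C59 and C47 FAIL and C80 HOLDS. [cite: Dummigan2017LiftingPuzzles, p0003:L28; Lachaussee2020Conducteur, p0077:L6 (bookkeeping proved here)] -/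
theorem levelOne_book_cm (l : LeafSupport.Leaf) :
    Implications71 (LeafSupport.mkN (LeafSupport.cm l)) (canon (LeafSupport.mkN (LeafSupport.cm l)) μtop κtop) (canon₇₁ (LeafSupport.mkN (LeafSupport.cm l)) μtop κtop) ∧
      (¬ (canon₇₁ (LeafSupport.mkN (LeafSupport.cm l)) μtop κtop).DummiganLifts ∧ ¬ (canon₇₁ (LeafSupport.mkN (LeafSupport.cm l)) μtop κtop).LachausseeConducteur ∧ (canon₇₁ (LeafSupport.mkN (LeafSupport.cm l)) μtop κtop).EHLSpadicL) ∧
      (∀ l', l' ≠ l → (LeafSupport.mkN (LeafSupport.cm l)).leaf l') ∧ ¬ (LeafSupport.mkN (LeafSupport.cm l)).leaf l :=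
  have cmod := LeafSupport.countermodel l
  have n := not_B_cm l
  ⟨canon_implications₇₁ _ _ _, ⟨fun h => n h.1, fun h => n h.1, trivial⟩, cmod.2.1, cmod.2.2.1⟩

/-- MOK SIDE: in Mok's countermodel of ANY of its leaves (book at the top, KMSW without its import of Mok, node granted) all three statements HOLD — none of
them has a Mok premise as typed. [cite: EischenHarrisLiSkinner2020, p0060:L36 (bookkeeping proved here)] -/
theorem levelOne_mok_cm (l : Mok2015.LeafSupport.Leaf) :
    Mok2015.LeafSupport.Systems (Mok2015.LeafSupport.mkN (Mok2015.LeafSupport.cm l)) ∧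
      (∀ l', l' ≠ l → (Mok2015.LeafSupport.mkN (Mok2015.LeafSupport.cm l)).leaf l') ∧ ¬ (Mok2015.LeafSupport.mkN (Mok2015.LeafSupport.cm l)).leaf l ∧
      Implications71 νtop (canon νtop (Mok2015.LeafSupport.mkN (Mok2015.LeafSupport.cm l)) κnoMok) (canon₇₁ νtop (Mok2015.LeafSupport.mkN (Mok2015.LeafSupport.cm l)) κnoMok) ∧
      ((canon₇₁ νtop (Mok2015.LeafSupport.mkN (Mok2015.LeafSupport.cm l)) κnoMok).DummiganLifts ∧ (canon₇₁ νtop (Mok2015.LeafSupport.mkN (Mok2015.LeafSupport.cm l)) κnoMok).LachausseeConducteur ∧ (canon₇₁ νtop (Mok2015.LeafSupport.mkN (Mok2015.LeafSupport.cm l)) κnoMok).EHLSpadicL) :=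
  have cmod := Mok2015.LeafSupport.countermodel l
  have b : ∀ N, νtop.Everything N := bookInputs_top.everything
  ⟨cmod.1, cmod.2.1, cmod.2.2.1, canon_implications₇₁ _ _ _, ⟨⟨b, b, b⟩, ⟨b, b, b⟩, trivial⟩⟩

/-- KMSW SIDE: book and Mok at the top, KMSW's countermodel of a leaf `l ≠ MokMain` (node granted): all three statements HOLD — none has a KMSW premise as
typed (C80's dependence on the unitary classification lives in its node). [claim: KalethaMinguezShinWhite2014, under-review] [cite: EischenHarrisLiSkinner2020, p0060:L37 (bookkeeping proved here)] -/
theorem levelOne_kmsw_cm (l : KMSW2014.LeafSupport.Leaf) (hl : l ≠ .MokMain) :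
    (∃ ωκ, KMSW2014.LeafSupport.Systems (KMSW2014.LeafSupport.mkN (KMSW2014.LeafSupport.cm l)) ωκ) ∧
      (∀ l', l' ≠ l → (KMSW2014.LeafSupport.mkN (KMSW2014.LeafSupport.cm l)).leaf l') ∧ ¬ (KMSW2014.LeafSupport.mkN (KMSW2014.LeafSupport.cm l)).leaf l ∧
      KMSW2014.E_ImportMok μtop (KMSW2014.LeafSupport.mkN (KMSW2014.LeafSupport.cm l)) ∧
      Implications71 νtop (canon νtop μtop (KMSW2014.LeafSupport.mkN (KMSW2014.LeafSupport.cm l))) (canon₇₁ νtop μtop (KMSW2014.LeafSupport.mkN (KMSW2014.LeafSupport.cm l))) ∧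
      ((canon₇₁ νtop μtop (KMSW2014.LeafSupport.mkN (KMSW2014.LeafSupport.cm l))).DummiganLifts ∧ (canon₇₁ νtop μtop (KMSW2014.LeafSupport.mkN (KMSW2014.LeafSupport.cm l))).LachausseeConducteur ∧ (canon₇₁ νtop μtop (KMSW2014.LeafSupport.mkN (KMSW2014.LeafSupport.cm l))).EHLSpadicL) :=
  have cmod := KMSW2014.LeafSupport.countermodel l
  have b : ∀ N, νtop.Everything N := bookInputs_top.everything
  ⟨⟨_, cmod.1⟩, cmod.2.1, cmod.2.2.1, fun _ => cmod.2.1 .MokMain (Ne.symm hl), canon_implications₇₁ _ _ _, ⟨⟨b, b, b⟩, ⟨b, b, b⟩, trivial⟩⟩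

/-- THE SEVENTY-FIRST TRANCHE REGRADED, in one statement: (i) at the top, node granted, all three hold; (ii) node denied, C80 fails and C59, C47 hold; (iii) in
the book countermodel of any leaf C59, C47 fail and C80 holds; (iv) in every Mok countermodel and (v) every KMSW countermodel (l ≠ MokMain) all three hold. [cite: Dummigan2017LiftingPuzzles, Props 5.1–5.6; Lachaussee2020Conducteur, Thms 2, 3, 5; EischenHarrisLiSkinner2020, Main Thm 108 (bookkeeping proved here)] -/
theorem levelOne_regraded :
    ((canon₇₁ νtop μtop κtop).DummiganLifts ∧ (canon₇₁ νtop μtop κtop).LachausseeConducteur ∧ (canon₇₁ νtop μtop κtop).EHLSpadicL) ∧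
      (¬ (canon₇₁no νtop μtop κtop).EHLSpadicL ∧ (canon₇₁no νtop μtop κtop).DummiganLifts ∧ (canon₇₁no νtop μtop κtop).LachausseeConducteur) ∧
      (∀ l : LeafSupport.Leaf, (¬ (canon₇₁ (LeafSupport.mkN (LeafSupport.cm l)) μtop κtop).DummiganLifts ∧ ¬ (canon₇₁ (LeafSupport.mkN (LeafSupport.cm l)) μtop κtop).LachausseeConducteur ∧ (canon₇₁ (LeafSupport.mkN (LeafSupport.cm l)) μtop κtop).EHLSpadicL)) ∧
      (∀ l : Mok2015.LeafSupport.Leaf, ((canon₇₁ νtop (Mok2015.LeafSupport.mkN (Mok2015.LeafSupport.cm l)) κnoMok).DummiganLifts ∧ (canon₇₁ νtop (Mok2015.LeafSupport.mkN (Mok2015.LeafSupport.cm l)) κnoMok).LachausseeConducteur ∧ (canon₇₁ νtop (Mok2015.LeafSupport.mkN (Mok2015.LeafSupport.cm l)) κnoMok).EHLSpadicL)) ∧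
      (∀ l : KMSW2014.LeafSupport.Leaf, l ≠ .MokMain → ((canon₇₁ νtop μtop (KMSW2014.LeafSupport.mkN (KMSW2014.LeafSupport.cm l))).DummiganLifts ∧ (canon₇₁ νtop μtop (KMSW2014.LeafSupport.mkN (KMSW2014.LeafSupport.cm l))).LachausseeConducteur ∧ (canon₇₁ νtop μtop (KMSW2014.LeafSupport.mkN (KMSW2014.LeafSupport.cm l))).EHLSpadicL)) :=
  ⟨seventyfirst_holds_top, levelOne_needs_node_top.2, fun l => (levelOne_book_cm l).2.1, fun l => (levelOne_mok_cm l).2.2.2.2,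
    fun l hl => (levelOne_kmsw_cm l hl).2.2.2.2.2⟩

/-! ## 71. Sixty-eighth tranche (v2 of this file, after `Downstream18.lean` v2; unit `pub-arthur-down-g30`): supports of ARITHMETIC GEOMETRY AND
L-VALUES, UNITARY AND SYMPLECTIC — C65 `NguyenKottwitzPEL`, C68 `HarronJorzaLinvariant`, C98 `ClozelKretRankin`, C70 `HMYBallQuotients`, C79
`GHLDelignePeriods`; see the module docstring for the summary of what is certified. -/

section Canon68

variable (ν : Nodes) (μ : Mok2015.Nodes) (κ : KMSW2014.Nodes)

/-- The canonical reading of the sixty-eighth tranche: each statement := the conjunction of the DAG outputs its edge consumes, C191 replaced by its `canon₂₈` value (book ∧ `GeeTaibi`'s `canon` value). [cite: Nguyen2023Kottwitz, Thm 4.2; HarronJorza2017, Thm 18; ClozelKret2025Rankin, Thm 3.2; HorinagaMaedaYamauchi2025Kodaira, Thm 1.1; GrobnerHarrisLin2025Periods, Thm 2 (canonical model; bookkeeping)] -/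
abbrev canon₆₈ : Consumers68 where
  NguyenKottwitzPEL := (∀ N, μ.Everything N) ∧ (∀ N, κ.Scope N)
  HarronJorzaLinvariant := (∀ N, ν.Everything N) ∧ (∀ N, μ.Everything N) ∧ (canon₂₈ ν μ κ).MokGSp4
  ClozelKretRankin := (∀ N, ν.Everything N)
  HMYBallQuotients := (∀ N, μ.Everything N) ∧ (∀ N, κ.Full N)
  GHLDelignePeriods := (∀ N, μ.Everything N) ∧ (∀ N, κ.Scope N)

/-- Every sixty-eighth-tranche edge holds in the canonical reading, for arbitrary ν, μ, κ. [cite: Nguyen2023Kottwitz, p0003:L60; HarronJorza2017, p0018:L36 (bookkeeping proved here)] -/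
theorem canon_implications₆₈ : Implications68 ν μ κ (canon₂₈ ν μ κ) (canon₆₈ ν μ κ) where
  nguyen := fun m s => ⟨m, s⟩
  harronJorza := fun b m g => ⟨b, m, g⟩
  clozelKret := fun b => b
  hmy := fun m f => ⟨m, f⟩
  ghl := fun m s => ⟨m, s⟩

end Canon68

/-- At the top (every input of the three DAGs and KMSW's sequels granted) all five statements hold — through `arithmeticII_of_rows`. [cite: Nguyen2023Kottwitz, Thm 4.2; HorinagaMaedaYamauchi2025Kodaira, Thm 1.1 (bookkeeping proved here)] -/
theorem sixtyeighth_holds_top : ((canon₆₈ νtop μtop κtop).NguyenKottwitzPEL ∧ (canon₆₈ νtop μtop κtop).HarronJorzaLinvariant ∧ (canon₆₈ νtop μtop κtop).ClozelKretRankin ∧ (canon₆₈ νtop μtop κtop).HMYBallQuotients ∧ (canon₆₈ νtop μtop κtop).GHLDelignePeriods) :=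
  have b : ∀ N, νtop.Everything N := bookInputs_top.everything
  have m : ∀ N, μtop.Everything N := mokInputs_top.everything
  have KQ := kmswInputs_top μtop
  have s : ∀ N, κtop.Scope N := KQ.1.scope mokInputs_top
  have f : ∀ N, κtop.Full N := KQ.1.full mokInputs_top KQ.2
  arithmeticII_of_rows (canon_implications₆₈ νtop μtop κtop) b m s f ⟨b, b⟩

/-- BOOK SIDE, EXACT SUPPORT AS TYPED: in the book countermodel of ANY leaf `l` (Mok and KMSW at the top; every edge valid) C68 and C98 FAIL; the three
unitary rows HOLD. [cite: HarronJorza2017, p0004:L55-58; ClozelKret2025Rankin, p0003:L39 (bookkeeping proved here)] -/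
theorem arithmeticII_book_cm (l : LeafSupport.Leaf) :
    Implications68 (LeafSupport.mkN (LeafSupport.cm l)) μtop κtop (canon₂₈ (LeafSupport.mkN (LeafSupport.cm l)) μtop κtop) (canon₆₈ (LeafSupport.mkN (LeafSupport.cm l)) μtop κtop) ∧
      (¬ (canon₆₈ (LeafSupport.mkN (LeafSupport.cm l)) μtop κtop).HarronJorzaLinvariant ∧ ¬ (canon₆₈ (LeafSupport.mkN (LeafSupport.cm l)) μtop κtop).ClozelKretRankin ∧ (canon₆₈ (LeafSupport.mkN (LeafSupport.cm l)) μtop κtop).NguyenKottwitzPEL ∧ (canon₆₈ (LeafSupport.mkN (LeafSupport.cm l)) μtop κtop).HMYBallQuotients ∧ (canon₆₈ (LeafSupport.mkN (LeafSupport.cm l)) μtop κtop).GHLDelignePeriods) ∧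
      (∀ l', l' ≠ l → (LeafSupport.mkN (LeafSupport.cm l)).leaf l') ∧ ¬ (LeafSupport.mkN (LeafSupport.cm l)).leaf l :=
  have cmod := LeafSupport.countermodel l
  have n := not_B_cm l
  have m : ∀ N, μtop.Everything N := mokInputs_top.everything
  have KQ := kmswInputs_top μtop
  have s : ∀ N, κtop.Scope N := KQ.1.scope mokInputs_top
  have f : ∀ N, κtop.Full N := KQ.1.full mokInputs_top KQ.2
  ⟨canon_implications₆₈ _ _ _, ⟨fun h => n h.1, n, ⟨m, s⟩, ⟨m, f⟩, ⟨m, s⟩⟩, cmod.2.1, cmod.2.2.1⟩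

/-- MOK SIDE, EXACT SUPPORT AS TYPED: in Mok's countermodel of ANY of its leaves (book at the top; KMSW read without its import of Mok; every edge valid)
C65, C68, C70, C79 FAIL and C98 HOLDS. [cite: Nguyen2023Kottwitz, p0032:L62-63; GrobnerHarrisLin2025Periods, p0032:L11 (bookkeeping proved here)] -/
theorem arithmeticII_mok_cm (l : Mok2015.LeafSupport.Leaf) :
    Mok2015.LeafSupport.Systems (Mok2015.LeafSupport.mkN (Mok2015.LeafSupport.cm l)) ∧
      (∀ l', l' ≠ l → (Mok2015.LeafSupport.mkN (Mok2015.LeafSupport.cm l)).leaf l') ∧ ¬ (Mok2015.LeafSupport.mkN (Mok2015.LeafSupport.cm l)).leaf l ∧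
      Implications68 νtop (Mok2015.LeafSupport.mkN (Mok2015.LeafSupport.cm l)) κnoMok (canon₂₈ νtop (Mok2015.LeafSupport.mkN (Mok2015.LeafSupport.cm l)) κnoMok) (canon₆₈ νtop (Mok2015.LeafSupport.mkN (Mok2015.LeafSupport.cm l)) κnoMok) ∧
      (¬ (canon₆₈ νtop (Mok2015.LeafSupport.mkN (Mok2015.LeafSupport.cm l)) κnoMok).NguyenKottwitzPEL ∧ ¬ (canon₆₈ νtop (Mok2015.LeafSupport.mkN (Mok2015.LeafSupport.cm l)) κnoMok).HarronJorzaLinvariant ∧ ¬ (canon₆₈ νtop (Mok2015.LeafSupport.mkN (Mok2015.LeafSupport.cm l)) κnoMok).HMYBallQuotients ∧ ¬ (canon₆₈ νtop (Mok2015.LeafSupport.mkN (Mok2015.LeafSupport.cm l)) κnoMok).GHLDelignePeriods ∧ (canon₆₈ νtop (Mok2015.LeafSupport.mkN (Mok2015.LeafSupport.cm l)) κnoMok).ClozelKretRankin) :=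
  have cmod := Mok2015.LeafSupport.countermodel l
  have nm := not_M_cm l
  have b : ∀ N, νtop.Everything N := bookInputs_top.everything
  ⟨cmod.1, cmod.2.1, cmod.2.2.1, canon_implications₆₈ _ _ _,
    ⟨fun h => nm h.1, fun h => nm h.2.1, fun h => nm h.1, fun h => nm h.1, b⟩⟩

/-- KMSW SIDE, EXACT SUPPORT AS TYPED: book and Mok at the top, KMSW's countermodel of a leaf `l ≠ MokMain` (every KMSW edge valid, the other KMSW leaves
true; every edge valid): C70 FAILS for EVERY such leaf, the two SEQUELS included (KMSW in full is its premise); C68 and C98 HOLD; C65 and C79 (KMSW's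
proved scope) HOLD iff `l.onlyFull` (the two sequels and the non-generic chapters) — i.e. they FAIL exactly in the countermodels of the scope leaves. [claim: KalethaMinguezShinWhite2014, under-review] [cite: HorinagaMaedaYamauchi2025Kodaira, Thm 5.7; Nguyen2023Kottwitz, p0010:L3 (bookkeeping proved here)] -/
theorem arithmeticII_kmsw_cm (l : KMSW2014.LeafSupport.Leaf) (hl : l ≠ .MokMain) :
    (∃ ωκ, KMSW2014.LeafSupport.Systems (KMSW2014.LeafSupport.mkN (KMSW2014.LeafSupport.cm l)) ωκ) ∧
      (∀ l', l' ≠ l → (KMSW2014.LeafSupport.mkN (KMSW2014.LeafSupport.cm l)).leaf l') ∧ ¬ (KMSW2014.LeafSupport.mkN (KMSW2014.LeafSupport.cm l)).leaf l ∧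
      KMSW2014.E_ImportMok μtop (KMSW2014.LeafSupport.mkN (KMSW2014.LeafSupport.cm l)) ∧
      Implications68 νtop μtop (KMSW2014.LeafSupport.mkN (KMSW2014.LeafSupport.cm l)) (canon₂₈ νtop μtop (KMSW2014.LeafSupport.mkN (KMSW2014.LeafSupport.cm l))) (canon₆₈ νtop μtop (KMSW2014.LeafSupport.mkN (KMSW2014.LeafSupport.cm l))) ∧
      (¬ (canon₆₈ νtop μtop (KMSW2014.LeafSupport.mkN (KMSW2014.LeafSupport.cm l))).HMYBallQuotients ∧ (canon₆₈ νtop μtop (KMSW2014.LeafSupport.mkN (KMSW2014.LeafSupport.cm l))).HarronJorzaLinvariant ∧ (canon₆₈ νtop μtop (KMSW2014.LeafSupport.mkN (KMSW2014.LeafSupport.cm l))).ClozelKretRankin) ∧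
      ((canon₆₈ νtop μtop (KMSW2014.LeafSupport.mkN (KMSW2014.LeafSupport.cm l))).NguyenKottwitzPEL ↔ l.onlyFull = true) ∧
      ((canon₆₈ νtop μtop (KMSW2014.LeafSupport.mkN (KMSW2014.LeafSupport.cm l))).GHLDelignePeriods ↔ l.onlyFull = true) :=
  have cmod := KMSW2014.LeafSupport.countermodel l
  have b : ∀ N, νtop.Everything N := bookInputs_top.everything
  have m : ∀ N, μtop.Everything N := mokInputs_top.everything
  have nf : ¬ ∀ N, (KMSW2014.LeafSupport.mkN (KMSW2014.LeafSupport.cm l)).Full N :=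
    fun h => KMSW2014.LeafSupport.not_full_of_noFull (cmod.2.2.2 0) (h 0)
  have hsc : (∀ N, (KMSW2014.LeafSupport.mkN (KMSW2014.LeafSupport.cm l)).Scope N) ↔ l.onlyFull = true := by
    constructor
    · intro hk
      cases hb : l.onlyFull
      · exact absurd (hk 0) (KMSW2014.LeafSupport.not_scope_of (KMSW2014.LeafSupport.scope_fails l hb 0))
      · rfl
    · intro h
      exact scope_of_onlyFull l h
  ⟨⟨_, cmod.1⟩, cmod.2.1, cmod.2.2.1, fun _ => cmod.2.1 .MokMain (Ne.symm hl), canon_implications₆₈ _ _ _,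
    ⟨fun h => nf h.2, ⟨b, m, ⟨b, b⟩⟩, b⟩,
    ⟨fun h => hsc.1 h.2, fun h => ⟨m, hsc.2 h⟩⟩, ⟨fun h => hsc.1 h.2, fun h => ⟨m, hsc.2 h⟩⟩⟩

/-- THE SIXTY-EIGHTH TRANCHE REGRADED, in one statement: (i) at the top all five hold; (ii) in the book countermodel of any leaf C68, C98 fail and the
unitary rows hold; (iii) in every Mok countermodel the four Mok-premised rows fail and C98 holds; (iv) in every KMSW countermodel (l ≠ MokMain) C70 fails
and C68, C98 hold. [cite: Nguyen2023Kottwitz, Thm 4.2; HarronJorza2017, Thm 18; ClozelKret2025Rankin, Thm 3.2; HorinagaMaedaYamauchi2025Kodaira, Thm 1.1; GrobnerHarrisLin2025Periods, Thm 2 (bookkeeping proved here)] -/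
theorem arithmeticII_regraded :
    ((canon₆₈ νtop μtop κtop).NguyenKottwitzPEL ∧ (canon₆₈ νtop μtop κtop).HarronJorzaLinvariant ∧ (canon₆₈ νtop μtop κtop).ClozelKretRankin ∧ (canon₆₈ νtop μtop κtop).HMYBallQuotients ∧ (canon₆₈ νtop μtop κtop).GHLDelignePeriods) ∧
      (∀ l : LeafSupport.Leaf, (¬ (canon₆₈ (LeafSupport.mkN (LeafSupport.cm l)) μtop κtop).HarronJorzaLinvariant ∧ ¬ (canon₆₈ (LeafSupport.mkN (LeafSupport.cm l)) μtop κtop).ClozelKretRankin ∧ (canon₆₈ (LeafSupport.mkN (LeafSupport.cm l)) μtop κtop).NguyenKottwitzPEL ∧ (canon₆₈ (LeafSupport.mkN (LeafSupport.cm l)) μtop κtop).HMYBallQuotients ∧ (canon₆₈ (LeafSupport.mkN (LeafSupport.cm l)) μtop κtop).GHLDelignePeriods)) ∧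
      (∀ l : Mok2015.LeafSupport.Leaf, (¬ (canon₆₈ νtop (Mok2015.LeafSupport.mkN (Mok2015.LeafSupport.cm l)) κnoMok).NguyenKottwitzPEL ∧ ¬ (canon₆₈ νtop (Mok2015.LeafSupport.mkN (Mok2015.LeafSupport.cm l)) κnoMok).HarronJorzaLinvariant ∧ ¬ (canon₆₈ νtop (Mok2015.LeafSupport.mkN (Mok2015.LeafSupport.cm l)) κnoMok).HMYBallQuotients ∧ ¬ (canon₆₈ νtop (Mok2015.LeafSupport.mkN (Mok2015.LeafSupport.cm l)) κnoMok).GHLDelignePeriods ∧ (canon₆₈ νtop (Mok2015.LeafSupport.mkN (Mok2015.LeafSupport.cm l)) κnoMok).ClozelKretRankin)) ∧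
      (∀ l : KMSW2014.LeafSupport.Leaf, l ≠ .MokMain → (¬ (canon₆₈ νtop μtop (KMSW2014.LeafSupport.mkN (KMSW2014.LeafSupport.cm l))).HMYBallQuotients ∧ (canon₆₈ νtop μtop (KMSW2014.LeafSupport.mkN (KMSW2014.LeafSupport.cm l))).HarronJorzaLinvariant ∧ (canon₆₈ νtop μtop (KMSW2014.LeafSupport.mkN (KMSW2014.LeafSupport.cm l))).ClozelKretRankin)) :=
  ⟨sixtyeighth_holds_top, fun l => (arithmeticII_book_cm l).2.1, fun l => (arithmeticII_mok_cm l).2.2.2.2,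
    fun l hl => (arithmeticII_kmsw_cm l hl).2.2.2.2.2.1⟩

/-! ## 72. Sixty-ninth tranche (v2 of this file, after `Downstream18.lean` v2; unit `pub-arthur-down-g30`): supports of MULTIPLICITY ONE AND THE
STABLE TRACE FORMULA AS SIDE INPUTS — C72 `BRCuspidalCohomology`, C75 `AtanasovHarrisTW`, C81 `GuerberoffCriticalValues` (node `GuerberoffHypMult`), C36
`ZhuOrthogonalIH` (node `ZhuHyp202`); see the module docstring for the summary of what is certified. -/

section Canon69

variable (ν : Nodes) (μ : Mok2015.Nodes) (κ : KMSW2014.Nodes)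

/-- The canonical reading of the sixty-ninth tranche with the two hypothesis nodes GRANTED: C72 := book ∧ Mok ∧ C51's `canon₆₅` value; C75 := KMSW's scope; the nodes := True; C81 := True; C36 := book ∧ A3's `canon` value ∧ True. [cite: BhagwatRaghuram2015Endoscopy, Thm 5; AtanasovHarris2025TWII, Thm 22; Guerberoff2018Periods, Thm 1; Zhu2018FrobeniusHecke, Thm 246 (canonical model; bookkeeping)] -/
abbrev canon₆₉ : Consumers69 where
  BRCuspidalCohomology := (∀ N, ν.Everything N) ∧ (∀ N, μ.Everything N) ∧ (canon₆₅ ν μ κ).MagaardSavinG2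
  AtanasovHarrisTW := (∀ N, κ.Scope N)
  GuerberoffHypMult := True
  GuerberoffCriticalValues := True
  ZhuHyp202 := True
  ZhuOrthogonalIH := (∀ N, ν.Everything N) ∧ (canon ν μ κ).TaibiInner ∧ True

/-- The reading with the two nodes DENIED: the node fields and C81 := False; C36 := book ∧ A3's value ∧ False; C72, C75 as in `canon₆₉`. [cite: Guerberoff2018Periods, Hypothesis 4.5.1; Zhu2018FrobeniusHecke, Hypothesis 202 (canonical model; bookkeeping)] -/
abbrev canon₆₉no : Consumers69 where
  BRCuspidalCohomology := (∀ N, ν.Everything N) ∧ (∀ N, μ.Everything N) ∧ (canon₆₅ ν μ κ).MagaardSavinG2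
  AtanasovHarrisTW := (∀ N, κ.Scope N)
  GuerberoffHypMult := False
  GuerberoffCriticalValues := False
  ZhuHyp202 := False
  ZhuOrthogonalIH := (∀ N, ν.Everything N) ∧ (canon ν μ κ).TaibiInner ∧ False

/-- Every sixty-ninth-tranche edge holds in the nodes-granted reading, for arbitrary ν, μ, κ. [cite: BhagwatRaghuram2015Endoscopy, p0008:L52; Zhu2018FrobeniusHecke, p0004:L20 (bookkeeping proved here)] -/
theorem canon_implications₆₉ : Implications69 ν μ κ (canon ν μ κ) (canon₆₅ ν μ κ) (canon₆₉ ν μ κ) where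
  bhagwatRaghuram := fun b m g => ⟨b, m, g⟩
  atanasovHarris := fun s => s
  guerberoff := fun h => h
  zhu := fun b t z => ⟨b, t, z⟩

/-- The edges also hold in the nodes-denied reading. [cite: Guerberoff2018Periods, §4.5; Zhu2018FrobeniusHecke, §(hypothesis) (bookkeeping proved here)] -/
theorem canon_implications₆₉no : Implications69 ν μ κ (canon ν μ κ) (canon₆₅ ν μ κ) (canon₆₉no ν μ κ) where
  bhagwatRaghuram := fun b m g => ⟨b, m, g⟩
  atanasovHarris := fun s => s
  guerberoff := fun h => h
  zhu := fun b t z => ⟨b, t, z⟩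

end Canon69

/-- At the top (every input of the three DAGs granted, nodes granted) all four statements hold — through `sideInputs_of_rows`. [cite: BhagwatRaghuram2015Endoscopy, Thm 5; AtanasovHarris2025TWII, Thm 22 (bookkeeping proved here)] -/
theorem sixtyninth_holds_top : ((canon₆₉ νtop μtop κtop).BRCuspidalCohomology ∧ (canon₆₉ νtop μtop κtop).AtanasovHarrisTW ∧ (canon₆₉ νtop μtop κtop).GuerberoffCriticalValues ∧ (canon₆₉ νtop μtop κtop).ZhuOrthogonalIH) :=
  have b : ∀ N, νtop.Everything N := bookInputs_top.everything
  have m : ∀ N, μtop.Everything N := mokInputs_top.everything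
  have KQ := kmswInputs_top μtop
  have s : ∀ N, κtop.Scope N := KQ.1.scope mokInputs_top
  sideInputs_of_rows (canon_implications₆₉ νtop μtop κtop) b m s b b trivial trivial

/-- THE NODES ARE GENUINE PREMISES AS TYPED: every DAG input granted, the two nodes DENIED, every edge valid: C81 and C36 FAIL; C72 and C75 HOLD. [cite: Guerberoff2018Periods, Thm 1 hypothesis; Zhu2018FrobeniusHecke, Thm 246 hypothesis (bookkeeping proved here)] -/
theorem sideInputs_need_nodes_top :
    Implications69 νtop μtop κtop (canon νtop μtop κtop) (canon₆₅ νtop μtop κtop) (canon₆₉no νtop μtop κtop) ∧ (¬ (canon₆₉no νtop μtop κtop).GuerberoffCriticalValues ∧ ¬ (canon₆₉no νtop μtop κtop).ZhuOrthogonalIH ∧ (canon₆₉no νtop μtop κtop).BRCuspidalCohomology ∧ (canon₆₉no νtop μtop κtop).AtanasovHarrisTW) :=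
  have b : ∀ N, νtop.Everything N := bookInputs_top.everything
  have m : ∀ N, μtop.Everything N := mokInputs_top.everything
  have KQ := kmswInputs_top μtop
  have s : ∀ N, κtop.Scope N := KQ.1.scope mokInputs_top
  ⟨canon_implications₆₉no _ _ _, ⟨fun h => h, fun h => h.2.2, ⟨b, m, b⟩, s⟩⟩

/-- BOOK SIDE, EXACT SUPPORT AS TYPED: in the book countermodel of ANY leaf `l` (Mok and KMSW at the top, nodes granted; every edge valid) C72 and C36 FAIL;
C75 and C81 HOLD. [cite: BhagwatRaghuram2015Endoscopy, p0005:L3; Zhu2018FrobeniusHecke, p0085:L11 (bookkeeping proved here)] -/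
theorem sideInputs_book_cm (l : LeafSupport.Leaf) :
    Implications69 (LeafSupport.mkN (LeafSupport.cm l)) μtop κtop (canon (LeafSupport.mkN (LeafSupport.cm l)) μtop κtop) (canon₆₅ (LeafSupport.mkN (LeafSupport.cm l)) μtop κtop) (canon₆₉ (LeafSupport.mkN (LeafSupport.cm l)) μtop κtop) ∧
      (¬ (canon₆₉ (LeafSupport.mkN (LeafSupport.cm l)) μtop κtop).BRCuspidalCohomology ∧ ¬ (canon₆₉ (LeafSupport.mkN (LeafSupport.cm l)) μtop κtop).ZhuOrthogonalIH ∧ (canon₆₉ (LeafSupport.mkN (LeafSupport.cm l)) μtop κtop).AtanasovHarrisTW ∧ (canon₆₉ (LeafSupport.mkN (LeafSupport.cm l)) μtop κtop).GuerberoffCriticalValues) ∧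
      (∀ l', l' ≠ l → (LeafSupport.mkN (LeafSupport.cm l)).leaf l') ∧ ¬ (LeafSupport.mkN (LeafSupport.cm l)).leaf l :=
  have cmod := LeafSupport.countermodel l
  have n := not_B_cm l
  have KQ := kmswInputs_top μtop
  have s : ∀ N, κtop.Scope N := KQ.1.scope mokInputs_top
  ⟨canon_implications₆₉ _ _ _, ⟨fun h => n h.1, fun h => n h.1, s, trivial⟩, cmod.2.1, cmod.2.2.1⟩

/-- MOK SIDE, EXACT SUPPORT AS TYPED: in Mok's countermodel of ANY of its leaves (book at the top; KMSW read without its import of Mok, so its proved scope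
fails too; nodes granted; every edge valid) C72 and C75 FAIL; C81 and C36 HOLD. [cite: BhagwatRaghuram2015Endoscopy, p0012:L110-112; AtanasovHarris2025TWII, p0017:L12 (bookkeeping proved here)] -/
theorem sideInputs_mok_cm (l : Mok2015.LeafSupport.Leaf) :
    Mok2015.LeafSupport.Systems (Mok2015.LeafSupport.mkN (Mok2015.LeafSupport.cm l)) ∧
      (∀ l', l' ≠ l → (Mok2015.LeafSupport.mkN (Mok2015.LeafSupport.cm l)).leaf l') ∧ ¬ (Mok2015.LeafSupport.mkN (Mok2015.LeafSupport.cm l)).leaf l ∧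
      Implications69 νtop (Mok2015.LeafSupport.mkN (Mok2015.LeafSupport.cm l)) κnoMok (canon νtop (Mok2015.LeafSupport.mkN (Mok2015.LeafSupport.cm l)) κnoMok) (canon₆₅ νtop (Mok2015.LeafSupport.mkN (Mok2015.LeafSupport.cm l)) κnoMok) (canon₆₉ νtop (Mok2015.LeafSupport.mkN (Mok2015.LeafSupport.cm l)) κnoMok) ∧
      (¬ (canon₆₉ νtop (Mok2015.LeafSupport.mkN (Mok2015.LeafSupport.cm l)) κnoMok).BRCuspidalCohomology ∧ ¬ (canon₆₉ νtop (Mok2015.LeafSupport.mkN (Mok2015.LeafSupport.cm l)) κnoMok).AtanasovHarrisTW ∧ (canon₆₉ νtop (Mok2015.LeafSupport.mkN (Mok2015.LeafSupport.cm l)) κnoMok).GuerberoffCriticalValues ∧ (canon₆₉ νtop (Mok2015.LeafSupport.mkN (Mok2015.LeafSupport.cm l)) κnoMok).ZhuOrthogonalIH) :=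
  have cmod := Mok2015.LeafSupport.countermodel l
  have nm := not_M_cm l
  have kf := κnoMok_facts
  have nk : ¬ ∀ N, κnoMok.Scope N := fun h => kf.2.2.2.2.2.1 0 (h 0)
  have b : ∀ N, νtop.Everything N := bookInputs_top.everything
  ⟨cmod.1, cmod.2.1, cmod.2.2.1, canon_implications₆₉ _ _ _,
    ⟨fun h => nm h.2.1, nk, trivial, ⟨b, b, trivial⟩⟩⟩

/-- KMSW SIDE, EXACT SUPPORT AS TYPED: book and Mok at the top, KMSW's countermodel of a leaf `l ≠ MokMain` (every KMSW edge valid, the other KMSW leaves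
true; nodes granted; every edge valid): C72, C81, C36 HOLD; C75 HOLDS iff `l.onlyFull` — it fails exactly in the countermodels of KMSW's proved-scope leaves
and holds in those of the two sequels and the non-generic chapters. [claim: KalethaMinguezShinWhite2014, under-review] [cite: AtanasovHarris2025TWII, §4.2.1 (bookkeeping proved here)] -/
theorem sideInputs_kmsw_cm (l : KMSW2014.LeafSupport.Leaf) (hl : l ≠ .MokMain) :
    (∃ ωκ, KMSW2014.LeafSupport.Systems (KMSW2014.LeafSupport.mkN (KMSW2014.LeafSupport.cm l)) ωκ) ∧
      (∀ l', l' ≠ l → (KMSW2014.LeafSupport.mkN (KMSW2014.LeafSupport.cm l)).leaf l') ∧ ¬ (KMSW2014.LeafSupport.mkN (KMSW2014.LeafSupport.cm l)).leaf l ∧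
      KMSW2014.E_ImportMok μtop (KMSW2014.LeafSupport.mkN (KMSW2014.LeafSupport.cm l)) ∧
      Implications69 νtop μtop (KMSW2014.LeafSupport.mkN (KMSW2014.LeafSupport.cm l)) (canon νtop μtop (KMSW2014.LeafSupport.mkN (KMSW2014.LeafSupport.cm l))) (canon₆₅ νtop μtop (KMSW2014.LeafSupport.mkN (KMSW2014.LeafSupport.cm l))) (canon₆₉ νtop μtop (KMSW2014.LeafSupport.mkN (KMSW2014.LeafSupport.cm l))) ∧
      ((canon₆₉ νtop μtop (KMSW2014.LeafSupport.mkN (KMSW2014.LeafSupport.cm l))).BRCuspidalCohomology ∧ (canon₆₉ νtop μtop (KMSW2014.LeafSupport.mkN (KMSW2014.LeafSupport.cm l))).GuerberoffCriticalValues ∧ (canon₆₉ νtop μtop (KMSW2014.LeafSupport.mkN (KMSW2014.LeafSupport.cm l))).ZhuOrthogonalIH ∧ ((canon₆₉ νtop μtop (KMSW2014.LeafSupport.mkN (KMSW2014.LeafSupport.cm l))).AtanasovHarrisTW ↔ l.onlyFull = true)) :=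
  have cmod := KMSW2014.LeafSupport.countermodel l
  have b : ∀ N, νtop.Everything N := bookInputs_top.everything
  have m : ∀ N, μtop.Everything N := mokInputs_top.everything
  have hsc : (∀ N, (KMSW2014.LeafSupport.mkN (KMSW2014.LeafSupport.cm l)).Scope N) ↔ l.onlyFull = true := by
    constructor
    · intro hk
      cases hb : l.onlyFull
      · exact absurd (hk 0) (KMSW2014.LeafSupport.not_scope_of (KMSW2014.LeafSupport.scope_fails l hb 0))
      · rfl
    · intro h
      exact scope_of_onlyFull l h
  ⟨⟨_, cmod.1⟩, cmod.2.1, cmod.2.2.1, fun _ => cmod.2.1 .MokMain (Ne.symm hl), canon_implications₆₉ _ _ _,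
    ⟨⟨b, m, b⟩, trivial, ⟨b, b, trivial⟩, hsc⟩⟩

/-- THE SIXTY-NINTH TRANCHE REGRADED, in one statement: (i) at the top, nodes granted, all four hold; (ii) nodes denied, C81 and C36 fail, C72 and C75 hold;
(iii) in the book countermodel of any leaf C72, C36 fail and C75, C81 hold; (iv) in every Mok countermodel C72, C75 fail and C81, C36 hold; (v) in every KMSW
countermodel (l ≠ MokMain) C72, C81, C36 hold and C75 ↔ l.onlyFull. [cite: BhagwatRaghuram2015Endoscopy, Thm 5; AtanasovHarris2025TWII, Thm 22; Guerberoff2018Periods, Thm 1; Zhu2018FrobeniusHecke, Thm 246 (bookkeeping proved here)] -/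
theorem sideInputs_regraded :
    ((canon₆₉ νtop μtop κtop).BRCuspidalCohomology ∧ (canon₆₉ νtop μtop κtop).AtanasovHarrisTW ∧ (canon₆₉ νtop μtop κtop).GuerberoffCriticalValues ∧ (canon₆₉ νtop μtop κtop).ZhuOrthogonalIH) ∧
      (¬ (canon₆₉no νtop μtop κtop).GuerberoffCriticalValues ∧ ¬ (canon₆₉no νtop μtop κtop).ZhuOrthogonalIH ∧ (canon₆₉no νtop μtop κtop).BRCuspidalCohomology ∧ (canon₆₉no νtop μtop κtop).AtanasovHarrisTW) ∧
      (∀ l : LeafSupport.Leaf, (¬ (canon₆₉ (LeafSupport.mkN (LeafSupport.cm l)) μtop κtop).BRCuspidalCohomology ∧ ¬ (canon₆₉ (LeafSupport.mkN (LeafSupport.cm l)) μtop κtop).ZhuOrthogonalIH ∧ (canon₆₉ (LeafSupport.mkN (LeafSupport.cm l)) μtop κtop).AtanasovHarrisTW ∧ (canon₆₉ (LeafSupport.mkN (LeafSupport.cm l)) μtop κtop).GuerberoffCriticalValues)) ∧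
      (∀ l : Mok2015.LeafSupport.Leaf, (¬ (canon₆₉ νtop (Mok2015.LeafSupport.mkN (Mok2015.LeafSupport.cm l)) κnoMok).BRCuspidalCohomology ∧ ¬ (canon₆₉ νtop (Mok2015.LeafSupport.mkN (Mok2015.LeafSupport.cm l)) κnoMok).AtanasovHarrisTW ∧ (canon₆₉ νtop (Mok2015.LeafSupport.mkN (Mok2015.LeafSupport.cm l)) κnoMok).GuerberoffCriticalValues ∧ (canon₆₉ νtop (Mok2015.LeafSupport.mkN (Mok2015.LeafSupport.cm l)) κnoMok).ZhuOrthogonalIH)) ∧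
      (∀ l : KMSW2014.LeafSupport.Leaf, l ≠ .MokMain → ((canon₆₉ νtop μtop (KMSW2014.LeafSupport.mkN (KMSW2014.LeafSupport.cm l))).BRCuspidalCohomology ∧ (canon₆₉ νtop μtop (KMSW2014.LeafSupport.mkN (KMSW2014.LeafSupport.cm l))).GuerberoffCriticalValues ∧ (canon₆₉ νtop μtop (KMSW2014.LeafSupport.mkN (KMSW2014.LeafSupport.cm l))).ZhuOrthogonalIH ∧ ((canon₆₉ νtop μtop (KMSW2014.LeafSupport.mkN (KMSW2014.LeafSupport.cm l))).AtanasovHarrisTW ↔ l.onlyFull = true))) :=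
  ⟨sixtyninth_holds_top, sideInputs_need_nodes_top.2, fun l => (sideInputs_book_cm l).2.1, fun l => (sideInputs_mok_cm l).2.2.2.2,
    fun l hl => (sideInputs_kmsw_cm l hl).2.2.2.2.2⟩

/-! ## 73. Seventieth tranche (v2 of this file, after `Downstream18.lean` v2; unit `pub-arthur-down-g30`): supports of RECENT CONSUMERS OF THE
MULTIPLICITY FORMULA — C122 `WanSelmerUrs`, C40 `PengWhitmoreRT`, C128 / C157 `KimYamauchiSp6`, C92 `MullerTheta`; see the module docstring for the summary of what
is certified. -/

section Canon70

variable (ν : Nodes) (μ : Mok2015.Nodes) (κ : KMSW2014.Nodes)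

/-- The canonical reading of the seventieth tranche: C122 := Mok ∧ KMSW's scope; C40 := book; C128 := book ∧ C55's `canon₃₃` value; C92 := book ∧ C5's and A3's `canon` values. [cite: Wan2019IwasawaUrs, Thm 1.3; PengWhitmore2026OrthogonalRT, Thm 1; KimYamauchi2025E73, Thm 8.7; Muller2026Theta, Thm 1 (canonical model; bookkeeping)] -/
abbrev canon₇₀ : Consumers70 where
  WanSelmerUrs := (∀ N, μ.Everything N) ∧ (∀ N, κ.Scope N)
  PengWhitmoreRT := (∀ N, ν.Everything N)
  KimYamauchiSp6 := (∀ N, ν.Everything N) ∧ (canon₃₃ ν μ κ).AtobeSiegelAMF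
  MullerTheta := (∀ N, ν.Everything N) ∧ (canon ν μ κ).ChenevierLannesStar ∧ (canon ν μ κ).TaibiInner

/-- Every seventieth-tranche edge holds in the canonical reading, for arbitrary ν, μ, κ. [cite: Wan2019IwasawaUrs, Rem. 1.5; Muller2026Theta, p0005:L3 (bookkeeping proved here)] -/
theorem canon_implications₇₀ : Implications70 ν μ κ (canon ν μ κ) (canon₃₃ ν μ κ) (canon₇₀ ν μ κ) where
  wan := fun m s => ⟨m, s⟩
  pengWhitmore := fun b => b
  kimYamauchi := fun b a => ⟨b, a⟩
  muller := fun b h5 h3 => ⟨b, h5, h3⟩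

end Canon70

/-- At the top (every input of the three DAGs granted) all four statements hold — through `recentAMF_of_rows`. [cite: Wan2019IwasawaUrs, Thm 1.3; Muller2026Theta, Thm 1 (bookkeeping proved here)] -/
theorem seventieth_holds_top : ((canon₇₀ νtop μtop κtop).WanSelmerUrs ∧ (canon₇₀ νtop μtop κtop).PengWhitmoreRT ∧ (canon₇₀ νtop μtop κtop).KimYamauchiSp6 ∧ (canon₇₀ νtop μtop κtop).MullerTheta) :=
  have b : ∀ N, νtop.Everything N := bookInputs_top.everything
  have m : ∀ N, μtop.Everything N := mokInputs_top.everything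
  have KQ := kmswInputs_top μtop
  have s : ∀ N, κtop.Scope N := KQ.1.scope mokInputs_top
  recentAMF_of_rows (canon_implications₇₀ νtop μtop κtop) b m s b b b

/-- BOOK SIDE, EXACT SUPPORT AS TYPED: in the book countermodel of ANY leaf `l` (Mok and KMSW at the top; every edge valid) C40, C128, C92 FAIL and C122 HOLDS. [cite: Muller2026Theta, Rem. 4 (p0002:L29); PengWhitmore2026OrthogonalRT, p0007:L57 (bookkeeping proved here)] -/
theorem recentAMF_book_cm (l : LeafSupport.Leaf) :
    Implications70 (LeafSupport.mkN (LeafSupport.cm l)) μtop κtop (canon (LeafSupport.mkN (LeafSupport.cm l)) μtop κtop) (canon₃₃ (LeafSupport.mkN (LeafSupport.cm l)) μtop κtop) (canon₇₀ (LeafSupport.mkN (LeafSupport.cm l)) μtop κtop) ∧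
      (¬ (canon₇₀ (LeafSupport.mkN (LeafSupport.cm l)) μtop κtop).PengWhitmoreRT ∧ ¬ (canon₇₀ (LeafSupport.mkN (LeafSupport.cm l)) μtop κtop).KimYamauchiSp6 ∧ ¬ (canon₇₀ (LeafSupport.mkN (LeafSupport.cm l)) μtop κtop).MullerTheta ∧ (canon₇₀ (LeafSupport.mkN (LeafSupport.cm l)) μtop κtop).WanSelmerUrs) ∧
      (∀ l', l' ≠ l → (LeafSupport.mkN (LeafSupport.cm l)).leaf l') ∧ ¬ (LeafSupport.mkN (LeafSupport.cm l)).leaf l :=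
  have cmod := LeafSupport.countermodel l
  have n := not_B_cm l
  have m : ∀ N, μtop.Everything N := mokInputs_top.everything
  have KQ := kmswInputs_top μtop
  have s : ∀ N, κtop.Scope N := KQ.1.scope mokInputs_top
  ⟨canon_implications₇₀ _ _ _, ⟨n, fun h => n h.1, fun h => n h.1, ⟨m, s⟩⟩, cmod.2.1, cmod.2.2.1⟩

/-- MOK SIDE, EXACT SUPPORT AS TYPED: in Mok's countermodel of ANY of its leaves (book at the top; KMSW read without its import of Mok; every edge valid) only
C122 FAILS. [cite: Wan2019IwasawaUrs, p0039:L51 ([Mok]) (bookkeeping proved here)] -/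
theorem recentAMF_mok_cm (l : Mok2015.LeafSupport.Leaf) :
    Mok2015.LeafSupport.Systems (Mok2015.LeafSupport.mkN (Mok2015.LeafSupport.cm l)) ∧
      (∀ l', l' ≠ l → (Mok2015.LeafSupport.mkN (Mok2015.LeafSupport.cm l)).leaf l') ∧ ¬ (Mok2015.LeafSupport.mkN (Mok2015.LeafSupport.cm l)).leaf l ∧
      Implications70 νtop (Mok2015.LeafSupport.mkN (Mok2015.LeafSupport.cm l)) κnoMok (canon νtop (Mok2015.LeafSupport.mkN (Mok2015.LeafSupport.cm l)) κnoMok) (canon₃₃ νtop (Mok2015.LeafSupport.mkN (Mok2015.LeafSupport.cm l)) κnoMok) (canon₇₀ νtop (Mok2015.LeafSupport.mkN (Mok2015.LeafSupport.cm l)) κnoMok) ∧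
      (¬ (canon₇₀ νtop (Mok2015.LeafSupport.mkN (Mok2015.LeafSupport.cm l)) κnoMok).WanSelmerUrs ∧ (canon₇₀ νtop (Mok2015.LeafSupport.mkN (Mok2015.LeafSupport.cm l)) κnoMok).PengWhitmoreRT ∧ (canon₇₀ νtop (Mok2015.LeafSupport.mkN (Mok2015.LeafSupport.cm l)) κnoMok).KimYamauchiSp6 ∧ (canon₇₀ νtop (Mok2015.LeafSupport.mkN (Mok2015.LeafSupport.cm l)) κnoMok).MullerTheta) :=
  have cmod := Mok2015.LeafSupport.countermodel l
  have nm := not_M_cm l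
  have b : ∀ N, νtop.Everything N := bookInputs_top.everything
  ⟨cmod.1, cmod.2.1, cmod.2.2.1, canon_implications₇₀ _ _ _,
    ⟨fun h => nm h.1, b, ⟨b, b⟩, ⟨b, b, b⟩⟩⟩

/-- KMSW SIDE, EXACT SUPPORT AS TYPED: book and Mok at the top, KMSW's countermodel of a leaf `l ≠ MokMain` (every KMSW edge valid, the other KMSW leaves true;
every edge valid): the three book rows HOLD; C122 HOLDS iff `l.onlyFull` — it fails exactly for KMSW's proved-scope leaves, both sequels irrelevant. [claim: KalethaMinguezShinWhite2014, under-review] [cite: Wan2019IwasawaUrs, Rem. 1.5 (bookkeeping proved here)] -/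
theorem recentAMF_kmsw_cm (l : KMSW2014.LeafSupport.Leaf) (hl : l ≠ .MokMain) :
    (∃ ωκ, KMSW2014.LeafSupport.Systems (KMSW2014.LeafSupport.mkN (KMSW2014.LeafSupport.cm l)) ωκ) ∧
      (∀ l', l' ≠ l → (KMSW2014.LeafSupport.mkN (KMSW2014.LeafSupport.cm l)).leaf l') ∧ ¬ (KMSW2014.LeafSupport.mkN (KMSW2014.LeafSupport.cm l)).leaf l ∧
      KMSW2014.E_ImportMok μtop (KMSW2014.LeafSupport.mkN (KMSW2014.LeafSupport.cm l)) ∧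
      Implications70 νtop μtop (KMSW2014.LeafSupport.mkN (KMSW2014.LeafSupport.cm l)) (canon νtop μtop (KMSW2014.LeafSupport.mkN (KMSW2014.LeafSupport.cm l))) (canon₃₃ νtop μtop (KMSW2014.LeafSupport.mkN (KMSW2014.LeafSupport.cm l))) (canon₇₀ νtop μtop (KMSW2014.LeafSupport.mkN (KMSW2014.LeafSupport.cm l))) ∧
      ((canon₇₀ νtop μtop (KMSW2014.LeafSupport.mkN (KMSW2014.LeafSupport.cm l))).PengWhitmoreRT ∧ (canon₇₀ νtop μtop (KMSW2014.LeafSupport.mkN (KMSW2014.LeafSupport.cm l))).KimYamauchiSp6 ∧ (canon₇₀ νtop μtop (KMSW2014.LeafSupport.mkN (KMSW2014.LeafSupport.cm l))).MullerTheta ∧ ((canon₇₀ νtop μtop (KMSW2014.LeafSupport.mkN (KMSW2014.LeafSupport.cm l))).WanSelmerUrs ↔ l.onlyFull = true)) :=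
  have cmod := KMSW2014.LeafSupport.countermodel l
  have b : ∀ N, νtop.Everything N := bookInputs_top.everything
  have m : ∀ N, μtop.Everything N := mokInputs_top.everything
  have hsc : (∀ N, (KMSW2014.LeafSupport.mkN (KMSW2014.LeafSupport.cm l)).Scope N) ↔ l.onlyFull = true := by
    constructor
    · intro hk
      cases hb : l.onlyFull
      · exact absurd (hk 0) (KMSW2014.LeafSupport.not_scope_of (KMSW2014.LeafSupport.scope_fails l hb 0))
      · rfl
    · intro h
      exact scope_of_onlyFull l h
  ⟨⟨_, cmod.1⟩, cmod.2.1, cmod.2.2.1, fun _ => cmod.2.1 .MokMain (Ne.symm hl), canon_implications₇₀ _ _ _,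
    ⟨b, ⟨b, b⟩, ⟨b, b, b⟩, ⟨fun h => hsc.1 h.2, fun h => ⟨m, hsc.2 h⟩⟩⟩⟩

/-- THE SEVENTIETH TRANCHE REGRADED, in one statement: (i) at the top all four hold; (ii) in the book countermodel of any leaf the three book rows fail and C122
holds; (iii) in every Mok countermodel only C122 fails; (iv) in every KMSW countermodel (l ≠ MokMain) the book rows hold and C122 ↔ l.onlyFull. [cite: Wan2019IwasawaUrs, Thm 1.3; PengWhitmore2026OrthogonalRT, Thm 1; KimYamauchi2025E73, Thm 8.7; Muller2026Theta, Thm 1 (bookkeeping proved here)] -/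
theorem recentAMF_regraded :
    ((canon₇₀ νtop μtop κtop).WanSelmerUrs ∧ (canon₇₀ νtop μtop κtop).PengWhitmoreRT ∧ (canon₇₀ νtop μtop κtop).KimYamauchiSp6 ∧ (canon₇₀ νtop μtop κtop).MullerTheta) ∧
      (∀ l : LeafSupport.Leaf, (¬ (canon₇₀ (LeafSupport.mkN (LeafSupport.cm l)) μtop κtop).PengWhitmoreRT ∧ ¬ (canon₇₀ (LeafSupport.mkN (LeafSupport.cm l)) μtop κtop).KimYamauchiSp6 ∧ ¬ (canon₇₀ (LeafSupport.mkN (LeafSupport.cm l)) μtop κtop).MullerTheta ∧ (canon₇₀ (LeafSupport.mkN (LeafSupport.cm l)) μtop κtop).WanSelmerUrs)) ∧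
      (∀ l : Mok2015.LeafSupport.Leaf, (¬ (canon₇₀ νtop (Mok2015.LeafSupport.mkN (Mok2015.LeafSupport.cm l)) κnoMok).WanSelmerUrs ∧ (canon₇₀ νtop (Mok2015.LeafSupport.mkN (Mok2015.LeafSupport.cm l)) κnoMok).PengWhitmoreRT ∧ (canon₇₀ νtop (Mok2015.LeafSupport.mkN (Mok2015.LeafSupport.cm l)) κnoMok).KimYamauchiSp6 ∧ (canon₇₀ νtop (Mok2015.LeafSupport.mkN (Mok2015.LeafSupport.cm l)) κnoMok).MullerTheta)) ∧
      (∀ l : KMSW2014.LeafSupport.Leaf, l ≠ .MokMain → ((canon₇₀ νtop μtop (KMSW2014.LeafSupport.mkN (KMSW2014.LeafSupport.cm l))).PengWhitmoreRT ∧ (canon₇₀ νtop μtop (KMSW2014.LeafSupport.mkN (KMSW2014.LeafSupport.cm l))).KimYamauchiSp6 ∧ (canon₇₀ νtop μtop (KMSW2014.LeafSupport.mkN (KMSW2014.LeafSupport.cm l))).MullerTheta ∧ ((canon₇₀ νtop μtop (KMSW2014.LeafSupport.mkN (KMSW2014.LeafSupport.cm l))).WanSelmerUrs ↔ l.onlyFull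 = true))) :=
  ⟨seventieth_holds_top, fun l => (recentAMF_book_cm l).2.1, fun l => (recentAMF_mok_cm l).2.2.2.2,
    fun l hl => (recentAMF_kmsw_cm l hl).2.2.2.2.2⟩

/-! ## 75. Seventy-second tranche (v2 of this file, after `Downstream19.lean` v2; unit `pub-arthur-down-g30`): supports of THE ANTICYCLOTOMIC LINE AND TWO
CONSTRUCTIONS — C123 `LaiWallCrossing`, C22 `LaiSkinnerEuler`, C133 `KimYamauchiGSpin210` (node `KYTransferHyp`), C129 `ItoDoubleDescent`; see the module docstring for
the summary of what is certified. -/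

section Canon72

variable (ν : Nodes) (μ : Mok2015.Nodes) (κ : KMSW2014.Nodes)

/-- The canonical reading of the seventy-second tranche with the node GRANTED: C123, C22 := KMSW's scope; the node := True; C133 := book ∧ True; C129 := book ∧ A5's `canon` value. [cite: Lai2024WallCrossing, Thm 1.3; LaiSkinner2024DiagonalCycles, Thm 1.4; KimYamauchi2018GSpin210, Thm 1.1; Ito2025DoubleDescent, Thm 1.2 (canonical model; bookkeeping)] -/
abbrev canon₇₂ : Consumers72 where
  LaiWallCrossing := (∀ N, κ.Scope N)
  LaiSkinnerEuler := (∀ N, κ.Scope N)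
  KYTransferHyp := True
  KimYamauchiGSpin210 := (∀ N, ν.Everything N) ∧ True
  ItoDoubleDescent := (∀ N, ν.Everything N) ∧ (canon ν μ κ).IshimotoFull

/-- The reading with the node DENIED: the node := False, C133 := book ∧ False; the others as in `canon₇₂`. [cite: KimYamauchi2018GSpin210, Thm 1.1 hypothesis (canonical model; bookkeeping)] -/
abbrev canon₇₂no : Consumers72 where
  LaiWallCrossing := (∀ N, κ.Scope N)
  LaiSkinnerEuler := (∀ N, κ.Scope N)
  KYTransferHyp := False
  KimYamauchiGSpin210 := (∀ N, ν.Everything N) ∧ False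
  ItoDoubleDescent := (∀ N, ν.Everything N) ∧ (canon ν μ κ).IshimotoFull

/-- Every seventy-second-tranche edge holds in the node-granted reading, for arbitrary ν, μ, κ. [cite: Lai2024WallCrossing, p0017:L41; Ito2025DoubleDescent, p0005:L95 (bookkeeping proved here)] -/
theorem canon_implications₇₂ : Implications72 ν κ (canon ν μ κ) (canon₇₂ ν μ κ) where
  lai := fun s => s
  laiSkinner := fun s => s
  kimYamauchi := fun b t => ⟨b, t⟩
  ito := fun b a => ⟨b, a⟩

/-- The edges also hold in the node-denied reading. [cite: KimYamauchi2018GSpin210, Thm 1.1 (bookkeeping proved here)] -/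
theorem canon_implications₇₂no : Implications72 ν κ (canon ν μ κ) (canon₇₂no ν μ κ) where
  lai := fun s => s
  laiSkinner := fun s => s
  kimYamauchi := fun b t => ⟨b, t⟩
  ito := fun b a => ⟨b, a⟩

end Canon72

/-- At the top (every input granted, node granted) all four statements hold — through `anticyclotomic_of_rows`. [cite: Lai2024WallCrossing, Thm 1.3; Ito2025DoubleDescent, Thm 1.2 (bookkeeping proved here)] -/
theorem seventysecond_holds_top : ((canon₇₂ νtop μtop κtop).LaiWallCrossing ∧ (canon₇₂ νtop μtop κtop).LaiSkinnerEuler ∧ (canon₇₂ νtop μtop κtop).KimYamauchiGSpin210 ∧ (canon₇₂ νtop μtop κtop).ItoDoubleDescent) :=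
  have b : ∀ N, νtop.Everything N := bookInputs_top.everything
  have KQ := kmswInputs_top μtop
  have s : ∀ N, κtop.Scope N := KQ.1.scope mokInputs_top
  anticyclotomic_of_rows (canon_implications₇₂ νtop μtop κtop) b s b trivial

/-- THE NODE IS A GENUINE PREMISE AS TYPED: every input granted, the node DENIED, every edge valid: C133 FAILS; C123, C22, C129 HOLD. [cite: KimYamauchi2018GSpin210, Thm 1.1 hypothesis (bookkeeping proved here)] -/
theorem anticyclotomic_needs_node_top :
    Implications72 νtop κtop (canon νtop μtop κtop) (canon₇₂no νtop μtop κtop) ∧ (¬ (canon₇₂no νtop μtop κtop).KimYamauchiGSpin210 ∧ (canon₇₂no νtop μtop κtop).LaiWallCrossing ∧ (canon₇₂no νtop μtop κtop).LaiSkinnerEuler ∧ (canon₇₂no νtop μtop κtop).ItoDoubleDescent) :=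
  have b : ∀ N, νtop.Everything N := bookInputs_top.everything
  have KQ := kmswInputs_top μtop
  have s : ∀ N, κtop.Scope N := KQ.1.scope mokInputs_top
  ⟨canon_implications₇₂no _ _ _, ⟨fun h => h.2, s, s, ⟨b, b⟩⟩⟩

/-- BOOK SIDE, EXACT SUPPORT AS TYPED: in the book countermodel of ANY leaf `l` (Mok and KMSW at the top, node granted; every edge valid) C133 and C129 FAIL; C123
and C22 HOLD. [cite: KimYamauchi2018GSpin210, p0003:L44; Ito2025DoubleDescent, p0010:L3 (bookkeeping proved here)] -/
theorem anticyclotomic_book_cm (l : LeafSupport.Leaf) :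
    Implications72 (LeafSupport.mkN (LeafSupport.cm l)) κtop (canon (LeafSupport.mkN (LeafSupport.cm l)) μtop κtop) (canon₇₂ (LeafSupport.mkN (LeafSupport.cm l)) μtop κtop) ∧
      (¬ (canon₇₂ (LeafSupport.mkN (LeafSupport.cm l)) μtop κtop).KimYamauchiGSpin210 ∧ ¬ (canon₇₂ (LeafSupport.mkN (LeafSupport.cm l)) μtop κtop).ItoDoubleDescent ∧ (canon₇₂ (LeafSupport.mkN (LeafSupport.cm l)) μtop κtop).LaiWallCrossing ∧ (canon₇₂ (LeafSupport.mkN (LeafSupport.cm l)) μtop κtop).LaiSkinnerEuler) ∧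
      (∀ l', l' ≠ l → (LeafSupport.mkN (LeafSupport.cm l)).leaf l') ∧ ¬ (LeafSupport.mkN (LeafSupport.cm l)).leaf l :=
  have cmod := LeafSupport.countermodel l
  have n := not_B_cm l
  have KQ := kmswInputs_top μtop
  have s : ∀ N, κtop.Scope N := KQ.1.scope mokInputs_top
  ⟨canon_implications₇₂ _ _ _, ⟨fun h => n h.1, fun h => n h.1, s, s⟩, cmod.2.1, cmod.2.2.1⟩

/-- MOK SIDE, EXACT SUPPORT AS TYPED: in Mok's countermodel of ANY of its leaves (book at the top; KMSW read without its import of Mok, so its proved scope fails;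
node granted) C123 and C22 FAIL; C133 and C129 HOLD. [cite: Lai2024WallCrossing, p0023:L166 ([KMSW]) (bookkeeping proved here)] -/
theorem anticyclotomic_mok_cm (l : Mok2015.LeafSupport.Leaf) :
    Mok2015.LeafSupport.Systems (Mok2015.LeafSupport.mkN (Mok2015.LeafSupport.cm l)) ∧
      (∀ l', l' ≠ l → (Mok2015.LeafSupport.mkN (Mok2015.LeafSupport.cm l)).leaf l') ∧ ¬ (Mok2015.LeafSupport.mkN (Mok2015.LeafSupport.cm l)).leaf l ∧
      Implications72 νtop κnoMok (canon νtop (Mok2015.LeafSupport.mkN (Mok2015.LeafSupport.cm l)) κnoMok) (canon₇₂ νtop (Mok2015.LeafSupport.mkN (Mok2015.LeafSupport.cm l)) κnoMok) ∧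
      (¬ (canon₇₂ νtop (Mok2015.LeafSupport.mkN (Mok2015.LeafSupport.cm l)) κnoMok).LaiWallCrossing ∧ ¬ (canon₇₂ νtop (Mok2015.LeafSupport.mkN (Mok2015.LeafSupport.cm l)) κnoMok).LaiSkinnerEuler ∧ (canon₇₂ νtop (Mok2015.LeafSupport.mkN (Mok2015.LeafSupport.cm l)) κnoMok).KimYamauchiGSpin210 ∧ (canon₇₂ νtop (Mok2015.LeafSupport.mkN (Mok2015.LeafSupport.cm l)) κnoMok).ItoDoubleDescent) :=
  have cmod := Mok2015.LeafSupport.countermodel l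
  have kf := κnoMok_facts
  have nk : ¬ ∀ N, κnoMok.Scope N := fun h => kf.2.2.2.2.2.1 0 (h 0)
  have b : ∀ N, νtop.Everything N := bookInputs_top.everything
  ⟨cmod.1, cmod.2.1, cmod.2.2.1, canon_implications₇₂ _ _ _, ⟨nk, nk, ⟨b, trivial⟩, ⟨b, b⟩⟩⟩

/-- KMSW SIDE, EXACT SUPPORT AS TYPED: book and Mok at the top, KMSW's countermodel of a leaf `l ≠ MokMain` (node granted): C133 and C129 HOLD; C123 and C22 HOLD
iff `l.onlyFull` — they fail exactly for KMSW's proved-scope leaves, the two sequels being irrelevant (Lai: « since our L-parameters are generic »). [claim: KalethaMinguezShinWhite2014, under-review] [cite: Lai2024WallCrossing, p0017:L41; LaiSkinner2024DiagonalCycles, p0019:L88 (bookkeeping proved here)] -/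
theorem anticyclotomic_kmsw_cm (l : KMSW2014.LeafSupport.Leaf) (hl : l ≠ .MokMain) :
    (∃ ωκ, KMSW2014.LeafSupport.Systems (KMSW2014.LeafSupport.mkN (KMSW2014.LeafSupport.cm l)) ωκ) ∧
      (∀ l', l' ≠ l → (KMSW2014.LeafSupport.mkN (KMSW2014.LeafSupport.cm l)).leaf l') ∧ ¬ (KMSW2014.LeafSupport.mkN (KMSW2014.LeafSupport.cm l)).leaf l ∧
      KMSW2014.E_ImportMok μtop (KMSW2014.LeafSupport.mkN (KMSW2014.LeafSupport.cm l)) ∧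
      Implications72 νtop (KMSW2014.LeafSupport.mkN (KMSW2014.LeafSupport.cm l)) (canon νtop μtop (KMSW2014.LeafSupport.mkN (KMSW2014.LeafSupport.cm l))) (canon₇₂ νtop μtop (KMSW2014.LeafSupport.mkN (KMSW2014.LeafSupport.cm l))) ∧
      ((canon₇₂ νtop μtop (KMSW2014.LeafSupport.mkN (KMSW2014.LeafSupport.cm l))).KimYamauchiGSpin210 ∧ (canon₇₂ νtop μtop (KMSW2014.LeafSupport.mkN (KMSW2014.LeafSupport.cm l))).ItoDoubleDescent ∧ ((canon₇₂ νtop μtop (KMSW2014.LeafSupport.mkN (KMSW2014.LeafSupport.cm l))).LaiWallCrossing ↔ l.onlyFull = true) ∧ ((canon₇₂ νtop μtop (KMSW2014.LeafSupport.mkN (KMSW2014.LeafSupport.cm l))).LaiSkinnerEuler ↔ l.onlyFull = true)) :=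
  have cmod := KMSW2014.LeafSupport.countermodel l
  have b : ∀ N, νtop.Everything N := bookInputs_top.everything
  have hsc : (∀ N, (KMSW2014.LeafSupport.mkN (KMSW2014.LeafSupport.cm l)).Scope N) ↔ l.onlyFull = true := by
    constructor
    · intro hk
      cases hb : l.onlyFull
      · exact absurd (hk 0) (KMSW2014.LeafSupport.not_scope_of (KMSW2014.LeafSupport.scope_fails l hb 0))
      · rfl
    · intro h
      exact scope_of_onlyFull l h
  ⟨⟨_, cmod.1⟩, cmod.2.1, cmod.2.2.1, fun _ => cmod.2.1 .MokMain (Ne.symm hl), canon_implications₇₂ _ _ _,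
    ⟨⟨b, trivial⟩, ⟨b, b⟩, hsc, hsc⟩⟩

/-- THE SEVENTY-SECOND TRANCHE REGRADED, in one statement: (i) at the top, node granted, all four hold; (ii) node denied, C133 fails and the others hold; (iii) in
the book countermodel of any leaf C133, C129 fail and C123, C22 hold; (iv) in every Mok countermodel C123, C22 fail and C133, C129 hold; (v) in every KMSW
countermodel (l ≠ MokMain) C133, C129 hold and C123, C22 ↔ l.onlyFull. [cite: Lai2024WallCrossing, Thm 1.3; LaiSkinner2024DiagonalCycles, Thm 1.4; KimYamauchi2018GSpin210, Thm 1.1; Ito2025DoubleDescent, Thm 1.2 (bookkeeping proved here)] -/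
theorem anticyclotomic_regraded :
    ((canon₇₂ νtop μtop κtop).LaiWallCrossing ∧ (canon₇₂ νtop μtop κtop).LaiSkinnerEuler ∧ (canon₇₂ νtop μtop κtop).KimYamauchiGSpin210 ∧ (canon₇₂ νtop μtop κtop).ItoDoubleDescent) ∧
      (¬ (canon₇₂no νtop μtop κtop).KimYamauchiGSpin210 ∧ (canon₇₂no νtop μtop κtop).LaiWallCrossing ∧ (canon₇₂no νtop μtop κtop).LaiSkinnerEuler ∧ (canon₇₂no νtop μtop κtop).ItoDoubleDescent) ∧
      (∀ l : LeafSupport.Leaf, (¬ (canon₇₂ (LeafSupport.mkN (LeafSupport.cm l)) μtop κtop).KimYamauchiGSpin210 ∧ ¬ (canon₇₂ (LeafSupport.mkN (LeafSupport.cm l)) μtop κtop).ItoDoubleDescent ∧ (canon₇₂ (LeafSupport.mkN (LeafSupport.cm l)) μtop κtop).LaiWallCrossing ∧ (canon₇₂ (LeafSupport.mkN (LeafSupport.cm l)) μtop κtop).LaiSkinnerEuler)) ∧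
      (∀ l : Mok2015.LeafSupport.Leaf, (¬ (canon₇₂ νtop (Mok2015.LeafSupport.mkN (Mok2015.LeafSupport.cm l)) κnoMok).LaiWallCrossing ∧ ¬ (canon₇₂ νtop (Mok2015.LeafSupport.mkN (Mok2015.LeafSupport.cm l)) κnoMok).LaiSkinnerEuler ∧ (canon₇₂ νtop (Mok2015.LeafSupport.mkN (Mok2015.LeafSupport.cm l)) κnoMok).KimYamauchiGSpin210 ∧ (canon₇₂ νtop (Mok2015.LeafSupport.mkN (Mok2015.LeafSupport.cm l)) κnoMok).ItoDoubleDescent)) ∧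
      (∀ l : KMSW2014.LeafSupport.Leaf, l ≠ .MokMain → ((canon₇₂ νtop μtop (KMSW2014.LeafSupport.mkN (KMSW2014.LeafSupport.cm l))).KimYamauchiGSpin210 ∧ (canon₇₂ νtop μtop (KMSW2014.LeafSupport.mkN (KMSW2014.LeafSupport.cm l))).ItoDoubleDescent ∧ ((canon₇₂ νtop μtop (KMSW2014.LeafSupport.mkN (KMSW2014.LeafSupport.cm l))).LaiWallCrossing ↔ l.onlyFull = true) ∧ ((canon₇₂ νtop μtop (KMSW2014.LeafSupport.mkN (KMSW2014.LeafSupport.cm l))).LaiSkinnerEuler ↔ l.onlyFull = true))) :=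
  ⟨seventysecond_holds_top, anticyclotomic_needs_node_top.2, fun l => (anticyclotomic_book_cm l).2.1, fun l => (anticyclotomic_mok_cm l).2.2.2.2,
    fun l hl => (anticyclotomic_kmsw_cm l hl).2.2.2.2.2⟩

/-! ## 76. Seventy-third tranche (v3 of this file, after `Downstream19.lean` v3; unit `pub-arthur-down-g31`): supports of PERIODS, POLES AND DISTINCTION
THROUGH THE PARAMETER — C132 `JiangWuChiB`, C138 `JZBesselDescents`, C137 `MitraOffenSpDist`, C134 `BRWRPoincare`; see the module docstring for the summary of
what is certified. -/

section Canon73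

variable (ν : Nodes) (μ : Mok2015.Nodes) (κ : KMSW2014.Nodes)

/-- The canonical reading of the seventy-third tranche, Chapter 9 GRANTED (over `canon₈`): C132 := Mok ∧ KMSW in full; C138 := book ∧ `canon₈`'s node and C16 values; C137 := Mok ∧ `canon₅₁`'s Mœglin – Tadić value ∧ `canon₄₅`'s E43 value; C134 := book. [cite: JiangWu2016ChiB, Thm 5.4; JiangZhang2021BesselDescents, Thm 6.1; MitraOffen2021SpDist, Thm 2; BRWR2016Poincare, Thm 1 (canonical model; bookkeeping)] -/
abbrev canon₇₃ : Consumers73 where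
  JiangWuChiB := (∀ N, μ.Everything N) ∧ (∀ N, κ.Full N)
  JZBesselDescents := (∀ N, ν.Everything N) ∧ (canon₈ ν μ κ).InnerTwists ∧ (canon₈ ν μ κ).JZmain
  MitraOffenSpDist := (∀ N, μ.Everything N) ∧ (canon₅₁ ν).MoeglinTadicDS ∧ (canon₄₅ ν).MoeglinUnitaryDS
  BRWRPoincare := (∀ N, ν.Everything N)

/-- The reading with the Chapter-9 node DENIED (over `canon₈no`: `InnerTwists`, `JZmain` false): C138 then carries two `False` conjuncts; the other three as in `canon₇₃`. [cite: JiangZhang2021BesselDescents, Thm 2.1 as cited for pure inner forms (p0006:L4-5, L95-97) (separating model; bookkeeping)] -/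
abbrev canon₇₃no9 : Consumers73 where
  JiangWuChiB := (∀ N, μ.Everything N) ∧ (∀ N, κ.Full N)
  JZBesselDescents := (∀ N, ν.Everything N) ∧ (canon₈no ν μ).InnerTwists ∧ (canon₈no ν μ).JZmain
  MitraOffenSpDist := (∀ N, μ.Everything N) ∧ (canon₅₁ ν).MoeglinTadicDS ∧ (canon₄₅ ν).MoeglinUnitaryDS
  BRWRPoincare := (∀ N, ν.Everything N)

/-- Every seventy-third-tranche edge holds in the Chapter-9-granted reading, for arbitrary ν, μ, κ. [cite: JiangWu2016ChiB, p0004:L3-4; JiangZhang2021BesselDescents, p0006:L95; MitraOffen2021SpDist, Rem. 1; BRWR2016Poincare, p0011:L60 (bookkeeping proved here)] -/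
theorem canon_implications₇₃ : Implications73 ν μ κ (canon₈ ν μ κ) (canon₄₅ ν) (canon₅₁ ν) (canon₇₃ ν μ κ) where
  jiangWu := fun m f => ⟨m, f⟩
  jiangZhang := fun b t j => ⟨b, t, j⟩
  mitraOffen := fun m t u => ⟨m, t, u⟩
  brwr := fun b => b

/-- The edges also hold in the Chapter-9-denied reading. [cite: JiangZhang2021BesselDescents, Thm 2.1 as cited (bookkeeping proved here)] -/
theorem canon_implications₇₃no9 : Implications73 ν μ κ (canon₈no ν μ) (canon₄₅ ν) (canon₅₁ ν) (canon₇₃no9 ν μ κ) where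
  jiangWu := fun m f => ⟨m, f⟩
  jiangZhang := fun b t j => ⟨b, t, j⟩
  mitraOffen := fun m t u => ⟨m, t, u⟩
  brwr := fun b => b

end Canon73

/-- Row E43's canonical value (the conjunction of its five PUBLISHED leaves) holds at the top. [cite: Moeglin2007Unitary, hypotheses p0001:L14-17 (bookkeeping proved here)] -/
theorem e43_canon_top : (canon₄₅ νtop).MoeglinUnitaryDS :=
  have P := bookInputs_top.published
  ⟨P.llc, P.fl, P.transfer, P.itf, P.ttf⟩

/-- At the top (every input of the three DAGs, KMSW's two sequels and Chapter 9 granted) all four statements hold — through `periodsPoles_of_rows`. [cite: JiangWu2016ChiB, Thm 5.4; JiangZhang2021BesselDescents, Thm 6.1; MitraOffen2021SpDist, Thm 2; BRWR2016Poincare, Thm 1 (bookkeeping proved here)] -/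
theorem seventythird_holds_top : ((canon₇₃ νtop μtop κtop).JiangWuChiB ∧ (canon₇₃ νtop μtop κtop).JZBesselDescents ∧ (canon₇₃ νtop μtop κtop).MitraOffenSpDist ∧ (canon₇₃ νtop μtop κtop).BRWRPoincare) :=
  have b : ∀ N, νtop.Everything N := bookInputs_top.everything
  have m : ∀ N, μtop.Everything N := mokInputs_top.everything
  have KQ := kmswInputs_top μtop
  have s : ∀ N, κtop.Scope N := KQ.1.scope mokInputs_top
  have f : ∀ N, κtop.Full N := KQ.1.full mokInputs_top KQ.2
  periodsPoles_of_rows (canon_implications₇₃ νtop μtop κtop) b m f trivial ⟨b, m, s⟩ b e43_canon_top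

/-- THE CHAPTER-9 NODE IS A GENUINE PREMISE OF C138 AS TYPED: every input granted, Chapter 9 DENIED, every edge valid: C138 FAILS; C132, C137, C134 HOLD. [cite: JiangZhang2021BesselDescents, p0006:L4-5 (pure inner forms), Thm 2.1 (bookkeeping proved here)] -/
theorem periodsPoles_need_ch9_top :
    Implications73 νtop μtop κtop (canon₈no νtop μtop) (canon₄₅ νtop) (canon₅₁ νtop) (canon₇₃no9 νtop μtop κtop) ∧ (¬ (canon₇₃no9 νtop μtop κtop).JZBesselDescents ∧ (canon₇₃no9 νtop μtop κtop).JiangWuChiB ∧ (canon₇₃no9 νtop μtop κtop).MitraOffenSpDist ∧ (canon₇₃no9 νtop μtop κtop).BRWRPoincare) :=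
  have b : ∀ N, νtop.Everything N := bookInputs_top.everything
  have m : ∀ N, μtop.Everything N := mokInputs_top.everything
  have KQ := kmswInputs_top μtop
  have f : ∀ N, κtop.Full N := KQ.1.full mokInputs_top KQ.2
  ⟨canon_implications₇₃no9 _ _ _, ⟨fun h => h.2.1, ⟨m, f⟩, ⟨m, b, e43_canon_top⟩, b⟩⟩

/-- BOOK SIDE, EXACT SUPPORT AS TYPED: in the book countermodel of ANY leaf `l` (Mok and KMSW at the top, Chapter 9 granted; every edge valid) C138, C137 and C134
FAIL and C132 HOLDS — C137 fails through tranche 51's reading of the Mœglin – Tadić classification as « the book » (declared in the edge), C132 has no book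
premise although [MR3135650] heads its list of three. [cite: JiangZhang2021BesselDescents, p0006:L95; BRWR2016Poincare, p0011:L60; JiangWu2016ChiB, p0017:L5 (bookkeeping proved here)] -/
theorem periodsPoles_book_cm (l : LeafSupport.Leaf) :
    Implications73 (LeafSupport.mkN (LeafSupport.cm l)) μtop κtop (canon₈ (LeafSupport.mkN (LeafSupport.cm l)) μtop κtop) (canon₄₅ (LeafSupport.mkN (LeafSupport.cm l))) (canon₅₁ (LeafSupport.mkN (LeafSupport.cm l))) (canon₇₃ (LeafSupport.mkN (LeafSupport.cm l)) μtop κtop) ∧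
      (¬ (canon₇₃ (LeafSupport.mkN (LeafSupport.cm l)) μtop κtop).JZBesselDescents ∧ ¬ (canon₇₃ (LeafSupport.mkN (LeafSupport.cm l)) μtop κtop).MitraOffenSpDist ∧ ¬ (canon₇₃ (LeafSupport.mkN (LeafSupport.cm l)) μtop κtop).BRWRPoincare ∧ (canon₇₃ (LeafSupport.mkN (LeafSupport.cm l)) μtop κtop).JiangWuChiB) ∧
      (∀ l', l' ≠ l → (LeafSupport.mkN (LeafSupport.cm l)).leaf l') ∧ ¬ (LeafSupport.mkN (LeafSupport.cm l)).leaf l :=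
  have cmod := LeafSupport.countermodel l
  have n := not_B_cm l
  have m : ∀ N, μtop.Everything N := mokInputs_top.everything
  have KQ := kmswInputs_top μtop
  have f : ∀ N, κtop.Full N := KQ.1.full mokInputs_top KQ.2
  ⟨canon_implications₇₃ _ _ _, ⟨fun h => n h.1, fun h => n h.2.1, fun h => n h, ⟨m, f⟩⟩, cmod.2.1, cmod.2.2.1⟩

/-- MOK SIDE, EXACT SUPPORT AS TYPED: in Mok's countermodel of ANY of its leaves (book at the top; KMSW read without its import of Mok; Chapter 9 granted; every
edge valid) C132, C138 and C137 FAIL and C134 HOLDS — C138 through row C16's typed Mok premise (its unitary half; declared). [cite: JiangWu2016ChiB, p0017:L59; MitraOffen2021SpDist, p0025:L33; JiangZhang2020, as row C16 (bookkeeping proved here)] -/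
theorem periodsPoles_mok_cm (l : Mok2015.LeafSupport.Leaf) :
    Mok2015.LeafSupport.Systems (Mok2015.LeafSupport.mkN (Mok2015.LeafSupport.cm l)) ∧
      (∀ l', l' ≠ l → (Mok2015.LeafSupport.mkN (Mok2015.LeafSupport.cm l)).leaf l') ∧ ¬ (Mok2015.LeafSupport.mkN (Mok2015.LeafSupport.cm l)).leaf l ∧
      Implications73 νtop (Mok2015.LeafSupport.mkN (Mok2015.LeafSupport.cm l)) κnoMok (canon₈ νtop (Mok2015.LeafSupport.mkN (Mok2015.LeafSupport.cm l)) κnoMok) (canon₄₅ νtop) (canon₅₁ νtop) (canon₇₃ νtop (Mok2015.LeafSupport.mkN (Mok2015.LeafSupport.cm l)) κnoMok) ∧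
      (¬ (canon₇₃ νtop (Mok2015.LeafSupport.mkN (Mok2015.LeafSupport.cm l)) κnoMok).JiangWuChiB ∧ ¬ (canon₇₃ νtop (Mok2015.LeafSupport.mkN (Mok2015.LeafSupport.cm l)) κnoMok).JZBesselDescents ∧ ¬ (canon₇₃ νtop (Mok2015.LeafSupport.mkN (Mok2015.LeafSupport.cm l)) κnoMok).MitraOffenSpDist ∧ (canon₇₃ νtop (Mok2015.LeafSupport.mkN (Mok2015.LeafSupport.cm l)) κnoMok).BRWRPoincare) :=
  have cmod := Mok2015.LeafSupport.countermodel l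
  have nm := not_M_cm l
  have b : ∀ N, νtop.Everything N := bookInputs_top.everything
  ⟨cmod.1, cmod.2.1, cmod.2.2.1, canon_implications₇₃ _ _ _,
    ⟨fun h => nm h.1, fun h => nm h.2.2.2.1, fun h => nm h.1, b⟩⟩

/-- KMSW SIDE, EXACT SUPPORT AS TYPED: book and Mok at the top, KMSW's countermodel of a leaf `l ≠ MokMain` (every KMSW edge valid, the other KMSW leaves true;
Chapter 9 granted; every edge valid): C132 FAILS FOR EVERY SUCH LEAF — KMSW's starred global theorem for the non-generic ψ_σ of an arbitrary U(X) rests on every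
KMSW leaf, both SEQUELS included (Jiang – Wu name no sequel and give no status sentence: the K1 dependence certified as typed); C137 and C134 HOLD (no KMSW
premise); C138 HOLDS iff `l.onlyFull` — through row C16's typed premise `κ.Scope` (declared). [claim: KalethaMinguezShinWhite2014, under-review] [cite: JiangWu2016ChiB, p0004:L1-4, p0017:L31; JiangZhang2020, as row C16 (bookkeeping proved here)] -/
theorem periodsPoles_kmsw_cm (l : KMSW2014.LeafSupport.Leaf) (hl : l ≠ .MokMain) :
    (∃ ωκ, KMSW2014.LeafSupport.Systems (KMSW2014.LeafSupport.mkN (KMSW2014.LeafSupport.cm l)) ωκ) ∧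
      (∀ l', l' ≠ l → (KMSW2014.LeafSupport.mkN (KMSW2014.LeafSupport.cm l)).leaf l') ∧ ¬ (KMSW2014.LeafSupport.mkN (KMSW2014.LeafSupport.cm l)).leaf l ∧
      KMSW2014.E_ImportMok μtop (KMSW2014.LeafSupport.mkN (KMSW2014.LeafSupport.cm l)) ∧
      Implications73 νtop μtop (KMSW2014.LeafSupport.mkN (KMSW2014.LeafSupport.cm l)) (canon₈ νtop μtop (KMSW2014.LeafSupport.mkN (KMSW2014.LeafSupport.cm l))) (canon₄₅ νtop) (canon₅₁ νtop) (canon₇₃ νtop μtop (KMSW2014.LeafSupport.mkN (KMSW2014.LeafSupport.cm l))) ∧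
      (¬ (canon₇₃ νtop μtop (KMSW2014.LeafSupport.mkN (KMSW2014.LeafSupport.cm l))).JiangWuChiB ∧ (canon₇₃ νtop μtop (KMSW2014.LeafSupport.mkN (KMSW2014.LeafSupport.cm l))).MitraOffenSpDist ∧ (canon₇₃ νtop μtop (KMSW2014.LeafSupport.mkN (KMSW2014.LeafSupport.cm l))).BRWRPoincare ∧ ((canon₇₃ νtop μtop (KMSW2014.LeafSupport.mkN (KMSW2014.LeafSupport.cm l))).JZBesselDescents ↔ l.onlyFull = true)) := by
  have cmod := KMSW2014.LeafSupport.countermodel l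
  have b : ∀ N, νtop.Everything N := bookInputs_top.everything
  have m : ∀ N, μtop.Everything N := mokInputs_top.everything
  have nf : ¬ ∀ N, (KMSW2014.LeafSupport.mkN (KMSW2014.LeafSupport.cm l)).Full N :=
    fun h => KMSW2014.LeafSupport.not_full_of_noFull (cmod.2.2.2 0) (h 0)
  have hsc : (∀ N, (KMSW2014.LeafSupport.mkN (KMSW2014.LeafSupport.cm l)).Scope N) ↔ l.onlyFull = true := by
    constructor
    · intro hk
      cases hb : l.onlyFull
      · exact absurd (hk 0) (KMSW2014.LeafSupport.not_scope_of (KMSW2014.LeafSupport.scope_fails l hb 0))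
      · rfl
    · intro h
      exact scope_of_onlyFull l h
  exact ⟨⟨_, cmod.1⟩, cmod.2.1, cmod.2.2.1, fun _ => cmod.2.1 .MokMain (Ne.symm hl), canon_implications₇₃ _ _ _,
    ⟨fun h => nf h.2, ⟨m, b, e43_canon_top⟩, b,
      ⟨fun h => hsc.1 h.2.2.2.2, fun h => ⟨b, trivial, b, m, hsc.2 h⟩⟩⟩⟩

/-- THE SEVENTY-THIRD TRANCHE REGRADED, in one statement: (i) at the top all four hold; (ii) Chapter 9 denied, C138 fails and the others hold; (iii) in the book
countermodel of any leaf C138, C137, C134 fail and C132 holds; (iv) in every Mok countermodel C132, C138, C137 fail and C134 holds; (v) in every KMSW countermodel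
(l ≠ MokMain) C132 fails, C137 and C134 hold, C138 ↔ `l.onlyFull`. [cite: JiangWu2016ChiB, Thm 5.4; JiangZhang2021BesselDescents, Thm 6.1; MitraOffen2021SpDist, Thm 2; BRWR2016Poincare, Thm 1 (bookkeeping proved here)] -/
theorem periodsPoles_regraded :
    ((canon₇₃ νtop μtop κtop).JiangWuChiB ∧ (canon₇₃ νtop μtop κtop).JZBesselDescents ∧ (canon₇₃ νtop μtop κtop).MitraOffenSpDist ∧ (canon₇₃ νtop μtop κtop).BRWRPoincare) ∧
      (¬ (canon₇₃no9 νtop μtop κtop).JZBesselDescents ∧ (canon₇₃no9 νtop μtop κtop).JiangWuChiB ∧ (canon₇₃no9 νtop μtop κtop).MitraOffenSpDist ∧ (canon₇₃no9 νtop μtop κtop).BRWRPoincare) ∧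
      (∀ l : LeafSupport.Leaf, (¬ (canon₇₃ (LeafSupport.mkN (LeafSupport.cm l)) μtop κtop).JZBesselDescents ∧ ¬ (canon₇₃ (LeafSupport.mkN (LeafSupport.cm l)) μtop κtop).MitraOffenSpDist ∧ ¬ (canon₇₃ (LeafSupport.mkN (LeafSupport.cm l)) μtop κtop).BRWRPoincare ∧ (canon₇₃ (LeafSupport.mkN (LeafSupport.cm l)) μtop κtop).JiangWuChiB)) ∧
      (∀ l : Mok2015.LeafSupport.Leaf, (¬ (canon₇₃ νtop (Mok2015.LeafSupport.mkN (Mok2015.LeafSupport.cm l)) κnoMok).JiangWuChiB ∧ ¬ (canon₇₃ νtop (Mok2015.LeafSupport.mkN (Mok2015.LeafSupport.cm l)) κnoMok).JZBesselDescents ∧ ¬ (canon₇₃ νtop (Mok2015.LeafSupport.mkN (Mok2015.LeafSupport.cm l)) κnoMok).MitraOffenSpDist ∧ (canon₇₃ νtop (Mok2015.LeafSupport.mkN (Mok2015.LeafSupport.cm l)) κnoMok).BRWRPoincare)) ∧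
      (∀ l : KMSW2014.LeafSupport.Leaf, l ≠ .MokMain → (¬ (canon₇₃ νtop μtop (KMSW2014.LeafSupport.mkN (KMSW2014.LeafSupport.cm l))).JiangWuChiB ∧ (canon₇₃ νtop μtop (KMSW2014.LeafSupport.mkN (KMSW2014.LeafSupport.cm l))).MitraOffenSpDist ∧ (canon₇₃ νtop μtop (KMSW2014.LeafSupport.mkN (KMSW2014.LeafSupport.cm l))).BRWRPoincare ∧ ((canon₇₃ νtop μtop (KMSW2014.LeafSupport.mkN (KMSW2014.LeafSupport.cm l))).JZBesselDescents ↔ l.onlyFull = true))) :=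
  ⟨seventythird_holds_top, periodsPoles_need_ch9_top.2, fun l => (periodsPoles_book_cm l).2.1, fun l => (periodsPoles_mok_cm l).2.2.2.2,
    fun l hl => (periodsPoles_kmsw_cm l hl).2.2.2.2.2⟩

/-! ## 77. Seventy-fourth tranche (v4 of this file, after `Downstream20.lean` v1; unit `pub-arthur-down-g31`): supports of THE UNITARY SHIMURA – GALOIS
LINE — C33 `RSZHeckeKunneth`, C141 `FPWeaklyRegular`, C140 `BergerWeissSigns`, C136 `JNSRigidFamilies`; see the module docstring for the summary of what is
certified. -/

section Canon74

variable (ν : Nodes) (μ : Mok2015.Nodes) (κ : KMSW2014.Nodes)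

/-- The canonical reading of the seventy-fourth tranche (over `canon`): C33 := Mok ∧ KMSW in full ∧ `canon`'s `AMR` value (the book); C141 := Mok; C140 := Mok ∧ Mok (its two premises); C136 := KMSW's scope. [cite: RapoportSmithlingZhang2020Diagonal, Thm [Morel–Suh] of §(ss:HKproj); FakhruddinPilloni2023Hecke, Thm 9.10; BergerWeiss2022Parities, Thm 2; JohanssonNewtonSorensen2020Rigid, Thm 1.1 (canonical model; bookkeeping)] -/
abbrev canon₇₄ : Consumers74 where
  RSZHeckeKunneth := (∀ N, μ.Everything N) ∧ (∀ N, κ.Full N) ∧ (canon ν μ κ).AMR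
  FPWeaklyRegular := (∀ N, μ.Everything N)
  BergerWeissSigns := (∀ N, μ.Everything N) ∧ (∀ N, μ.Everything N)
  JNSRigidFamilies := (∀ N, κ.Scope N)

/-- Every seventy-fourth-tranche edge holds in the canonical reading, for arbitrary ν, μ, κ. [cite: RapoportSmithlingZhang2020Diagonal, l.2134; FakhruddinPilloni2023Hecke, p0042:L102; BergerWeiss2022Parities, p0009:L31; JohanssonNewtonSorensen2020Rigid, p0008:L16 (bookkeeping proved here)] -/
theorem canon_implications₇₄ : Implications74 μ κ (canon ν μ κ) (canon₇₄ ν μ κ) where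
  rsz := fun m f a => ⟨m, f, a⟩
  fakhruddinPilloni := fun m => m
  bergerWeiss := fun m p => ⟨m, p⟩
  jns := fun s => s

end Canon74

/-- At the top (every input of the three DAGs, KMSW's two sequels granted) all four statements hold — through `unitaryGalois_of_rows`. [cite: RapoportSmithlingZhang2020Diagonal, Thm [Morel–Suh]; JohanssonNewtonSorensen2020Rigid, Thm 1.1 (bookkeeping proved here)] -/
theorem seventyfourth_holds_top : ((canon₇₄ νtop μtop κtop).RSZHeckeKunneth ∧ (canon₇₄ νtop μtop κtop).FPWeaklyRegular ∧ (canon₇₄ νtop μtop κtop).BergerWeissSigns ∧ (canon₇₄ νtop μtop κtop).JNSRigidFamilies) :=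
  have b : ∀ N, νtop.Everything N := bookInputs_top.everything
  have m : ∀ N, μtop.Everything N := mokInputs_top.everything
  have KQ := kmswInputs_top μtop
  have s : ∀ N, κtop.Scope N := KQ.1.scope mokInputs_top
  have f : ∀ N, κtop.Full N := KQ.1.full mokInputs_top KQ.2
  unitaryGalois_of_rows (canon_implications₇₄ νtop μtop κtop) m f s b

/-- BOOK SIDE, EXACT SUPPORT AS TYPED: in the book countermodel of ANY leaf `l` (Mok and KMSW at the top; every edge valid) C33 FAILS — `AMR` is typed ⇐ the book
(Arancibia – Mœglin – Renard's use of [Art13]) — and C141, C140, C136 HOLD (no book premise; [Art13] appears in C136's text as provenance only). [cite: RapoportSmithlingZhang2020Diagonal, l.2134 item 3); JohanssonNewtonSorensen2020Rigid, p0008:L16 (bookkeeping proved here)] -/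
theorem unitaryGalois_book_cm (l : LeafSupport.Leaf) :
    Implications74 μtop κtop (canon (LeafSupport.mkN (LeafSupport.cm l)) μtop κtop) (canon₇₄ (LeafSupport.mkN (LeafSupport.cm l)) μtop κtop) ∧
      (¬ (canon₇₄ (LeafSupport.mkN (LeafSupport.cm l)) μtop κtop).RSZHeckeKunneth ∧ (canon₇₄ (LeafSupport.mkN (LeafSupport.cm l)) μtop κtop).FPWeaklyRegular ∧ (canon₇₄ (LeafSupport.mkN (LeafSupport.cm l)) μtop κtop).BergerWeissSigns ∧ (canon₇₄ (LeafSupport.mkN (LeafSupport.cm l)) μtop κtop).JNSRigidFamilies) ∧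
      (∀ l', l' ≠ l → (LeafSupport.mkN (LeafSupport.cm l)).leaf l') ∧ ¬ (LeafSupport.mkN (LeafSupport.cm l)).leaf l :=
  have cmod := LeafSupport.countermodel l
  have n := not_B_cm l
  have m : ∀ N, μtop.Everything N := mokInputs_top.everything
  have KQ := kmswInputs_top μtop
  have s : ∀ N, κtop.Scope N := KQ.1.scope mokInputs_top
  ⟨canon_implications₇₄ _ _ _, ⟨fun h => n h.2.2, m, ⟨m, m⟩, s⟩, cmod.2.1, cmod.2.2.1⟩

/-- MOK SIDE, EXACT SUPPORT AS TYPED: in Mok's countermodel of ANY of its leaves (book at the top; KMSW read without its import of Mok, so neither its scope nor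
its full statements hold; every edge valid) ALL FOUR statements FAIL. [cite: FakhruddinPilloni2023Hecke, p0048:L112-115; BergerWeiss2022Parities, p0014:L27; RapoportSmithlingZhang2020Diagonal, l.3759; JohanssonNewtonSorensen2020Rigid, p0025:L26 (bookkeeping proved here)] -/
theorem unitaryGalois_mok_cm (l : Mok2015.LeafSupport.Leaf) :
    Mok2015.LeafSupport.Systems (Mok2015.LeafSupport.mkN (Mok2015.LeafSupport.cm l)) ∧
      (∀ l', l' ≠ l → (Mok2015.LeafSupport.mkN (Mok2015.LeafSupport.cm l)).leaf l') ∧ ¬ (Mok2015.LeafSupport.mkN (Mok2015.LeafSupport.cm l)).leaf l ∧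
      Implications74 (Mok2015.LeafSupport.mkN (Mok2015.LeafSupport.cm l)) κnoMok (canon νtop (Mok2015.LeafSupport.mkN (Mok2015.LeafSupport.cm l)) κnoMok) (canon₇₄ νtop (Mok2015.LeafSupport.mkN (Mok2015.LeafSupport.cm l)) κnoMok) ∧
      (¬ (canon₇₄ νtop (Mok2015.LeafSupport.mkN (Mok2015.LeafSupport.cm l)) κnoMok).RSZHeckeKunneth ∧ ¬ (canon₇₄ νtop (Mok2015.LeafSupport.mkN (Mok2015.LeafSupport.cm l)) κnoMok).FPWeaklyRegular ∧ ¬ (canon₇₄ νtop (Mok2015.LeafSupport.mkN (Mok2015.LeafSupport.cm l)) κnoMok).BergerWeissSigns ∧ ¬ (canon₇₄ νtop (Mok2015.LeafSupport.mkN (Mok2015.LeafSupport.cm l)) κnoMok).JNSRigidFamilies) :=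
  have cmod := Mok2015.LeafSupport.countermodel l
  have nm := not_M_cm l
  have kf := κnoMok_facts
  have nk : ¬ ∀ N, κnoMok.Scope N := fun h => kf.2.2.2.2.2.1 0 (h 0)
  ⟨cmod.1, cmod.2.1, cmod.2.2.1, canon_implications₇₄ _ _ _,
    ⟨fun h => nm h.1, nm, fun h => nm h.1, nk⟩⟩

/-- KMSW SIDE, EXACT SUPPORT AS TYPED: book and Mok at the top, KMSW's countermodel of a leaf `l ≠ MokMain` (every KMSW edge valid, the other KMSW leaves true; every
edge valid): C33 FAILS FOR EVERY SUCH LEAF — « [KMSW] (and its sequels) … known » rests on every KMSW leaf, the two SEQUELS included (the EXCEEDS word certified as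
typed); C141 and C140 HOLD (Mok only); C136 HOLDS iff `l.onlyFull` — KMSW's PROVED scope, exactly the authors' Remark 2.1. [claim: KalethaMinguezShinWhite2014, under-review] [cite: RapoportSmithlingZhang2020Diagonal, l.2134; JohanssonNewtonSorensen2020Rigid, Rem. 2.1 (p0008:L19-20) (bookkeeping proved here)] -/
theorem unitaryGalois_kmsw_cm (l : KMSW2014.LeafSupport.Leaf) (hl : l ≠ .MokMain) :
    (∃ ωκ, KMSW2014.LeafSupport.Systems (KMSW2014.LeafSupport.mkN (KMSW2014.LeafSupport.cm l)) ωκ) ∧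
      (∀ l', l' ≠ l → (KMSW2014.LeafSupport.mkN (KMSW2014.LeafSupport.cm l)).leaf l') ∧ ¬ (KMSW2014.LeafSupport.mkN (KMSW2014.LeafSupport.cm l)).leaf l ∧
      KMSW2014.E_ImportMok μtop (KMSW2014.LeafSupport.mkN (KMSW2014.LeafSupport.cm l)) ∧
      Implications74 μtop (KMSW2014.LeafSupport.mkN (KMSW2014.LeafSupport.cm l)) (canon νtop μtop (KMSW2014.LeafSupport.mkN (KMSW2014.LeafSupport.cm l))) (canon₇₄ νtop μtop (KMSW2014.LeafSupport.mkN (KMSW2014.LeafSupport.cm l))) ∧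
      (¬ (canon₇₄ νtop μtop (KMSW2014.LeafSupport.mkN (KMSW2014.LeafSupport.cm l))).RSZHeckeKunneth ∧ (canon₇₄ νtop μtop (KMSW2014.LeafSupport.mkN (KMSW2014.LeafSupport.cm l))).FPWeaklyRegular ∧ (canon₇₄ νtop μtop (KMSW2014.LeafSupport.mkN (KMSW2014.LeafSupport.cm l))).BergerWeissSigns ∧ ((canon₇₄ νtop μtop (KMSW2014.LeafSupport.mkN (KMSW2014.LeafSupport.cm l))).JNSRigidFamilies ↔ l.onlyFull = true)) := by
  have cmod := KMSW2014.LeafSupport.countermodel l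
  have m : ∀ N, μtop.Everything N := mokInputs_top.everything
  have nf : ¬ ∀ N, (KMSW2014.LeafSupport.mkN (KMSW2014.LeafSupport.cm l)).Full N :=
    fun h => KMSW2014.LeafSupport.not_full_of_noFull (cmod.2.2.2 0) (h 0)
  have hsc : (∀ N, (KMSW2014.LeafSupport.mkN (KMSW2014.LeafSupport.cm l)).Scope N) ↔ l.onlyFull = true := by
    constructor
    · intro hk
      cases hb : l.onlyFull
      · exact absurd (hk 0) (KMSW2014.LeafSupport.not_scope_of (KMSW2014.LeafSupport.scope_fails l hb 0))
      · rfl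
    · intro h
      exact scope_of_onlyFull l h
  exact ⟨⟨_, cmod.1⟩, cmod.2.1, cmod.2.2.1, fun _ => cmod.2.1 .MokMain (Ne.symm hl), canon_implications₇₄ _ _ _,
    ⟨fun h => nf h.2.1, m, ⟨m, m⟩, hsc⟩⟩

/-- THE SEVENTY-FOURTH TRANCHE REGRADED, in one statement: (i) at the top all four hold; (ii) in the book countermodel of any leaf C33 fails and C141, C140, C136
hold; (iii) in every Mok countermodel all four fail; (iv) in every KMSW countermodel (l ≠ MokMain) C33 fails, C141 and C140 hold, C136 ↔ `l.onlyFull`. [cite: RapoportSmithlingZhang2020Diagonal, Thm [Morel–Suh]; FakhruddinPilloni2023Hecke, Thm 9.10; BergerWeiss2022Parities, Thm 2; JohanssonNewtonSorensen2020Rigid, Thm 1.1 (bookkeeping proved here)] -/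
theorem unitaryGalois_regraded :
    ((canon₇₄ νtop μtop κtop).RSZHeckeKunneth ∧ (canon₇₄ νtop μtop κtop).FPWeaklyRegular ∧ (canon₇₄ νtop μtop κtop).BergerWeissSigns ∧ (canon₇₄ νtop μtop κtop).JNSRigidFamilies) ∧
      (∀ l : LeafSupport.Leaf, (¬ (canon₇₄ (LeafSupport.mkN (LeafSupport.cm l)) μtop κtop).RSZHeckeKunneth ∧ (canon₇₄ (LeafSupport.mkN (LeafSupport.cm l)) μtop κtop).FPWeaklyRegular ∧ (canon₇₄ (LeafSupport.mkN (LeafSupport.cm l)) μtop κtop).BergerWeissSigns ∧ (canon₇₄ (LeafSupport.mkN (LeafSupport.cm l)) μtop κtop).JNSRigidFamilies)) ∧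
      (∀ l : Mok2015.LeafSupport.Leaf, (¬ (canon₇₄ νtop (Mok2015.LeafSupport.mkN (Mok2015.LeafSupport.cm l)) κnoMok).RSZHeckeKunneth ∧ ¬ (canon₇₄ νtop (Mok2015.LeafSupport.mkN (Mok2015.LeafSupport.cm l)) κnoMok).FPWeaklyRegular ∧ ¬ (canon₇₄ νtop (Mok2015.LeafSupport.mkN (Mok2015.LeafSupport.cm l)) κnoMok).BergerWeissSigns ∧ ¬ (canon₇₄ νtop (Mok2015.LeafSupport.mkN (Mok2015.LeafSupport.cm l)) κnoMok).JNSRigidFamilies)) ∧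
      (∀ l : KMSW2014.LeafSupport.Leaf, l ≠ .MokMain → (¬ (canon₇₄ νtop μtop (KMSW2014.LeafSupport.mkN (KMSW2014.LeafSupport.cm l))).RSZHeckeKunneth ∧ (canon₇₄ νtop μtop (KMSW2014.LeafSupport.mkN (KMSW2014.LeafSupport.cm l))).FPWeaklyRegular ∧ (canon₇₄ νtop μtop (KMSW2014.LeafSupport.mkN (KMSW2014.LeafSupport.cm l))).BergerWeissSigns ∧ ((canon₇₄ νtop μtop (KMSW2014.LeafSupport.mkN (KMSW2014.LeafSupport.cm l))).JNSRigidFamilies ↔ l.onlyFull = true))) :=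
  ⟨seventyfourth_holds_top, fun l => (unitaryGalois_book_cm l).2.1, fun l => (unitaryGalois_mok_cm l).2.2.2.2,
    fun l hl => (unitaryGalois_kmsw_cm l hl).2.2.2.2.2⟩

/-! ## 78. Seventy-fifth tranche (v5 of this file, after `Downstream20.lean` v2; unit `pub-arthur-down-g31`): supports of UNITARY DESCENT AND MULTIPLICITY
ONE — TWO USES, TWO HYPOTHESES — C125 `JLinPeriods`, C106 `ChaudouardZydorGGP`, C150 `HarrisMultOne` / `HarrisSquareRoot`, C151 `SorensenIhara` /
`SorensenMultOne` / `SorensenLLCFamilies`; see the module docstring for the summary of what is certified. -/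

section Canon75

variable (μ : Mok2015.Nodes) (κ : KMSW2014.Nodes)

/-- The canonical reading of the seventy-fifth tranche (over `canon₃₄`; no book node occurs): C125 := KMSW's scope ∧ Mok; C106 := Mok ∧ KMSW's scope; `HarrisMultOne` := KMSW in full (its supplier edge); C150 Thm 9 := that ∧ `canon₃₄`'s C25 value; the Ihara node := `True` (granted: no supplier in the three DAGs); `SorensenMultOne` := KMSW in full; C151 Thm 1 := the two node values. [cite: Lin2015Periods, Prop. 3.1; ChaudouardZydor2021Transfert, §1.1 Théorème; Harris2021SquareRoot, Hypothesis 2, Thm 9; Sorensen2016Ihara, Hypothesis 1, Thm 1 (canonical model; bookkeeping)] -/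
abbrev canon₇₅ : Consumers75 where
  JLinPeriods := (∀ N, κ.Scope N) ∧ (∀ N, μ.Everything N)
  ChaudouardZydorGGP := (∀ N, μ.Everything N) ∧ (∀ N, κ.Scope N)
  HarrisMultOne := (∀ N, κ.Full N)
  HarrisSquareRoot := (∀ N, κ.Full N) ∧ (canon₃₄ μ κ).BPPlancherel
  SorensenIhara := True
  SorensenMultOne := (∀ N, κ.Full N)
  SorensenLLCFamilies := True ∧ (∀ N, κ.Full N)

/-- Every seventy-fifth-tranche edge holds in the canonical reading, for arbitrary μ, κ. [cite: Lin2015Periods, p0014:L3; ChaudouardZydor2021Transfert, p0006:L2; Harris2021SquareRoot, p0004:L37, p0011:L53; Sorensen2016Ihara, p0015:L1, L17 (bookkeeping proved here)] -/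
theorem canon_implications₇₅ : Implications75 μ κ (canon₃₄ μ κ) (canon₇₅ μ κ) where
  jlin := fun s m => ⟨s, m⟩
  chaudouardZydor := fun m s => ⟨m, s⟩
  harrisHyp := fun f => f
  harris := fun h bp => ⟨h, bp⟩
  sorensenHyp := fun f => f
  sorensen := fun i s => ⟨i, s⟩

/-- `canon₃₄`'s value of C25 (`BPPlancherel`) from Mok's outputs and KMSW's scope (tranche 34's reading unfolds to conjunctions of the two). [cite: BeuzartPlessis2021Plancherel, Thm 5 (canonical model; bookkeeping proved here)] -/
theorem canon₃₄_bpPlancherel_of (m : (∀ N, μ.Everything N)) (s : (∀ N, κ.Scope N)) : (canon₃₄ μ κ).BPPlancherel :=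
  ⟨m, s, ⟨m, s⟩, ⟨m, s, ⟨m, s⟩, ⟨m, s⟩⟩⟩

end Canon75

/-- At the top (every input of Mok's and KMSW's DAGs, KMSW's two sequels granted; the Ihara node granted as `True`) all six non-trivial fields hold — through
`multOne75_of_rows`. [cite: Lin2015Periods, Prop. 3.1; ChaudouardZydor2021Transfert, §1.1 Théorème; Harris2021SquareRoot, Thm 9; Sorensen2016Ihara, Thm 1 (bookkeeping proved here)] -/
theorem seventyfifth_holds_top : ((canon₇₅ μtop κtop).JLinPeriods ∧ (canon₇₅ μtop κtop).ChaudouardZydorGGP ∧ (canon₇₅ μtop κtop).HarrisMultOne ∧ (canon₇₅ μtop κtop).HarrisSquareRoot ∧ (canon₇₅ μtop κtop).SorensenMultOne ∧ (canon₇₅ μtop κtop).SorensenLLCFamilies) :=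
  have m : ∀ N, μtop.Everything N := mokInputs_top.everything
  have KQ := kmswInputs_top μtop
  have s : ∀ N, κtop.Scope N := KQ.1.scope mokInputs_top
  have f : ∀ N, κtop.Full N := KQ.1.full mokInputs_top KQ.2
  multOne75_of_rows (canon_implications₇₅ μtop κtop) m s f (canon₃₄_bpPlancherel_of μtop κtop m s) trivial

/-- BOOK SIDE, EXACT SUPPORT AS TYPED: the reading does not mention the book's nodes, so in the book countermodel of ANY leaf `l` (Mok and KMSW at the top) the
whole tranche still holds — no row of the tranche cites [Art13] for a premise (C151's and C106's texts do not cite the book at all). [cite: Sorensen2016Ihara, p0023:L39; ChaudouardZydor2021Transfert, p0078:L35-41 (bookkeeping proved here)] -/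
theorem multOne_book_cm (l : LeafSupport.Leaf) :
    Implications75 μtop κtop (canon₃₄ μtop κtop) (canon₇₅ μtop κtop) ∧ ((canon₇₅ μtop κtop).JLinPeriods ∧ (canon₇₅ μtop κtop).ChaudouardZydorGGP ∧ (canon₇₅ μtop κtop).HarrisMultOne ∧ (canon₇₅ μtop κtop).HarrisSquareRoot ∧ (canon₇₅ μtop κtop).SorensenMultOne ∧ (canon₇₅ μtop κtop).SorensenLLCFamilies) ∧
      (∀ l', l' ≠ l → (LeafSupport.mkN (LeafSupport.cm l)).leaf l') ∧ ¬ (LeafSupport.mkN (LeafSupport.cm l)).leaf l :=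
  have cmod := LeafSupport.countermodel l
  ⟨canon_implications₇₅ _ _, seventyfifth_holds_top, cmod.2.1, cmod.2.2.1⟩

/-- MOK SIDE, EXACT SUPPORT AS TYPED: in Mok's countermodel of ANY of its leaves (KMSW read without its import of Mok, so neither its scope nor its full statements
hold; every edge valid) ALL SIX non-trivial fields FAIL — the two uses, the two hypotheses through their supplier edges, and the two theorems read through them. [cite: Lin2015Periods, p0091:L51; ChaudouardZydor2021Transfert, p0078:L41; Harris2021SquareRoot, p0013:L50; Sorensen2016Ihara, p0015:L1 (bookkeeping proved here)] -/
theorem multOne_mok_cm (l : Mok2015.LeafSupport.Leaf) :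
    Mok2015.LeafSupport.Systems (Mok2015.LeafSupport.mkN (Mok2015.LeafSupport.cm l)) ∧
      (∀ l', l' ≠ l → (Mok2015.LeafSupport.mkN (Mok2015.LeafSupport.cm l)).leaf l') ∧ ¬ (Mok2015.LeafSupport.mkN (Mok2015.LeafSupport.cm l)).leaf l ∧
      Implications75 (Mok2015.LeafSupport.mkN (Mok2015.LeafSupport.cm l)) κnoMok (canon₃₄ (Mok2015.LeafSupport.mkN (Mok2015.LeafSupport.cm l)) κnoMok) (canon₇₅ (Mok2015.LeafSupport.mkN (Mok2015.LeafSupport.cm l)) κnoMok) ∧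
      (¬ (canon₇₅ (Mok2015.LeafSupport.mkN (Mok2015.LeafSupport.cm l)) κnoMok).JLinPeriods ∧ ¬ (canon₇₅ (Mok2015.LeafSupport.mkN (Mok2015.LeafSupport.cm l)) κnoMok).ChaudouardZydorGGP ∧ ¬ (canon₇₅ (Mok2015.LeafSupport.mkN (Mok2015.LeafSupport.cm l)) κnoMok).HarrisMultOne ∧ ¬ (canon₇₅ (Mok2015.LeafSupport.mkN (Mok2015.LeafSupport.cm l)) κnoMok).HarrisSquareRoot ∧ ¬ (canon₇₅ (Mok2015.LeafSupport.mkN (Mok2015.LeafSupport.cm l)) κnoMok).SorensenMultOne ∧ ¬ (canon₇₅ (Mok2015.LeafSupport.mkN (Mok2015.LeafSupport.cm l)) κnoMok).SorensenLLCFamilies) :=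
  have cmod := Mok2015.LeafSupport.countermodel l
  have nm := not_M_cm l
  have kf := κnoMok_facts
  have nF : ¬ ∀ N, κnoMok.Full N := fun h => kf.2.2.2.2.2.2 0 (h 0)
  ⟨cmod.1, cmod.2.1, cmod.2.2.1, canon_implications₇₅ _ _,
    ⟨fun h => nm h.2, fun h => nm h.1, nF, fun h => nF h.1, nF, fun h => nF h.2⟩⟩

/-- KMSW SIDE, EXACT SUPPORT AS TYPED: Mok at the top, KMSW's countermodel of a leaf `l ≠ MokMain` (every KMSW edge valid, the other KMSW leaves true; every edge
valid): the two USES — C125 (Lin: descent and rank one for TEMPERED π on pure inner forms) and C106 (Chaudouard – Zydor: one supercuspidal place) — HOLD iff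
`l.onlyFull`, KMSW's PROVED scope; the two HYPOTHESES — Harris's Hypothesis 2 (« the sequel to [KMSW] ») and Sorensen's Hypothesis 1 (G attached to a division
algebra: [KMS_B]) — and the theorems read through them FAIL FOR EVERY SUCH LEAF, the two SEQUELS included. [claim: KalethaMinguezShinWhite2014, under-review] [cite: Lin2015Periods, p0033:L33; Harris2021SquareRoot, p0004:L37; Sorensen2016Ihara, p0015:L1 (bookkeeping proved here)] -/
theorem multOne_kmsw_cm (l : KMSW2014.LeafSupport.Leaf) (hl : l ≠ .MokMain) :
    (∃ ωκ, KMSW2014.LeafSupport.Systems (KMSW2014.LeafSupport.mkN (KMSW2014.LeafSupport.cm l)) ωκ) ∧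
      (∀ l', l' ≠ l → (KMSW2014.LeafSupport.mkN (KMSW2014.LeafSupport.cm l)).leaf l') ∧ ¬ (KMSW2014.LeafSupport.mkN (KMSW2014.LeafSupport.cm l)).leaf l ∧
      KMSW2014.E_ImportMok μtop (KMSW2014.LeafSupport.mkN (KMSW2014.LeafSupport.cm l)) ∧
      Implications75 μtop (KMSW2014.LeafSupport.mkN (KMSW2014.LeafSupport.cm l)) (canon₃₄ μtop (KMSW2014.LeafSupport.mkN (KMSW2014.LeafSupport.cm l))) (canon₇₅ μtop (KMSW2014.LeafSupport.mkN (KMSW2014.LeafSupport.cm l))) ∧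
      (((canon₇₅ μtop (KMSW2014.LeafSupport.mkN (KMSW2014.LeafSupport.cm l))).JLinPeriods ↔ l.onlyFull = true) ∧ ((canon₇₅ μtop (KMSW2014.LeafSupport.mkN (KMSW2014.LeafSupport.cm l))).ChaudouardZydorGGP ↔ l.onlyFull = true) ∧ ¬ (canon₇₅ μtop (KMSW2014.LeafSupport.mkN (KMSW2014.LeafSupport.cm l))).HarrisMultOne ∧ ¬ (canon₇₅ μtop (KMSW2014.LeafSupport.mkN (KMSW2014.LeafSupport.cm l))).HarrisSquareRoot ∧ ¬ (canon₇₅ μtop (KMSW2014.LeafSupport.mkN (KMSW2014.LeafSupport.cm l))).SorensenMultOne ∧ ¬ (canon₇₅ μtop (KMSW2014.LeafSupport.mkN (KMSW2014.LeafSupport.cm l))).SorensenLLCFamilies) := by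
  have cmod := KMSW2014.LeafSupport.countermodel l
  have m : ∀ N, μtop.Everything N := mokInputs_top.everything
  have nf : ¬ ∀ N, (KMSW2014.LeafSupport.mkN (KMSW2014.LeafSupport.cm l)).Full N :=
    fun h => KMSW2014.LeafSupport.not_full_of_noFull (cmod.2.2.2 0) (h 0)
  have hsc : (∀ N, (KMSW2014.LeafSupport.mkN (KMSW2014.LeafSupport.cm l)).Scope N) ↔ l.onlyFull = true := by
    constructor
    · intro hk
      cases hb : l.onlyFull
      · exact absurd (hk 0) (KMSW2014.LeafSupport.not_scope_of (KMSW2014.LeafSupport.scope_fails l hb 0))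
      · rfl
    · intro h
      exact scope_of_onlyFull l h
  exact ⟨⟨_, cmod.1⟩, cmod.2.1, cmod.2.2.1, fun _ => cmod.2.1 .MokMain (Ne.symm hl), canon_implications₇₅ _ _,
    ⟨⟨fun h => hsc.1 h.1, fun h => ⟨hsc.2 h, m⟩⟩, ⟨fun h => hsc.1 h.2, fun h => ⟨m, hsc.2 h⟩⟩,
      nf, fun h => nf h.1, nf, fun h => nf h.2⟩⟩

/-- THE SEVENTY-FIFTH TRANCHE REGRADED, in one statement: (i) at the top all six non-trivial fields hold; (ii) in the book countermodel of any leaf they all still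
hold (no book premise); (iii) in every Mok countermodel all six fail; (iv) in every KMSW countermodel (l ≠ MokMain) C125 and C106 ↔ `l.onlyFull`, the two
hypotheses and the two theorems through them fail. [cite: Lin2015Periods, Prop. 3.1; ChaudouardZydor2021Transfert, §1.1 Théorème; Harris2021SquareRoot, Thm 9; Sorensen2016Ihara, Thm 1 (bookkeeping proved here)] -/
theorem multOne75_regraded :
    ((canon₇₅ μtop κtop).JLinPeriods ∧ (canon₇₅ μtop κtop).ChaudouardZydorGGP ∧ (canon₇₅ μtop κtop).HarrisMultOne ∧ (canon₇₅ μtop κtop).HarrisSquareRoot ∧ (canon₇₅ μtop κtop).SorensenMultOne ∧ (canon₇₅ μtop κtop).SorensenLLCFamilies) ∧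
      (∀ l : LeafSupport.Leaf, (¬ (LeafSupport.mkN (LeafSupport.cm l)).leaf l) ∧ ((canon₇₅ μtop κtop).JLinPeriods ∧ (canon₇₅ μtop κtop).ChaudouardZydorGGP ∧ (canon₇₅ μtop κtop).HarrisMultOne ∧ (canon₇₅ μtop κtop).HarrisSquareRoot ∧ (canon₇₅ μtop κtop).SorensenMultOne ∧ (canon₇₅ μtop κtop).SorensenLLCFamilies)) ∧
      (∀ l : Mok2015.LeafSupport.Leaf, (¬ (canon₇₅ (Mok2015.LeafSupport.mkN (Mok2015.LeafSupport.cm l)) κnoMok).JLinPeriods ∧ ¬ (canon₇₅ (Mok2015.LeafSupport.mkN (Mok2015.LeafSupport.cm l)) κnoMok).ChaudouardZydorGGP ∧ ¬ (canon₇₅ (Mok2015.LeafSupport.mkN (Mok2015.LeafSupport.cm l)) κnoMok).HarrisMultOne ∧ ¬ (canon₇₅ (Mok2015.LeafSupport.mkN (Mok2015.LeafSupport.cm l)) κnoMok).HarrisSquareRoot ∧ ¬ (canon₇₅ (Mok2015.LeafSupport.mkN (Mok2015.LeafSupport.cm l)) κnoMok).SorensenMultOne ∧ ¬ (canon₇₅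 (Mok2015.LeafSupport.mkN (Mok2015.LeafSupport.cm l)) κnoMok).SorensenLLCFamilies)) ∧
      (∀ l : KMSW2014.LeafSupport.Leaf, l ≠ .MokMain → (((canon₇₅ μtop (KMSW2014.LeafSupport.mkN (KMSW2014.LeafSupport.cm l))).JLinPeriods ↔ l.onlyFull = true) ∧ ((canon₇₅ μtop (KMSW2014.LeafSupport.mkN (KMSW2014.LeafSupport.cm l))).ChaudouardZydorGGP ↔ l.onlyFull = true) ∧ ¬ (canon₇₅ μtop (KMSW2014.LeafSupport.mkN (KMSW2014.LeafSupport.cm l))).HarrisMultOne ∧ ¬ (canon₇₅ μtop (KMSW2014.LeafSupport.mkN (KMSW2014.LeafSupport.cm l))).HarrisSquareRoot ∧ ¬ (canon₇₅ μtop (KMSW2014.LeafSupport.mkN (KMSW2014.LeafSupport.cm l))).SorensenMultOne ∧ ¬ (canon₇₅ μtop (KMSW2014.LeafSupport.mkN (KMSW2014.LeafSupport.cm l))).SorensenLLCFamilies)) :=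
  ⟨seventyfifth_holds_top, fun l => ⟨(multOne_book_cm l).2.2.2, (multOne_book_cm l).2.1⟩, fun l => (multOne_mok_cm l).2.2.2.2,
    fun l hl => (multOne_kmsw_cm l hl).2.2.2.2.2⟩

/-! ## 79. Seventy-sixth tranche (v5 of this file, after `Downstream20.lean` v2; unit `pub-arthur-down-g31`): supports of THE BOOK AS ANNOUNCED (2011–2013)
AND TWO MODEL CITATIONS OF THE UNITARY CLASSIFICATION — C169 `MoeglinPairesL`, C179 `JLZResidualPoles`, C145 `TakanashiParity`, C30 `DSHermitianParameters`; see the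
module docstring for the summary of what is certified. -/

section Canon76

variable (ν : Nodes) (μ : Mok2015.Nodes) (κ : KMSW2014.Nodes)

/-- The canonical reading of the seventy-sixth tranche, Chapter 9 GRANTED (over `canon₈`): C169 := book ∧ `canon₈`'s node value; C179 := book; C145 := Mok; C30 := KMSW in full. [cite: Moeglin2012PairesL, introduction; JiangLiuZhang2013Poles, Thm 1.2; Takanashi2025Parity, Thm 0.3; DummiganSchoennenbeck2021Feit, §4.3 (canonical model; bookkeeping)] -/
abbrev canon₇₆ : Consumers76 where
  MoeglinPairesL := (∀ N, ν.Everything N) ∧ (canon₈ ν μ κ).InnerTwists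
  JLZResidualPoles := (∀ N, ν.Everything N)
  TakanashiParity := (∀ N, μ.Everything N)
  DSHermitianParameters := (∀ N, κ.Full N)

/-- The reading with the Chapter-9 node DENIED (over `canon₈no`): C169 then carries a `False` conjunct; the other three as in `canon₇₆`. [cite: Moeglin2012PairesL, p0004:L5, p0016:L3 (quasi-splitness assumed at the archimedean places only) (separating model; bookkeeping)] -/
abbrev canon₇₆no9 : Consumers76 where
  MoeglinPairesL := (∀ N, ν.Everything N) ∧ (canon₈no ν μ).InnerTwists
  JLZResidualPoles := (∀ N, ν.Everything N)
  TakanashiParity := (∀ N, μ.Everything N)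
  DSHermitianParameters := (∀ N, κ.Full N)

/-- Every seventy-sixth-tranche edge holds in the Chapter-9-granted reading, for arbitrary ν, μ, κ. [cite: Moeglin2012PairesL, p0003:L3; JiangLiuZhang2013Poles, p0006:L58-59; Takanashi2025Parity, p0013:L9; DummiganSchoennenbeck2021Feit, p0009:L2 (bookkeeping proved here)] -/
theorem canon_implications₇₆ : Implications76 ν μ κ (canon₈ ν μ κ) (canon₇₆ ν μ κ) where
  moeglin := fun b t => ⟨b, t⟩
  jlz := fun b => b
  takanashi := fun m => m
  dummiganSchoennenbeck := fun f => f

/-- The edges also hold in the Chapter-9-denied reading. [cite: Moeglin2012PairesL, p0002:L3 (bookkeeping proved here)] -/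
theorem canon_implications₇₆no9 : Implications76 ν μ κ (canon₈no ν μ) (canon₇₆no9 ν μ κ) where
  moeglin := fun b t => ⟨b, t⟩
  jlz := fun b => b
  takanashi := fun m => m
  dummiganSchoennenbeck := fun f => f

end Canon76

/-- At the top (every input of the three DAGs, KMSW's two sequels and Chapter 9 granted) all four statements hold — through `announced76_of_rows`. [cite: Moeglin2012PairesL, introduction; JiangLiuZhang2013Poles, Thm 1.2; Takanashi2025Parity, Thm 0.3; DummiganSchoennenbeck2021Feit, §4.3 (bookkeeping proved here)] -/
theorem seventysixth_holds_top : ((canon₇₆ νtop μtop κtop).MoeglinPairesL ∧ (canon₇₆ νtop μtop κtop).JLZResidualPoles ∧ (canon₇₆ νtop μtop κtop).TakanashiParity ∧ (canon₇₆ νtop μtop κtop).DSHermitianParameters) :=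
  have b : ∀ N, νtop.Everything N := bookInputs_top.everything
  have m : ∀ N, μtop.Everything N := mokInputs_top.everything
  have KQ := kmswInputs_top μtop
  have f : ∀ N, κtop.Full N := KQ.1.full mokInputs_top KQ.2
  announced76_of_rows (canon_implications₇₆ νtop μtop κtop) b m f trivial

/-- THE CHAPTER-9 NODE IS A GENUINE PREMISE OF C169 AS TYPED: every input granted, Chapter 9 DENIED, every edge valid: C169 FAILS; C179, C145, C30 HOLD. [cite: Moeglin2012PairesL, p0002:L3, p0004:L5 (bookkeeping proved here)] -/
theorem announced76_need_ch9_top :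
    Implications76 νtop μtop κtop (canon₈no νtop μtop) (canon₇₆no9 νtop μtop κtop) ∧ (¬ (canon₇₆no9 νtop μtop κtop).MoeglinPairesL ∧ (canon₇₆no9 νtop μtop κtop).JLZResidualPoles ∧ (canon₇₆no9 νtop μtop κtop).TakanashiParity ∧ (canon₇₆no9 νtop μtop κtop).DSHermitianParameters) :=
  have b : ∀ N, νtop.Everything N := bookInputs_top.everything
  have m : ∀ N, μtop.Everything N := mokInputs_top.everything
  have KQ := kmswInputs_top μtop
  have f : ∀ N, κtop.Full N := KQ.1.full mokInputs_top KQ.2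
  ⟨canon_implications₇₆no9 _ _ _, ⟨fun h => h.2, b, m, f⟩⟩

/-- BOOK SIDE, EXACT SUPPORT AS TYPED: in the book countermodel of ANY leaf `l` (Mok and KMSW at the top, Chapter 9 granted; every edge valid) C169 and C179 FAIL,
C145 and C30 HOLD — Dummigan – Schönnenbeck cite the book only as the O_24 model (« in the light of work of Arthur »), not as a premise. [cite: Moeglin2012PairesL, p0017:L7; JiangLiuZhang2013Poles, p0040:L21-23; DummiganSchoennenbeck2021Feit, p0003:L5 (bookkeeping proved here)] -/
theorem announced76_book_cm (l : LeafSupport.Leaf) :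
    Implications76 (LeafSupport.mkN (LeafSupport.cm l)) μtop κtop (canon₈ (LeafSupport.mkN (LeafSupport.cm l)) μtop κtop) (canon₇₆ (LeafSupport.mkN (LeafSupport.cm l)) μtop κtop) ∧
      (¬ (canon₇₆ (LeafSupport.mkN (LeafSupport.cm l)) μtop κtop).MoeglinPairesL ∧ ¬ (canon₇₆ (LeafSupport.mkN (LeafSupport.cm l)) μtop κtop).JLZResidualPoles ∧ (canon₇₆ (LeafSupport.mkN (LeafSupport.cm l)) μtop κtop).TakanashiParity ∧ (canon₇₆ (LeafSupport.mkN (LeafSupport.cm l)) μtop κtop).DSHermitianParameters) ∧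
      (∀ l', l' ≠ l → (LeafSupport.mkN (LeafSupport.cm l)).leaf l') ∧ ¬ (LeafSupport.mkN (LeafSupport.cm l)).leaf l :=
  have cmod := LeafSupport.countermodel l
  have n := not_B_cm l
  have m : ∀ N, μtop.Everything N := mokInputs_top.everything
  have KQ := kmswInputs_top μtop
  have f : ∀ N, κtop.Full N := KQ.1.full mokInputs_top KQ.2
  ⟨canon_implications₇₆ _ _ _, ⟨fun h => n h.1, fun h => n h, m, f⟩, cmod.2.1, cmod.2.2.1⟩

/-- MOK SIDE, EXACT SUPPORT AS TYPED: in Mok's countermodel of ANY of its leaves (book at the top, Chapter 9 granted; KMSW read without its import of Mok, so its full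
statements fail; every edge valid) C145 and C30 FAIL, C169 and C179 HOLD (Jiang – Liu – Zhang's unitary remark is not part of Theorem 1.2 as typed). [cite: Takanashi2025Parity, p0024:L20-21; DummiganSchoennenbeck2021Feit, p0020:L7; JiangLiuZhang2013Poles, p0007:L7-9 (bookkeeping proved here)] -/
theorem announced76_mok_cm (l : Mok2015.LeafSupport.Leaf) :
    Mok2015.LeafSupport.Systems (Mok2015.LeafSupport.mkN (Mok2015.LeafSupport.cm l)) ∧
      (∀ l', l' ≠ l → (Mok2015.LeafSupport.mkN (Mok2015.LeafSupport.cm l)).leaf l') ∧ ¬ (Mok2015.LeafSupport.mkN (Mok2015.LeafSupport.cm l)).leaf l ∧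
      Implications76 νtop (Mok2015.LeafSupport.mkN (Mok2015.LeafSupport.cm l)) κnoMok (canon₈ νtop (Mok2015.LeafSupport.mkN (Mok2015.LeafSupport.cm l)) κnoMok) (canon₇₆ νtop (Mok2015.LeafSupport.mkN (Mok2015.LeafSupport.cm l)) κnoMok) ∧
      ((canon₇₆ νtop (Mok2015.LeafSupport.mkN (Mok2015.LeafSupport.cm l)) κnoMok).MoeglinPairesL ∧ (canon₇₆ νtop (Mok2015.LeafSupport.mkN (Mok2015.LeafSupport.cm l)) κnoMok).JLZResidualPoles ∧ ¬ (canon₇₆ νtop (Mok2015.LeafSupport.mkN (Mok2015.LeafSupport.cm l)) κnoMok).TakanashiParity ∧ ¬ (canon₇₆ νtop (Mok2015.LeafSupport.mkN (Mok2015.LeafSupport.cm l)) κnoMok).DSHermitianParameters) :=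
  have cmod := Mok2015.LeafSupport.countermodel l
  have nm := not_M_cm l
  have kf := κnoMok_facts
  have nF : ¬ ∀ N, κnoMok.Full N := fun h => kf.2.2.2.2.2.2 0 (h 0)
  have b : ∀ N, νtop.Everything N := bookInputs_top.everything
  ⟨cmod.1, cmod.2.1, cmod.2.2.1, canon_implications₇₆ _ _ _,
    ⟨⟨b, trivial⟩, b, fun h => nm h, nF⟩⟩

/-- KMSW SIDE, EXACT SUPPORT AS TYPED: book and Mok at the top, KMSW's countermodel of a leaf `l ≠ MokMain` (every KMSW edge valid, the other KMSW leaves true;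
Chapter 9 granted; every edge valid): C30 FAILS FOR EVERY SUCH LEAF, the two SEQUELS included — the authors' own flag, certified load-bearing as typed —, C169,
C179 and C145 HOLD. [claim: KalethaMinguezShinWhite2014, under-review] [cite: DummiganSchoennenbeck2021Feit, p0009:L2 (bookkeeping proved here)] -/
theorem announced76_kmsw_cm (l : KMSW2014.LeafSupport.Leaf) (hl : l ≠ .MokMain) :
    (∃ ωκ, KMSW2014.LeafSupport.Systems (KMSW2014.LeafSupport.mkN (KMSW2014.LeafSupport.cm l)) ωκ) ∧
      (∀ l', l' ≠ l → (KMSW2014.LeafSupport.mkN (KMSW2014.LeafSupport.cm l)).leaf l') ∧ ¬ (KMSW2014.LeafSupport.mkN (KMSW2014.LeafSupport.cm l)).leaf l ∧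
      KMSW2014.E_ImportMok μtop (KMSW2014.LeafSupport.mkN (KMSW2014.LeafSupport.cm l)) ∧
      Implications76 νtop μtop (KMSW2014.LeafSupport.mkN (KMSW2014.LeafSupport.cm l)) (canon₈ νtop μtop (KMSW2014.LeafSupport.mkN (KMSW2014.LeafSupport.cm l))) (canon₇₆ νtop μtop (KMSW2014.LeafSupport.mkN (KMSW2014.LeafSupport.cm l))) ∧
      ((canon₇₆ νtop μtop (KMSW2014.LeafSupport.mkN (KMSW2014.LeafSupport.cm l))).MoeglinPairesL ∧ (canon₇₆ νtop μtop (KMSW2014.LeafSupport.mkN (KMSW2014.LeafSupport.cm l))).JLZResidualPoles ∧ (canon₇₆ νtop μtop (KMSW2014.LeafSupport.mkN (KMSW2014.LeafSupport.cm l))).TakanashiParity ∧ ¬ (canon₇₆ νtop μtop (KMSW2014.LeafSupport.mkN (KMSW2014.LeafSupport.cm l))).DSHermitianParameters) :=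
  have cmod := KMSW2014.LeafSupport.countermodel l
  have b : ∀ N, νtop.Everything N := bookInputs_top.everything
  have m : ∀ N, μtop.Everything N := mokInputs_top.everything
  have nf : ¬ ∀ N, (KMSW2014.LeafSupport.mkN (KMSW2014.LeafSupport.cm l)).Full N :=
    fun h => KMSW2014.LeafSupport.not_full_of_noFull (cmod.2.2.2 0) (h 0)
  ⟨⟨_, cmod.1⟩, cmod.2.1, cmod.2.2.1, fun _ => cmod.2.1 .MokMain (Ne.symm hl), canon_implications₇₆ _ _ _,
    ⟨⟨b, trivial⟩, b, m, nf⟩⟩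

/-- THE SEVENTY-SIXTH TRANCHE REGRADED, in one statement: (i) at the top all four hold; (ii) with Chapter 9 denied C169 fails; (iii) in the book countermodel of any leaf
C169 and C179 fail, C145 and C30 hold; (iv) in every Mok countermodel C145 and C30 fail, C169 and C179 hold; (v) in every KMSW countermodel (l ≠ MokMain) C30 fails and
the other three hold. [cite: Moeglin2012PairesL, introduction; JiangLiuZhang2013Poles, Thm 1.2; Takanashi2025Parity, Thm 0.3; DummiganSchoennenbeck2021Feit, §4.3 (bookkeeping proved here)] -/
theorem announced76_regraded :
    ((canon₇₆ νtop μtop κtop).MoeglinPairesL ∧ (canon₇₆ νtop μtop κtop).JLZResidualPoles ∧ (canon₇₆ νtop μtop κtop).TakanashiParity ∧ (canon₇₆ νtop μtop κtop).DSHermitianParameters) ∧ ¬ (canon₇₆no9 νtop μtop κtop).MoeglinPairesL ∧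
      (∀ l : LeafSupport.Leaf, (¬ (canon₇₆ (LeafSupport.mkN (LeafSupport.cm l)) μtop κtop).MoeglinPairesL ∧ ¬ (canon₇₆ (LeafSupport.mkN (LeafSupport.cm l)) μtop κtop).JLZResidualPoles ∧ (canon₇₆ (LeafSupport.mkN (LeafSupport.cm l)) μtop κtop).TakanashiParity ∧ (canon₇₆ (LeafSupport.mkN (LeafSupport.cm l)) μtop κtop).DSHermitianParameters)) ∧
      (∀ l : Mok2015.LeafSupport.Leaf, ((canon₇₆ νtop (Mok2015.LeafSupport.mkN (Mok2015.LeafSupport.cm l)) κnoMok).MoeglinPairesL ∧ (canon₇₆ νtop (Mok2015.LeafSupport.mkN (Mok2015.LeafSupport.cm l)) κnoMok).JLZResidualPoles ∧ ¬ (canon₇₆ νtop (Mok2015.LeafSupport.mkN (Mok2015.LeafSupport.cm l)) κnoMok).TakanashiParity ∧ ¬ (canon₇₆ νtop (Mok2015.LeafSupport.mkN (Mok2015.LeafSupport.cm l)) κnoMok).DSHermitianParameters)) ∧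
      (∀ l : KMSW2014.LeafSupport.Leaf, l ≠ .MokMain → ((canon₇₆ νtop μtop (KMSW2014.LeafSupport.mkN (KMSW2014.LeafSupport.cm l))).MoeglinPairesL ∧ (canon₇₆ νtop μtop (KMSW2014.LeafSupport.mkN (KMSW2014.LeafSupport.cm l))).JLZResidualPoles ∧ (canon₇₆ νtop μtop (KMSW2014.LeafSupport.mkN (KMSW2014.LeafSupport.cm l))).TakanashiParity ∧ ¬ (canon₇₆ νtop μtop (KMSW2014.LeafSupport.mkN (KMSW2014.LeafSupport.cm l))).DSHermitianParameters)) :=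
  ⟨seventysixth_holds_top, announced76_need_ch9_top.2.1, fun l => (announced76_book_cm l).2.1, fun l => (announced76_mok_cm l).2.2.2.2,
    fun l hl => (announced76_kmsw_cm l hl).2.2.2.2.2⟩

end Support

end Downstream

end Literature.NumberTheory.Automorphic.Arthur2013
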